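import Summits.BirchSwinnertonDyer.BirchSwinnertonDyer.Theses.PrintX11a
import Summits.BirchSwinnertonDyer.BirchSwinnertonDyer.Theorems.PrintX11aUpperNonSurjFiveTwoCores
import Summits.BirchSwinnertonDyer.BirchSwinnertonDyer.Theorems.PrintX11aUpperNonSurjFiveDepthStrata
import Literature.NumberTheory.EllipticCurves.BipartiteToricPeriod
import HarnessLib

/-!
# Line «monogen5» for crux U5 = `PrintX11a.UpperNonSurjFive` (item `stmt-BirchSwinnertonDyer-20614`)

bsd-idea-6 (g22 → g44).  The REVISION CHRONICLE rev 2 → rev 14 (≈ 12.8 kB of prose that stood here through rev 14) is ARCHIVED VERBATIM in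
`Lines/monogen5-revlog.md` §L1 (rev 15, g44: both workfiles had reached the 200 000-B `crux write` cap).  One line per revision:
rev 2 g23 (critic V#167 prices) · rev 3 g27 (`p`-scope; the U5@7 data) · rev 4 g28 (row CLEAN7 run by REF) · rev 5 g31 (S4 ⟸ S4♮ ∧ S4ₚ,
kernel-checked; seven stubs since) · rev 6 g35 (KIT-T run; F1″-ord relabel) · rev 7 g36 (PROPOSITION P⁺, §5) · rev 8 g37 (KIT-T‴ + THE CLEAN
CUT §4b) · rev 9 g38 (print audit of P⁺) · rev 10 g39 (THE WIDE CUT §4c) · rev 11 g40 (THE FULL CUT §4d) · rev 12 g41 (THE INTEGRAL READING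
§4e) · rev 13 g42 (NECESSITY §4f: U5 ⟺ Sᶦ ∧ S6 modulo `PrintFacts`) · rev 14 g43 (THE DEFINITE TRANSPLANT §4g: S∂ `ToricPeriodCarrierDepth`)
· rev 15 g44 (HOUSEKEEPING + critic V#182 fold — REV 14 PASS + PASS for the annex S∂, no price; nit N-g9-1 «print BELOW wall (3)» folded in
§4g; N-g9-2 (type the TF1 cover as a conditional glue when it is USED) scheduled; from-scratch decomp pass g44 = found-nothing, six angles,
`Lines/monogen5.md` R15.4; module docstrings only — CODE BYTE-IDENTICAL to rev 14).  This file is PUBLISHED with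
`ledger crux write … Lines/monogen5.lean`, NOT skeleton-checked (W-79); the record skeleton of 20614 stays «gl1cartan5» rev 12
(`b8b3b65fd09f35c5`) with its two open cores C_Ш = `ShaExponentCore` and C_cc = `TamagawaDepthCore`.  BSD is not proved by any of this.

## The line in one paragraph (target: the census-populated core C_cc = «`2 ≤ ord_p ∏ c_ℓ`, `Ш(E)[p] = 0`»)

LEVER: **the winding COFACTOR modulo the universal MONODROMY GENERATOR.**  Let `(E, p)` be a U5 pair (class X11a: `r_an = 0`,
`p ∥ N`, `E[p]` irreducible, non-surjective, unramified at every multiplicative `ℓ ≠ p`; `p ≥ 5`), `ρ̄ = E[p]`, `𝔪` its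
(non-Eisenstein) maximal ideal of the Hecke algebra of level `N`, `T := T_{N,𝔪}` (reduced, local, finite flat over `ℤ_p`; its
`ℚ̄_p`-points are the MEMBERS `h` of the congruence class: newforms of level dividing `N` with `ρ̄_h ≅ ρ̄`, each with its unique
in-`𝔪` stabilisation), `H := H₁(X₀(N), ℤ_p)⁺_𝔪` (free of rank one over `T`, generator `γ`: Wiles Thm. 2.1 ∕ Diamond), and
`e = {0,∞}⁺ ∈ H` the winding element (Manin–Drinfeld at a non-Eisenstein `𝔪`), so `e = η·γ` with `η ∈ T` and
`η(h) = L(h,1)·(stabilisation factors) ∕ Ω_h^{(γ)}` EXACTLY (`Ω_h^{(γ)}` := the period normalised by `γ`; for `h = f_E`: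
`Ω_f^{(γ)} = p-unit · Ω_E`, optimality + Mazur's Manin constant).  A split-multiplicative CARRIER `ℓ₁` (`p ∣ c_{ℓ₁} = v_{ℓ₁}(Δ)`) is
♭ («node prime») if `ℓ₁ = p` or `ℓ₁ ≢ ±1 (mod p)`: then the local deformation ring of `ρ̄|G_{ℓ₁}` on the (unramified ∪ Steinberg)
locus is the node `𝒪[[y, n]]/(y·n)` with `n` = THE monodromy entry, so the inertia ideal `I_{ℓ₁} ⊂ T` (image of
`ker(R_Σ → R_{Σ∖ℓ₁})`) is PRINCIPAL, `I_{ℓ₁} = (n₁)`, `ord_p n₁(f_E) = n_{ℓ₁} := v_p(v_{ℓ₁}(Δ))` (Tate).  The level is CLEAN if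
EVERY multiplicative prime of `E` is ♭; then `T = T_Σ` of Diamond (anemic = full at `𝔪`), `R_Σ = T_Σ` (Diamond 1996 ∕ CSS 1997
Thm. 6.1: arbitrary `Σ`, «semistable at `p`», `ρ̄|G_{ℚ(√p*)}` absolutely irreducible — automatic for the census images
5Ns ∕ 5S4 ∕ 7Ns, an explicit hypothesis in general) at levels `N` and `N/ℓ₁` gives
(P) `ker(T → T_{N/ℓ₁,𝔪'}) = n₁·T`, and the stabilisation identity + dual Ihara (Diamond–Ribet Lemma 4.6, any prime incl.
`ℓ = p`) give (S) `η = ỹ·η̃₁ + n₁·b` with `b ∈ T`, `ỹ = (1 − U_{ℓ₁}⁻¹)·w` vanishing at EVERY member Steinberg at `ℓ₁`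
(`a_{ℓ₁} = +1` is forced on a clean level), `η₁` = the level-`N/ℓ₁` winding element.
(A) AT `f = f_E`: `η(f) = n₁(f)·b(f)` ⟹ `ord_p(L(E,1)/Ω_E) ≥ n_{ℓ₁}` — quantitative level lowering at `p ∥ N`
(Kim–Ota Thm. 1.3 is the `p ∤ N` crystalline analogue; Pollack–Weston Thm. 1.2 at big image); NOT new alone
(= «oldprod5» (D♭)+(W) at one prime IN CONTENT; the proof route — `R = T` principality of the inertia ideal in the FULL local
algebra, no character groups, no product ideal — is different).
(B) NEW — THE COFACTOR IS LOCAL: if `ℓ₂ ≠ ℓ₁` is a second split carrier, take the member `g` := Ribet level-raising at `ℓ₁`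
(Ribet 1990 Thm. 1; Remark 3 for `ℓ₁ = p`) of a member unramified at `ℓ₁, ℓ₂` (Ribet 1990 lowering, twice).  `g` is Steinberg at
`ℓ₁` and unramified at `ℓ₂`, so `ỹ(g) = 0` and `b(g) = η(g)/n₁(g)`; but `η(g) = (1 − 1/α_{ℓ₂}(g°))·unit·η^{(2)}(g°)` (stabilisation
at `ℓ₂`, dual Ihara) with `α_{ℓ₂} ≡ 1 (mod 𝔭)` and `ord η^{(2)}(g°) ≥ ord n₁(g)` by (A) run at level `N/ℓ₂` (R = T at `N/ℓ₂`,
`N/ℓ₁ℓ₂`).  Hence `b(g) ∈ 𝔭_g`, so `b` is a NON-UNIT of the LOCAL ring `T`, so `p ∣ b(f)`: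
`ord_p(L(E,1)/Ω_E) ≥ n_{ℓ₁} + 1`.  With `Ш(E)[p] = 0`, `p ∤ #E(ℚ)` (Irr) and `ord_p Ш_an = ord_p(L/Ω) − v_p ∏c`
(`GL1Cartan.padicValRat_shaAn_eq_sub_tamagawa`) this is the lead's door `ClassX11a.missingUpperBoundAt_of_noPTorsion` on the
RUNG «`v_p ∏c ≤ n_{ℓ₁}` (A) or `v_p ∏c ≤ n_{ℓ₁} + 1` with a second split carrier (B)».

CENSUS (T2 of 20614, `p = 5`): `346560lh1` (`N = 2⁶·3·5·19²`, 5S4, multiplicative primes `{3, 5}` both split carriers,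
`c₃ = 5 = v₃(Δ)`, `c₅ = 10`, `∏c = 100 = L/Ω`, `Ш_an = 1`): `3 ≢ ±1 (mod 5)` ⇒ CLEAN; `ℓ₁ = 3`, `ℓ₂ = 5 = p`:
`v_5(∏c) = 2 ≤ n_3 + 1 = 2` ⇒ ON RUNG (B), handled by stub S3 THROUGH ITS `ℓ₂ = p` BRANCH (V#167: lowering AT `5` in the
finite-flat case, dual Ihara at `ℓ = p`, mechanism (A) at the prime-to-`p` level `N/5 = 69312` in the crystalline ∕ Kim–Ota regime) —
print-composite in `GL₂/ℚ` weight-2 print but an UNTYPED CHAIN in this tree (tree-XL; seat-able now: nothing).  `118080ds1` (`N = 2⁶·3²·5·41`, 5Ns, carriers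
`{5, 41}`, `41 ≡ 1 (mod 5)` a TRIVIAL prime): UNCLEAN ⇒ stub S4 (the Böckle–Khare–Manning regime: Wiles defect `2n_q` at trivial
primes; Kim–Ota: «the tame level condition is inevitable»; rev 5: its conjunct S4ₚ `PrincipalAtPFrame` — the principal prime is `5 = p`
because the only other split carrier, `41`, is trivial, never ♭).  @7 (REF-AUDIT §ZA add. 4, jobs j335917 ∕ j335919, on the five explicit
U5@7 pairs E₁–E₅ of `Lines/finemu5-p7-populated-g4.md` §2, image `N_s(7)`, `N ≈ 10¹⁰`): ALL FIVE levels are UNCLEAN (second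
multiplicative prime `251 ≡ −1` resp. `337 ≡ +1 (mod 7)`); the only C_cc pair among them, E₃ (`t = 18/7`, `D = 6`: `c₇ = 7` split,
`c₂₅₁ = 7` split, `∏c = 98`, `Ш_an = 1`), lies on RUNG (B) with `ℓ₁ = 7 = p`, `ℓ₂ = 251` ⇒ stub S4 (both disjuncts; rev 5: S4ₚ), the same shape as
`118080ds1`@5; S3's domain at `p = 7` (a CLEAN level) requires a twist ramified at every prime of `den*(c,d) = c³ − 4c²d + 3cd² + d³`
(those primes are `≡ ±1 (mod 7)`, never ♭, and `den* = ±1` has no solution with `7 ∣ d ≠ 0`: Thue, 18 solutions) — such pairs exist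
ineffectively (Bump–Friedberg–Hoffstein).  @7 rev 4 (REF g25 ran row MONOGEN5-CLEAN7 as specified — `t = c/(7ℓ₁)`, `|c| ≤ 250`, `ℓ₁ ∈ {2,3,5,11,17,19,23}`
(♭ mod 7 — REF's ERRATUM to the card's list: `13 ≡ −1 (mod 7)` is NOT ♭), the mandatory twist making every `den*`-prime additive and `7`, `ℓ₁`
multiplicative, times toggles `{±1, ±2, ±3, ±6}`, kept iff the multiplicative primes are exactly `{7, ℓ₁}`, BOTH split, root number `+1`; jobs j336063 ∕
j336075 ∕ j336079, scripts `pub/bsd-print-x11a/staging/ref/g25/jobC7/{c7,c7dbg,c7min}.gp`, REF-AUDIT §ZA add. 5): NO such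
candidate has `N ≤ 4·10¹³`; 2116 have `N ≤ 10⁶⁰`; the least is `N = 22911917258064366 ≈ 2.3·10¹⁶` (`ℓ₁ = 2`, `t = 27/14`, twist `−7563`,
`[a₁,a₂,a₃,a₄,a₆] = [1, −1, 1, −43416645704553725882840, −3464450663471982721647216782530469]`, `∏c = 392 = 2³·7²`), then
`N = 569291857418909898` (`t = 39/14`, twist `−543`, `∏c = 392`) and `N = 728287224705659150` (`t = 25/14`, twist `−1931`, `∏c = 588`); all 2116
have `v₇(∏c) = 2` (both carriers of depth exactly 1: rung (B) with `ℓ₂ = 7 = p`, where S3's bound `v₇∏c ≤ n_{ℓ₁} + 1 = 2` would be TIGHT, as at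
`346560lh1`@5).  CAVEATS: membership in U5 (`r_an = 0`, i.e. `L(E_D,1) ≠ 0`) is NOT certified for any of them (sign only), and no instrument of
this card runs at `N ≈ 2.3·10¹⁶` (KIT-M = mod-7 modular symbols at full level: infeasible; one `L`-value needs `√N ≈ 1.5·10⁸`, i.e. ≈ 5·10⁸
Dirichlet coefficients — the heavy row MONOGEN5-CLEAN7-L, which REF has ATTEMPTED as kit job j336085 (PARI `ellL1`, low precision, 2 cores,
18 GB; RUNNING at 22:02Z, result pending: `r_an = 0` would make the `N_min` candidate the first CERTIFIED member of S3's domain at `p = 7`).  So — rev-4 state, SUPERSEDED by «@7 rev 5» below —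
S3@7 is CANDIDATE-INHABITED, UNCERTIFIED (pending j336085) and otherwise INSTRUMENT-FREE; `346560lh1`@5 remains the only runnable S3 instrument.
@7 rev 5 (REF g26, REF-AUDIT §ZA add. 6, 2026-08-29T23:28:33Z; job j336085 `ref25-clean-u5at7-L`, PARI `ellL1`, realbitprecision 48, 2435 s;
evidence #53 `refaudit_ZA6.md` on 20614): for the least candidate `F` (`ℓ₁ = 2`, `t = 27/14`, twist `−7563`;
`N = 22911917258064366 = 2·3⁴·7·1783²·2521²`): `L(F,1) = 0.59059054 ≠ 0`, `Ω = 1.0462559·10⁻⁵`, `#tors = 1`, `w = +1`,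
`Ш_an = 144.00000 = 12²` (`7 ∤`); local data — `2`: I₇ SPLIT (`a₂ = +1`), `c₂ = 7 = v₂(Δ)`, `2 ≢ ±1 (mod 7)` (♭); `7`: I₇ SPLIT (`a₇ = +1`),
`c₇ = 7 = v₇(Δ)`; `3`: II* (`c = 1`); `1783`: III (`c = 2`); `2521`: I₇* (`c = 4`; `2521 ≡ 1 (mod 7)` but ADDITIVE — not multiplicative, hence not a
carrier and no obstruction to cleanliness); `∏c = 392 = 2³·7²`.  Hence `r_an = 0` and `(F, 7)` is a U5@7 PAIR (`7 ∥ N`; `E[7]` irreducible; image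
`⊆ N_s(7)` by the family — trace-zero density `389/663 = 58.7 %` observed vs `58.3 %`; ¬Ram automatic), on a CLEAN level, RUNG (B) with
`ℓ₁ = 2 ≠ p`, `ℓ₂ = 7 = p`, `v₇(∏c) = 2 = n_{ℓ₁} + 1`: INSIDE S3's typed domain, and S3's conclusion `ord₇(L/Ω) ≥ n_{ℓ₁} + 1 = 2` HOLDS WITH
EQUALITY (`ord₇(Ш_an·∏c/#tors²) = ord₇(144·392) = 2`), BSD-consistent with `Ш(F)[7] = 0` — the same tight shape as `346560lh1`@5.  THIS IS THE
FIRST EXPLICIT (certified-numerics) MEMBER of S2 ∕ S3's CLEAN domain at `p = 7`: S3 now has TWO decided instances (`346560lh1`@5, `F`@7), both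
tight, neither anomalous (numerics inside BSD cannot refute a BSD-implied stub — they can only fail to corroborate it; they did not).  Candidates
#2 (`t = 39/14`, `N = 569291857418909898 = 2·3³·7·13²·181²·16493²`) and #3 did not finish inside the job's 2-h cap; not needed.  Row
MONOGEN5-CLEAN7-L of the card is thereby ANSWERED on its «certified member; `ord₇ ≥ 2` corroborates S3» branch; KIT-M ∕ KIT-T stay infeasible at
`N ≈ 2.3·10¹⁶`, so `F`@7 is a MEMBER, not an instrument — `346560lh1`@5 remains the only level at which a BSD-free instrument of this card runs.

STUBS (the only `sorry`s): S1 `PrintFacts` (13 named tree facts, XS) · S2 `PrincipalCarrierDepth` (A, clean; SIZING (V#167 P1):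
print-composite in `GL₂/ℚ` weight-2 print — UNTYPED CHAIN, tree-XL (the tree has no deformation rings, no `R = T`, no `T_𝔪`-module `H₁`); seat-able now: nothing) ·
S3 `SecondCarrierIncrement` (B, clean, `ℓ₁ ≠ p`; THE LOAD-BEARING STUB; SIZING (V#167 P1): print-composite in `GL₂/ℚ` weight-2 print — UNTYPED CHAIN,
tree-XL (the tree has no deformation rings, no `R = T`, no `T_𝔪`-module `H₁`); seat-able now: nothing;
its docstring carries the FACT LEDGER F1–F9 = `R = T` ×4, node local rings, Carayol, mult-one ∕ freeness, dual Ihara, stabilisation,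
Ribet raising ∕ lowering, Manin, with exact hypotheses and the glue) · S4 `TrivialPrimeFrame` (A and B at unclean levels or
with principal prime `p` in (B)) — rev 5 (lens «decomp»): NO LONGER A STUB but the ASSEMBLY NODE of the kernel-checked split
`trivialPrimeFrame_of_split : TrivialLevelNodeFrame → PrincipalAtPFrame → TrivialPrimeFrame`, fed by the two new stubs
· S4♮ `TrivialLevelNodeFrame` (A and B at an UNCLEAN level with ♭ principal prime `ℓ₁ ≠ p`; SIZING: PRINT-COMPOSITE MODULO F1″-ord (rev 6 relabel, V#171 P1 (ii): F1″-ord = Böckle–Khare–Manning II Thm. 6.4 re-run ORDINARY at `p ∥ N` with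
`U_p ∈ T̄`, whose local factor at `p` is the SINGULAR CI node on all of U5 and whose `M_∞` is supported on both `p`-components — research-S,
not a routine variant) — S3's fact ledger
F4–F9 verbatim at level `Γ₀(N)` (F4 = Wiles 1995 Thm. 2.1 = Darmon–Diamond–Taylor Thm. 4.26 (b): multiplicity one at ANY `N` with `p² ∤ N`,
`T_p ∉ 𝔪` — no hypothesis at the primes `q ≠ p`), and F1 ↦ F1″ := `R^τ ≅ T̄^τ` for the FULL `T_{N,𝔪} ∋ U_q` under Böckle–Khare–Manning II's
local conditions (`fun` = unipotent WITH A CHOICE OF FROBENIUS EIGENVALUE at the trivial multiplicative primes, Lemma 6.3: `α_q ↦ U_q`;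
`un` at the other multiplicative `q ≠ p`, incl. `q ≡ −1`; Thm. 6.4: isomorphism, `R^τ ≅ T̄^τ` finite free over `𝒪` (reduced when `Σ^{fun} = ∅` by Thm. 6.4 itself; with the trivial prime in `Σ^{fun}` by Thm. 6.4 +
Coleman–Edixhoven 1998 semisimplicity of `U_q` on the `q`-old part, already inside S1 `PrintFacts` — rev 6 fold of V#171 P1 (iii) ∕ n1)) — IN PRINT ONLY FLAT AT `p ∤ N`;
every U5 pair has `p ∥ N`, so the ORDINARY-at-`p` variant is the ONE unwritten input = the research content of S4♮ (size M for a specialist: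
«not a fundamental limitation of our techniques», loc. cit. §6.1; tree-XXL); regime (g29 memo F3 ∕ `Cruxes/UpperNonSurjFive/TameInstrumentVacuous.lean`,
REF §ZB PASS-AS-PUBLISHED, engine j336718, tame 6 ∕ 6, 0 ∕ 45341 failures): a split multiplicative `q ≡ 1 (mod p)` of a U5 pair has
`ρ̄(Frob_q)` unipotent inside an image of order prime to `p`, so `Frob_q = 1` on `E[p]` — FORCED BKM-trivial (`n_q ≥ 1`) — hence at such `q`
Diamond's `T_Σ ≠ T_{N,𝔪}` (both Frobenius roots `≡ 1`, `U_q ∉ im R_Σ`, the in-`𝔪` stabilisation not unique) while multiplicity one itself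
HOLDS; population (REF §ZB add. 1, job j336774, beyond Cremona; all `r_an = 0`, `v₅∏c = 2 = ord₅(L/Ω)`, `5 ∤ Ш_an`): pairs (6)
`N = 1621384960 = 2⁸·5·13·139·701` (`ℓ₁ = 13`, trivial `ℓ₂ = 701`, room `v₅(700) = 2`, `Ш_an = 9`), (9) `N = 7098049365 = 3·5·11²·61²·1051`
(`ℓ₁ = 3`, `ℓ₂ = 1051`, room 2; the ISOLATE: the lowered levels `N/ℓ₂ ⊃ N/ℓ₁ℓ₂` are CLEAN, so the whole difficulty is F1″ at the two levels
`N ⊃ N/ℓ₁` containing the one trivial prime), (10) `N = 45191735040` (`ℓ₁ = 3`, `ℓ₂ = 7001`, room 3, `Ш_an = 4`); census-empty at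
`p = 5`, `N < 5·10⁵`) and
· S4ₚ `PrincipalAtPFrame` (principal prime `ℓ₁ = p`: (A) at an unclean level, (B) at any level; research-M as S4 was: the ordinary local
ring at `p ∥ N` for `ρ̄|G_{ℚ_p} = ωδ ⊕ δ` as a node «crystalline-ordinary ∪ semistable» with PRINCIPAL Tate coordinate `n_p`,
`ord n_p(f_E) = v_p(v_p(Δ))` (F3, PRINT-CHECK), level raising AT `p` (Ribet 1990 Remark 3), and F1″ on top when the level is unclean;
population `118080ds1`@5 (`ℓ₂ = 41`, room `v₅(40) = 1`), E₃@7 (`ℓ₂ = 251 ≡ −1`: `un`, `n = 0`, not trivial), and pairs (2)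
`N = 28091360 = 2⁵·5·11²·1451` (`t = 26/5`, `D = −4`, `[0,0,0,−162386312,−617024242384]`, carriers `{5, 1451}` both split of depth 1,
`∏c = 100`, `Ш_an = 1`, room `v₅(1450) = 2`), (3) `144263840` (`ℓ₂ = 18401`), (4) `285854240` (`ℓ₂ = 101`), (8) `3502049760` (`ℓ₂ = 101`;
`199 ≡ −1` non-split) of REF §ZB add. 1 — in all six the principal carrier is `p` BECAUSE the other split carrier is trivial or `≡ −1`,
never ♭) · S5
`OffRungResidual` (C_cc off the rung: no ♭ split carrier, or depth pattern beyond `n_{ℓ₁} + 1`; open, typed) · S6 `ShaCoreResidual`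
(the record's C_Ш VERBATIM; open).  Composition `UpperNonSurjFive_of_monogen` concludes `Theses.PrintX11a.UpperNonSurjFive` BY NAME
through the record's rev-12 turnkey `GL1Cartan.upperNonSurjFive_of_elevenFacts_of_twoCores`.

EVERY typed stub S2–S4 is a CONSEQUENCE of BSD (`ord_p(L/Ω) = ord_p #Ш + Σ ord_p c_ℓ ≥ n_{ℓ₁} [+ 1]`, `p ∤ #tors` by Irr), strictly
weaker than U5 (no `#Ш`), and is NOT the crux in costume: it bounds `L/Ω` from below by ONE (resp. ONE-PLUS-ONE) local depth.

Sources (labelled): [corpus: book:cornell1997-modular-forms-fermats-last-theorem p.571–575] Diamond, «An extension of Wiles'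
results», §5 (`T_Σ ⊂ ∏_g 𝒪_g` = image of `R_Σ`), Thm. 6.1 (`R_Σ = T_Σ`, CI, arbitrary `Σ`), §7.3 (kernel of
`T_Σ/I_Σ T_Σ → T_∅` is torsion); [corpus: same book p.437–439] Diamond–Ribet, Thm. 4.5 (freeness = Wiles 2.1), Lemma 4.6 (dual
Ihara surjectivity, incl. `p = ℓ`); [corpus: paper:arxiv-1905.02926 p.3] Kim–Ota Thm. 1.3 + «tame level condition inevitable»;
[corpus: paper:arxiv-2108.09729 p.3–4] Böckle–Khare–Manning Thm. 1.1 (Wiles defect `Σ 2n_q/e` at trivial primes); tree facts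
`ribet1990_levelRaising_pNew` (Ribet 1990 Thm. 1, Remark 3 = raising at `p`), `ribet1990_levelLowering_gamma0_newform_general_of_five_le`,
`ribet1984_iharaLemma`, `mazur_not_dvd_maninConstant_of_odd`, `greenbergVatsal2000_plusSymbol_congruence`; Vatsal 1999
(doi:10.1215/s0012-7094-99-09811-3) canonical periods; [galaxy: no hits for "Tamagawa exponent|quantitative level lowering",
"Wiles defect|Tamagawa exponents|congruence ideals and integral periods" (pdf ∕ panama ∕ crabby)].
[cite: DiamondCSS1997, Thm. 6.1 and §7.3] [cite: DiamondRibetCSS1997, Thm. 4.5, Lemma 4.6] [cite: KimOta2019, Thm. 1.3]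
[cite: BoeckleKhareManning2024, Thm. 1.1] [cite: Ribet1990RaisingLevels, Thm. 1, Remark 3] [cite: Vatsal1999, §1]
[cite: SilvermanATAEC1994, Cor. IV.9.2 (d)] [cite: Miller2011LMS, Def. 1.1]
-/

set_option linter.dupNamespace false

noncomputable section

open scoped Classical

open WeierstrassCurve
  Literature.NumberTheory.EllipticCurves
  Literature.NumberTheory.EllipticCurves.ModularForms
  Literature.NumberTheory.EllipticCurves.Rank1Residual
  Literature.NumberTheory.EllipticCurves.Rank1Residual.Typed
  Literature.NumberTheory.EllipticCurves.SteinWuthrich2013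
  Literature.NumberTheory.EllipticCurves.Kato2004
  Literature.NumberTheory.EllipticCurves.Wuthrich2014
  Summit.BirchSwinnertonDyer.Rank1Residual
  Summit.BirchSwinnertonDyer.BirchSwinnertonDyer.Theses
  Summit.BirchSwinnertonDyer.BirchSwinnertonDyer.Theorems.GL1Cartan

namespace Summit.BirchSwinnertonDyer.BirchSwinnertonDyer.Cruxes.UpperNonSurjFive.MonoGen

/-! ## §1 The objects: monodromy depth, node (♭) primes, clean levels, the two rungs -/

/-- **Monodromy depth `n_ℓ(E) := v_p(v_ℓ(Δ_min))`** — at a split multiplicative `ℓ` this is `v_p(c_ℓ)` and the exact exponent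
`k` with `E[p^k]` unramified (resp. finite flat, `ℓ = p`) at `ℓ`; it is `ord_p` of the universal monodromy generator `n_ℓ`
evaluated at `f_E` (Tate curve, lattice unique up to homothety by Irr). [cite: SilvermanATAEC1994, Cor. IV.9.2 (d) and Thm. V.5.3] -/
def depth (W : WeierstrassCurve ℚ) [W.IsGloballyMinimal] (p ℓ : ℕ) : ℕ :=
  padicValNat p (padicValInt ℓ W.minimalDiscriminantInt)

/-- **♭ («node») prime for `p`:** `ℓ = p`, or `ℓ ≢ ±1 (mod p)`.  At such `ℓ` the Frobenius eigenvalues `{ℓ, 1}` of an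
unramified `ρ̄|G_ℓ` with cyclotomic determinant are distinct from each other and from `{−ℓ, −1}`, `h⁰(G_ℓ, ad⁰ρ̄(1)) = 1`, and the
(unramified ∪ Steinberg) local deformation ring is the node `𝒪[[a,b,n]]/(n·(A − ℓB))`: ONE monodromy coordinate `n`.
At `ℓ ≡ 1` (trivial ∕ principal-series branch) or `ℓ ≡ −1` (`St₋` ∕ supercuspidal branch) this fails.
[cite: DiamondCSS1997, §2–§3 (local classification)] [cite: BoeckleKhareManning2024, Thm. 1.1 (the defect at trivial primes)] -/
def FlatPrime (p ℓ : ℕ) : Prop :=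
  ℓ = p ∨ (ℓ % p ≠ 1 ∧ ℓ % p ≠ p - 1)

/-- **CLEAN LEVEL for `(E, p)`:** every multiplicative prime of `E` is a ♭ prime for `p` (so `Σ` := multiplicative primes ∪ `{p}`
has `N_Σ = N`, the full and anemic Hecke algebras agree at `𝔪`, `T_Σ = T_{N,𝔪}`, and every member Steinberg at a split carrier
`ℓ` has `a_ℓ = +1`).  Kim–Ota: the condition is «inevitable» for the quantitative level-lowering formula.
[cite: KimOta2019, Thm. 1.3 (5) and Rem. 1.17 (3)] -/
def CleanLevel (W : WeierstrassCurve ℚ) (p : ℕ) : Prop :=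
  ∀ (q : ℕ) [Fact q.Prime], W.HasMultiplicativeReductionAtPrime q → FlatPrime p q

/-- **RUNG (A):** some ♭ split-multiplicative prime `ℓ₁` carries ALL the `p`-Tamagawa depth: `v_p ∏c ≤ n_{ℓ₁}`
(one carrier, or the T1 shape «`p^k ∣ c_{ℓ₁}`» with the other carriers absent). [cite: SilvermanATAEC1994, Cor. IV.9.2 (d)] -/
def OnRungA (W : WeierstrassCurve ℚ) [W.IsGloballyMinimal] (p : ℕ) : Prop :=
  ∃ (ℓ : ℕ) (_ : Fact ℓ.Prime), W.HasSplitMultiplicativeReductionAtPrime ℓ ∧ FlatPrime p ℓ ∧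
    padicValNat p W.tamagawaProduct ≤ depth W p ℓ

/-- **RUNG (B):** a ♭ split-multiplicative prime `ℓ₁` and a SECOND split carrier `ℓ₂ ≠ ℓ₁` (`p ∣ v_{ℓ₂}(Δ) = c_{ℓ₂}`) with
`v_p ∏c ≤ n_{ℓ₁} + 1` — the census configuration «two carriers, the second of depth one» (both T2 pairs of 20614).
[cite: SilvermanATAEC1994, Cor. IV.9.2 (d)] -/
def OnRungB (W : WeierstrassCurve ℚ) [W.IsGloballyMinimal] (p : ℕ) : Prop :=
  ∃ (ℓ₁ ℓ₂ : ℕ) (_ : Fact ℓ₁.Prime) (_ : Fact ℓ₂.Prime), W.HasSplitMultiplicativeReductionAtPrime ℓ₁ ∧ FlatPrime p ℓ₁ ∧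
    ℓ₂ ≠ ℓ₁ ∧ W.HasSplitMultiplicativeReductionAtPrime ℓ₂ ∧ p ∣ padicValInt ℓ₂ W.minimalDiscriminantInt ∧
    padicValNat p W.tamagawaProduct ≤ depth W p ℓ₁ + 1

/-! ## §2 The statements of the line -/

/-- **S1 — the thirteen named print facts of the record's turnkey `GL1Cartan.upperNonSurjFive_of_elevenFacts_of_twoCores`, as ONE
conjunction BY NAME** (Stein–Wuthrich 6.1 ×2, Kato 12.4, modularity, Kato §17.13 ×3, Mazur 1978 Cor. 4.1, GZK, Coleman–Edixhoven,
Greenberg–Vatsal, Ribet 1984 Thm. 4.1, Ribet 1990 lowering at `p ≥ 5`). [cite: Kato2004Asterisque, Thm. 12.4 and §17.13]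
[cite: SteinWuthrich2013, Thm. 6.1] [cite: DarmonDiamondTaylor1995, Thm. 3.15] -/
def PrintFacts : Prop :=
  Literature.NumberTheory.EllipticCurves.SteinWuthrich2013.thm61_splitMultiplicative ∧
    Literature.NumberTheory.EllipticCurves.SteinWuthrich2013.thm61_nonsplitMultiplicative ∧
    Literature.NumberTheory.EllipticCurves.Kato2004.thm12_4 ∧
    Literature.NumberTheory.EllipticCurves.ModularForms.exists_isNewformOf ∧
    Literature.NumberTheory.EllipticCurves.Kato2004.exists_multDivisibilityInputs_nonsplit_contra ∧
    Literature.NumberTheory.EllipticCurves.Kato2004.exists_multDivisibilityInputs_split_contra ∧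
    Literature.NumberTheory.EllipticCurves.Kato2004.exists_multDivisibilityInputs_fine_contra ∧
    Literature.NumberTheory.EllipticCurves.ModularForms.mazur_not_dvd_maninConstant_of_odd ∧
    rank_eq_analyticRank_of_analyticRank_le_one ∧
    colemanEdixhoven1998_heckePolynomial_simpleRoots ∧ greenbergVatsal2000_plusSymbol_congruence ∧
    ribet1984_iharaLemma ∧ ribet1990_levelLowering_gamma0_newform_general_of_five_le

/-- Projection (rev 13; critic V#180 nit N-g8-9 — read the conjunction BY NAME, never re-tuple it): modularity (print 4 of 13).
[cite: DarmonDiamondTaylor1995, Thm. 3.15] -/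
theorem PrintFacts.nf (h : PrintFacts) : Literature.NumberTheory.EllipticCurves.ModularForms.exists_isNewformOf :=
  h.2.2.2.1

/-- Projection (rev 13): Mazur's Manin-constant corollary at odd `p` (print 8 of 13). [cite: Mazur1978, Cor. 4.1] -/
theorem PrintFacts.mz (h : PrintFacts) : Literature.NumberTheory.EllipticCurves.ModularForms.mazur_not_dvd_maninConstant_of_odd :=
  h.2.2.2.2.2.2.2.1

/-- Projection (rev 13): Gross–Zagier–Kolyvagin in analytic rank `≤ 1` (print 9 of 13). [cite: Darmon2004, Thm. 3.22] -/
theorem PrintFacts.gzk (h : PrintFacts) : rank_eq_analyticRank_of_analyticRank_le_one :=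
  h.2.2.2.2.2.2.2.2.1

/-- **S2 — (A) PRINCIPAL-CARRIER DEPTH on a CLEAN level (support-grade, not the lever; SIZING (V#167 P1): print-composite in `GL₂/ℚ` weight-2 print —
UNTYPED CHAIN, tree-XL (the tree has no deformation rings, no `R = T`, no `T_𝔪`-module `H₁`); seat-able now: nothing — the inputs are F1–F6, F8, F9 of
S3's FACT LEDGER at the two levels `N`, `N/ℓ`, plus F3 when `ℓ = p`).**  For a U5 pair
`(E, p)` (X11a, `¬Surj`, `p ≥ 5`) on a clean level and ANY split-multiplicative prime `ℓ` of `E` (so `ℓ` is ♭):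
`ord_p(L(E,1)/Ω_E) ≥ n_ℓ = v_p(v_ℓ(Δ))`.  MECHANISM: `η(f) = n_ℓ(f)·b(f)` from (P) `ker(T_{N,𝔪} → T_{N/ℓ,𝔪'}) = n_ℓ·T`
(`R_Σ = T_Σ` at `N` and `N/ℓ`, Diamond Thm. 6.1 + the node local ring; at `ℓ = p`: ordinary ring modulo the Tate-parameter
coordinate = flat ring) and (S) (stabilisation + dual Ihara, Diamond–Ribet Lemma 4.6), `Ω_f^{(γ)} = p`-unit`·Ω_E` (optimality,
Mazur's Manin constant).  A consequence of BSD; strictly weaker than U5.  WHY IT MIGHT FAIL AS A PROOF PLAN: (i) the TW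
non-degeneracy `ρ̄|G_{ℚ(√p*)}` abs. irreducible is an INPUT (automatic for 5Ns ∕ 5S4 ∕ 7Ns, not for every `Irr ∧ ¬Surj` image);
(ii) at `ℓ = p` the identification «flat locus = (n_p = 0)» with `ord n_p(f) = v_p(v_p(Δ))` is print-check (Kim–Ota exclude `p ∣ N`).
In print nearby: Kim–Ota Thm. 1.3 (`p ∤ N`), Pollack–Weston Thm. 1.2 (big image), «oldprod5» (D♭).
[cite: DiamondCSS1997, Thm. 6.1 and §7.3] [cite: DiamondRibetCSS1997, Lemma 4.6] [cite: KimOta2019, Thm. 1.3] [cite: Mazur1978, Cor. 4.1] -/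
def PrincipalCarrierDepth : Prop :=
  ∀ (W : WeierstrassCurve ℚ) [W.IsElliptic] [W.IsGloballyMinimal] (p : ℕ) [Fact p.Prime],
    ClassX11a W p → ¬ Surj W p → 5 ≤ p → CleanLevel W p →
    ∀ (ℓ : ℕ) [Fact ℓ.Prime], W.HasSplitMultiplicativeReductionAtPrime ℓ →
    ∀ t : ℚ, W.entireLFunction 1 / (W.realPeriodRat : ℂ) = (t : ℂ) →
      ((depth W p ℓ : ℕ) : ℤ) ≤ padicValRat p t

/-- **S3 — (B) THE SECOND-CARRIER INCREMENT on a CLEAN level, principal prime `ℓ₁ ≠ p` (THE LOAD-BEARING STUB; NEW as a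
mechanism; SIZING (V#167 P1): print-composite in `GL₂/ℚ` weight-2 print — UNTYPED CHAIN, tree-XL (the tree has no deformation rings, no `R = T`, no
`T_𝔪`-module `H₁`); seat-able now: nothing — of the FACT LEDGER F1–F9 below only fragments of F7 exist in the tree
(`ribet1984_iharaLemma`, lowering at `ℓ ≠ p`, `ribet1990_levelRaising_pNew` UNPROVED); everything else would have to be typed first).**  For a U5 pair
on a clean level, a split-multiplicative `ℓ₁ ≠ p` and a second split CARRIER
`ℓ₂ ≠ ℓ₁` (`p ∣ v_{ℓ₂}(Δ)`; `ℓ₂ = p` allowed): `ord_p(L(E,1)/Ω_E) ≥ n_{ℓ₁} + 1`.  MECHANISM (the cofactor is local):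
`η = ỹ η̃₁ + n₁ b` in `T` (as in S2); the level-raised member `g` (Ribet 1990 Thm. 1 at `ℓ₁ ∤ p·level`, from a member unramified
at `ℓ₁, ℓ₂`) is Steinberg at `ℓ₁` (`a_{ℓ₁}(g) = +1` forced: clean) and unramified at `ℓ₂`, so `b(g) = η(g)/n₁(g)` with
`η(g) = (1 − 1/α_{ℓ₂}(g°))·unit·η^{(N/ℓ₂)}(g°)`, `α_{ℓ₂} ≡ 1`, and `ord η^{(N/ℓ₂)}(g°) ≥ ord n₁(g°) = ord n₁(g)` by S2's mechanism at
level `N/ℓ₂` (`R = T` at `N/ℓ₂` and `N/ℓ₁ℓ₂`; flat at `p` when `ℓ₂ = p`); so `b ∈ 𝔪_T` (`T` LOCAL) and `p ∣ b(f)`.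
Consequence of BSD (`ord c_{ℓ₂} ≥ 1`); strictly weaker than U5; on the census pair `346560lh1` it is exactly what C_cc needs.
WHY IT MIGHT FAIL AS A PROOF PLAN: (i) TW non-degeneracy as in S2; (ii) the exactness `η(h) = W(v_h)/Ω_h^{(γ)}` with ONE generator
`γ` across all members needs freeness of `H₁(X₀(N),ℤ_p)⁺_𝔪` at `p ∥ N` (Wiles 2.1 ordinary-distinguished; `ω ≠ 1` holds) and
the transport of `γ` to levels `N/ℓ₁`, `N/ℓ₂` (dual Ihara at `ℓ₂ = p`: Diamond–Ribet Lemma 4.6 case `p = ℓ`); (iii) nothing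
else: every input is in print for `GL₂/ℚ`, weight 2 (but UNTYPED here, see SIZING).
FACT LEDGER (V#167 P1: the named print inputs, hypotheses exact, whose conjunction ⊢ `SecondCarrierIncrement` by the GLUE below):
F1 [`R = T`] for `ρ̄ = E[p]` (`p ≥ 5`, modular, abs. irreducible, and TW-non-degenerate: `ρ̄|G_{ℚ(√p*)}` abs. irreducible) the map
`R_Σ → T_Σ` is an isomorphism of complete intersections at each of the four levels `N, N/ℓ₁, N/ℓ₂, N/ℓ₁ℓ₂` with the deformation
condition «minimal outside `Σ`, ordinary at `p`» (`p ∥` level) resp. «flat at `p`» (`p ∤` level) — Wiles 1995 Thm. 3.3 + Taylor–Wiles,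
Diamond 1996 (`Σ` arbitrary, CSS Thm. 6.1), Diamond 1997 (mult-one as OUTPUT); F2 [node ring] at a ♭ prime `ℓ ≠ p`, `ℓ ≢ ±1 (mod p)`,
`ρ̄|G_ℓ` unramified with Frobenius eigenvalues `{1, ℓ}`: the «unramified-or-Steinberg» local deformation ring is the transversal union
of the unramified and the Steinberg component, so in `T_{Nℓ-level}` the inertia (monodromy) ideal is PRINCIPAL `(n_ℓ)` and
`ker(T_N → T_{N/ℓ}) = n_ℓ·T_N` once F1 holds at both levels (Diamond CSS §7.3: the kernel of `T_Σ/I_Σ → T_∅` is torsion — and vanishes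
under `R = T` ×2); F3 [`ℓ = p`, used only when the principal prime or the lowered prime is `p`] for `p ∥ N` with `ρ̄|G_{ℚ_p} = ωδ ⊕ δ`
SPLIT (`q_E ∈ (ℚ_p^×)^p`, automatic at `p'`-image): the ordinary ring modulo the Tate-parameter coordinate is the flat ring and
`ord_𝔭 n_p(f_E) = v_p(v_p(Δ))` — PRINT-CHECK (Kim–Ota exclude `p ∣ N`; flagged (ii) of S2); F4 [freeness] `H₁(X₀(M), ℤ_p)^±_𝔪` free
over `T_{M,𝔪}` at all four levels, incl. `p ∥ M` (Wiles 1995 Thm. 2.1: `𝔪` ordinary and `p`-distinguished — here `ω·δ ≠ δ`; Diamond–Ribet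
CSS Thm. 4.5); F5 [dual Ihara ∕ stabilisation] surjectivity of `H₁(X₀(Mq), ℤ_p)_𝔪 → H₁(X₀(M), ℤ_p)²_𝔪` for `q ∤ M`, INCLUDING `q = p`
(Ribet 1984 = tree fact `ribet1984_iharaLemma` for `q ∤ pM`; Diamond–Ribet CSS Lemma 4.6 and Wiles 1995 Lemma 2.5 for `q = p`), giving
`η_{Mq} = ỹ·η̃_q + n_q·b` with `ỹ = (1 − U_q⁻¹)w`; F6 [Carayol ∕ Tate] for a member `h` Steinberg at `ℓ`: `ord_𝔭 n_ℓ(h)` = the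
`ℓ`-ramification depth of `ρ_h|I_ℓ`, intrinsic (same at every level where `h` occurs), and `= v_p(v_ℓ(Δ_E)) = depth` at `h = f_E`
(Tate curve; [cite: SilvermanATAEC1994, Cor. IV.9.2 (d)]); F7 [Ribet] lowering at `ℓ₂` and at `ℓ₁` (`ρ̄` unramified there; at `ℓ = p`:
`ρ̄` finite at `p` — tree fact `ribet1990_levelLowering_gamma0_newform_general_of_five_le` covers `ℓ ≠ p` only) and raising at
`ℓ₁ ∤ p·N/ℓ₁ℓ₂` from a level-`N/ℓ₁ℓ₂` member (Ribet 1990 ICM Thm. 1, tree fact `ribet1990_levelRaising_pNew` UNPROVED; sign `a_{ℓ₁}(g) = +1`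
forced on a clean level since `{−ℓ₁, −1} ≢ {1, ℓ₁}`); F8 [periods] ONE generator `γ` of the free module transported through F5 defines
`Ω_h^{(γ)}` for every member; at the optimal `f_E`: `Ω_{f_E}^{(γ)} = u·Ω_E`, `u ∈ ℤ_(p)^×` (Manin constant prime to `p` for `p ≥ 5`,
`p² ∤ 4N`: tree fact `mazur_not_dvd_maninConstant_of_odd`; Vatsal 1999 §1 canonical periods); F9 [winding identity] for every member `h`
at level `M'`: `η_{M'}(h)·Ω_h^{(γ)} ≐ L(h,1)·∏_{q ∣ M', q-old for h}(stabilisation factor `1 − α_q(h)⁻¹` or its dual)` up to `p`-units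
(Mazur's winding element; Vatsal 1999 §§1–2; Greenberg–Vatsal 2000 §3 = tree fact `greenbergVatsal2000_plusSymbol_congruence` for the
plus symbol).  GLUE: F7 ⇒ the member `g` (level `N/ℓ₂`, `ℓ₁`-new, `ℓ₂`-unramified, with newform `g°`); F1 ×2 + F2 + F4 + F5 at `ℓ₁` ⇒
`η_N = ỹ η̃₁ + n₁ b` in `T_{N,𝔪}` and, at `g` (Steinberg at `ℓ₁` ⇒ `ỹ(g) = 0`), `b(g) = η_N(g)/n₁(g)`; F5 + F9 at `ℓ₂` ⇒
`η_N(g) = (1 − α_{ℓ₂}(g°)⁻¹)·u·η_{N/ℓ₂}(g°)` with `α_{ℓ₂} ≡ 1 (mod 𝔭)` (clean: the unit root of `ρ̄(Frob_{ℓ₂}) ∼ {1, ℓ₂}` resp. `δ(Frob_p) = 1`);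
F1 ×2 + F2 + F4 at levels `N/ℓ₂ ⊃ N/ℓ₁ℓ₂` (mechanism (A)) ⇒ `ord η_{N/ℓ₂}(g°) ≥ ord n₁(g°)`, and F6 ⇒ `ord n₁(g°) = ord n₁(g)`; hence
`b(g) ∈ 𝔭_g`, so `b ∉ T^×`, so `b ∈ 𝔪_T` (`T_𝔪 → 𝒪_g`, `T_𝔪 → ℤ_p` LOCAL), so `p ∣ b(f_E)`; F6 + F8 + F9 at `f_E` (new at every `q ∣ N`:
no stabilisation factor) ⇒ `ord_p(L(E,1)/Ω_E) = ord η_N(f_E) = ord n₁(f_E) + ord b(f_E) ≥ n_{ℓ₁} + 1` ∎.  CENSUS BRANCH (V#167): at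
`346560lh1` (`ℓ₁ = 3`, `ℓ₂ = 5 = p` split, `N/5 = 69312 = 2⁶·3·19²`, `N/15 = 23104`) the chain runs through the `ℓ₂ = p` branch —
F7 lowering AT `p` (finite-flat case), F5 dual Ihara at `q = p`, F9's factor `1 − α_5(g°)⁻¹` with `α_5 ≡ a_5(E) = 1`, and mechanism (A)
at the prime-to-`p` levels `69312 ⊃ 23104` (flat-at-`5` deformation condition = the crystalline regime where Kim–Ota Thm. 1.3 is
stated verbatim); F3 is NOT used on this branch (the principal prime is `3 ≠ p`).
Cheapest falsifier (V#167 n1 sizing): [KIT-M as first stated — the `𝔪`-adic modular-symbol space at FULL level `346560` has index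
≈ 8.7·10⁵, weight-2 dimension ≈ 7·10⁴: sparse mod-5 linear algebra, hours] ∕ [KIT-S when run at the LOWERED levels only, via the
displayed factorisation: `η_{69312}(g°)`, `n₃(g°)`, `α_5(g°)` at level `69312 = 23104·3`, and the doubly-lowered member at level `23104`,
which is RATIONAL — the optimal curve `23104bd1` (llzero5 census row) — so listing the class there is a table LOOKUP]: exhibit the
`3`-new `5`-old member `g°` and check `ord_5 (η_{69312}(g°)) ≥ ord_5 n₃(g°) + 0` and `b(g) ≡ 0 (mod 𝔭)`, equivalently
`ord_5 (L(g°,1)·(1 − α_5(g°)⁻¹)/Ω_{g°}^{(γ)}) ≥ ord_5 n₃(g°) + 1`.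
[cite: DiamondCSS1997, Thm. 6.1] [cite: DiamondRibetCSS1997, Thm. 4.5, Lemma 4.6] [cite: Ribet1990RaisingLevels, Thm. 1]
[cite: Vatsal1999, §1] [cite: KimOta2019, Thm. 1.3] -/
def SecondCarrierIncrement : Prop :=
  ∀ (W : WeierstrassCurve ℚ) [W.IsElliptic] [W.IsGloballyMinimal] (p : ℕ) [Fact p.Prime],
    ClassX11a W p → ¬ Surj W p → 5 ≤ p → CleanLevel W p →
    ∀ (ℓ₁ ℓ₂ : ℕ) [Fact ℓ₁.Prime] [Fact ℓ₂.Prime], ℓ₁ ≠ p →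
      W.HasSplitMultiplicativeReductionAtPrime ℓ₁ → ℓ₂ ≠ ℓ₁ → W.HasSplitMultiplicativeReductionAtPrime ℓ₂ →
      p ∣ padicValInt ℓ₂ W.minimalDiscriminantInt →
    ∀ t : ℚ, W.entireLFunction 1 / (W.realPeriodRat : ℂ) = (t : ℂ) →
      ((depth W p ℓ₁ : ℕ) : ℤ) + 1 ≤ padicValRat p t

/-- **S4 — (A♯)+(B♯) THE TRIVIAL-PRIME FRAME (research-M; the `118080ds1` half of the `p = 5` census; rev 3: TWO known
instances — `118080ds1`@5 with `q = 41 ≡ +1 (mod 5)` a BKM-TRIVIAL prime (Frobenius trivial on `E[5]`: REF jobs j334833 Tate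
parameter, j335552 CM bottom `x³ − 27x`), and E₃@7 (`t = 18/7`, `D = 6`) with `q = 251 ≡ −1 (mod 7)`, the SIGN-COINCIDENT sub-case
(`ρ̄(Frob₂₅₁) ∼ diag(1, −1)`, NOT a trivial prime: the extra components are `St₋` and the depth-zero supercuspidals of conductor
`251²` from the order-`7` characters of the non-split torus, `7 ∥ 252`); in BOTH the principal carrier is `p` itself; rev 5 (text only):
by the g29 memo F3 ∕ `TameInstrumentVacuous.lean` (REF §ZB PASS) EVERY split multiplicative `q ≡ 1 (mod p)` of a U5 pair is BKM-trivial
(`Frob_q = 1` on `E[p]`, forced by the `p′`-image), and REF §ZB add. 1 (job j336774) adds SEVEN explicit `r_an = 0` C_cc-sector U5@5 pairs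
beyond Cremona (`v₅∏c = 2 = ord₅(L/Ω)`, `5 ∤ Ш_an`), all UNCLEAN through a split trivial carrier with ROOM `v₅(q − 1) ≥ 2`: four of the
`118080ds1` shape (`ℓ₁ = 5 = p`; `q ∈ {1451, 18401, 101, 101}`, e.g. `N = 28091360 = 2⁵·5·11²·1451`, `t = 26/5`, `D = −4`, `∏c = 100`,
`Ш_an = 1`) and THREE with a ♭ principal prime `ℓ₁ ≠ p` whose second carrier is the trivial one (`(ℓ₁, q) ∈ {(13, 701), (3, 1051), (3, 7001)}`,
`N = 1621384960`, `7098049365 = 3·5·11²·61²·1051`, `45191735040`) — the first explicit members of the second conjunct's `¬ CleanLevel`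
disjunct with `ℓ₁ ≠ p`; at `N = 7098049365` the lowered levels `N/ℓ₂`, `N/ℓ₁ℓ₂` are CLEAN (multiplicative primes `3` ♭, `5 = p`), so the
level-`N/ℓ₂` half of S3's mechanism holds as on a clean level and the WHOLE difficulty sits in the full-level step at the ONE trivial prime
`ℓ₂ = 1051` (Diamond's `T_Σ ≠ T_{N,𝔪}` there: `U_{ℓ₂} ∉ im R_Σ`, both Frobenius roots `≡ 1`, the in-`𝔪` stabilisation not unique;
multiplicity one itself holds, Wiles Thm. 2.1) — the trivial-prime obstruction isolated at a single prime with room `2`; rev 5 DECOMP (the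
seat's lens): this `def` is now the ASSEMBLY NODE of the split S4 ⟸ S4♮ `TrivialLevelNodeFrame` ∧ S4ₚ `PrincipalAtPFrame`, PROVED below
as `trivialPrimeFrame_of_split`; S4♮ is PRINT-COMPOSITE MODULO F1″-ord (rev 6 relabel of «print-adjacent»; research-S) because Böckle–Khare–Manning II, Lemma 6.3 + Thm. 6.4, supply exactly the
missing surjection `R^{fun}_{ℓ₂} ↠ T[U_{ℓ₂}]`, `α ↦ U_{ℓ₂}`, at `p ∤ N` flat — see the two docstrings below).**  The conclusions of S2 and S3 at
a ♭ principal prime `ℓ₁` when the level is NOT clean (some multiplicative `q ≡ ±1 (mod p)`, `q ≠ p`: then `T_Σ ≠ T_N` —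
principal-series components at `q²` when `q ≡ 1`, `St₋` ∕ supercuspidal when `q ≡ −1` — the full algebra needs `U_q ∉ im R`, and
`T^{st}` at a trivial prime carries the Böckle–Khare–Manning Wiles defect `2n_q`; the U_q = 0 depletion costs exactly `v_p(q−1)`),
or in (B) with principal prime `ℓ₁ = p` (level raising AT `p`: Ribet 1990 Remark 3).  Instrument: `118080ds1` (`ℓ₁ = 5 = p`,
`ℓ₂ = 41 ≡ 1 (mod 5)`, `v_5(∏c) = 2 = n_5 + 1`).  WHY IT MIGHT FAIL: the transfer of (P) from `T_Σ` to `T_{N,𝔪}` may acquire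
torsion supported on the extra components (Kim–Ota: the formula fails without the tame condition), so the «+1» may need the
depth of `41` to be read on `T_Σ` rather than `T_N`.  Consequence of BSD; strictly weaker than U5.
[cite: BoeckleKhareManning2024, Thm. 1.1, Lemma 6.3 and Thm. 6.4] [cite: KimOta2019, Rem. 1.17 (3)] [cite: Ribet1990RaisingLevels, Remark 3] -/
def TrivialPrimeFrame : Prop :=
  (∀ (W : WeierstrassCurve ℚ) [W.IsElliptic] [W.IsGloballyMinimal] (p : ℕ) [Fact p.Prime],
      ClassX11a W p → ¬ Surj W p → 5 ≤ p → ¬ CleanLevel W p →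
      ∀ (ℓ : ℕ) [Fact ℓ.Prime], W.HasSplitMultiplicativeReductionAtPrime ℓ → FlatPrime p ℓ →
      ∀ t : ℚ, W.entireLFunction 1 / (W.realPeriodRat : ℂ) = (t : ℂ) →
        ((depth W p ℓ : ℕ) : ℤ) ≤ padicValRat p t) ∧
  (∀ (W : WeierstrassCurve ℚ) [W.IsElliptic] [W.IsGloballyMinimal] (p : ℕ) [Fact p.Prime],
      ClassX11a W p → ¬ Surj W p → 5 ≤ p →
      ∀ (ℓ₁ ℓ₂ : ℕ) [Fact ℓ₁.Prime] [Fact ℓ₂.Prime], (¬ CleanLevel W p ∨ ℓ₁ = p) →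
        W.HasSplitMultiplicativeReductionAtPrime ℓ₁ → FlatPrime p ℓ₁ → ℓ₂ ≠ ℓ₁ →
        W.HasSplitMultiplicativeReductionAtPrime ℓ₂ → p ∣ padicValInt ℓ₂ W.minimalDiscriminantInt →
      ∀ t : ℚ, W.entireLFunction 1 / (W.realPeriodRat : ℂ) = (t : ℂ) →
        ((depth W p ℓ₁ : ℕ) : ℤ) + 1 ≤ padicValRat p t)

/-- **S4♮ — (A)+(B) AT AN UNCLEAN LEVEL WITH ♭ PRINCIPAL PRIME `ℓ₁ ≠ p` (rev 5, lens «decomp»: the first conjunct of the split of S4;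
SIZING: PRINT-COMPOSITE MODULO F1″-ord, research-S (rev 6 relabel of «print-adjacent», V#171 P1 (ii)) — print-composite in `GL₂/ℚ`
weight-2 print EXCEPT FOR the unwritten ORDINARY-at-`p ∥ N` variant F1″ with singular (CI-node) local factor at `p`; UNTYPED CHAIN, tree-XXL;
seat-able now: nothing).**  For a U5 pair whose level is NOT clean (some multiplicative `q ≡ ±1 (mod p)`, `q ≠ p`), a ♭ split-multiplicative
`ℓ₁ ≠ p` [and in (B) a second split carrier `ℓ₂ ≠ ℓ₁`, `p ∣ v_{ℓ₂}(Δ)`]: `ord_p(L(E,1)/Ω_E) ≥ n_{ℓ₁}` [resp. `≥ n_{ℓ₁} + 1`].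
MECHANISM = S2 ∕ S3 VERBATIM; the ONLY input that changes is the presentation of the full Hecke algebra.  At a clean level S2 ∕ S3 use
Diamond's `R_Σ = T_Σ = T_{N,𝔪}` (F1); at an unclean level `T_Σ ≠ T_{N,𝔪}` (Diamond's level `N_Σ ⊋ N`: principal series at `q²` for
`q ≡ 1`, `St₋` ∕ supercuspidal for `q ≡ −1`), and at a TRIVIAL `q` (`ρ̄|G_q = 1`, `q ≡ 1 (mod p)` — by the g29 memo F3 EVERY split
multiplicative `q ≡ 1 (mod p)` of a U5 pair, forced by the `p′`-image) `U_q ∉ im R_Σ` (both Frobenius roots `≡ 1`).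
FACT LEDGER″ (replacing F1, F2 of S3's ledger; F3 unused since `ℓ₁ ≠ p`; F4–F9 VERBATIM — F4 = Wiles 1995 Thm. 2.1 =
Darmon–Diamond–Taylor Thm. 4.26 (b): `dim J₀(N)[𝔪] = 2` for ANY `N` with `p² ∤ N`, `ρ_𝔪` irreducible and `T_p ∉ 𝔪`, NO hypothesis at the
primes `q ≠ p` of `N`, so `H₁(X₀(M), ℤ_p)^±_𝔪` is free of rank one over the FULL `T_{M,𝔪}` at every level `M` of the chain — multiplicity one
is NOT the obstruction at a trivial prime):
F1″ [`R^τ ≅ T̄^τ`, Böckle–Khare–Manning II §6] for `F = ℚ`, `D = M₂(ℚ)` (`Σ^{st} = ∅`), `ρ̄ = E[p]` (Taylor–Wiles conditions only: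
`ρ̄|G_{ℚ(ζ_p)}` abs. irreducible — automatic for the FULL groups 5Ns ∕ 5S4 ∕ 7Ns (LEAD g4∕g6 image classification: `im ∩ SL₂ = {diag(a,a⁻¹)} ∪`
antidiagonals, resp. `2A₄ ⊂ SL₂(𝔽₅)` — absolutely irreducible), not from `Irr ∧ ¬Surj` alone (rev 6, V#171 n2); NO big-image hypothesis, unlike Kim–Ota ∕ Pollack–Weston ∕ arXiv:2408.15410),
local conditions `τ_q = fun` at the trivial multiplicative primes (Calegari's ring `R_q^{fun}` of unipotent liftings WITH A CHOICE OF FROBENIUS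
EIGENVALUE: Gorenstein, reduced, flat of relative dimension 3, two components «unramified-with-choice ∪ Steinberg» — Prop. 4.6 (5), §5),
`τ_q = un` at the other multiplicative `q ≠ p` (♭, or `q ≡ −1`: `n_q = 0`), `τ_v = min` at the additive primes (non-vexing; vexing ones with
Diamond's level structure), level `K_q = U₀(q)`: THEN `R^τ → T̄^τ := T^τ[U_q : q ∈ Σ^{fun}]_𝔪` is an ISOMORPHISM, `R^τ ≅ T̄^τ` finite free over `𝒪` (reduced when `Σ^{fun} = ∅` by Thm. 6.4 itself; with the trivial prime in `Σ^{fun}` by Thm. 6.4 +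
Coleman–Edixhoven 1998 semisimplicity of `U_q` on the `q`-old part, already inside S1 `PrintFacts` — rev 6 fold of V#171 P1 (iii) ∕ n1)
free over `𝒪` (Thm. 6.4), mapping the universal Frobenius root `α_q ↦ U_q` (Lemma 6.3) — HYPOTHESES OF RECORD: `p ∤ N` and `ρ` FLAT at `p`
(§6.1: «`p` … not divisible by any prime in `Σ`», «`ρ̄|G_v` finite flat»).  EVERY U5 pair has `p ∥ N` (`ρ_{E,p}|G_{ℚ_p}` semistable
ordinary; `ρ̄` finite flat), so the statement NEEDED is Thm. 6.4 WITH THE ORDINARY CONDITION AT `p ∈ Σ` (Wiles's Selmer deformations,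
`U_p ∈ T̄`) — NOT IN PRINT as stated (loc. cit. §6.1: the flat restriction «is not a fundamental limitation of our techniques»; the 2024
Hilbert-modular sequel arXiv:2408.15410 keeps the level prime to `p`, flat at `p`, and assumes big image) = THE research content of this stub.
F2″ [exact principal inertia ideal] at the ♭ prime `ℓ₁ ≠ p`: `R^{un}_{ℓ₁}/(n) = R^{unr}_{ℓ₁}` (the node), hence by F1″ at the two levels
`M ⊃ M/ℓ₁`: `T̄_M/(n₁) ≅ R^τ/(n) ≅ R^{τ′} ≅ T̄_{M/ℓ₁}` torsion-free, i.e. `ker(T̄_M → T̄_M^{ℓ₁-old} ≅ T̄_{M/ℓ₁}) = n₁·T̄_M` EXACTLY (sharper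
than Diamond §7.3's «torsion kernel»).  GLUE = S3's GLUE with F1 ↦ F1″ at every level of the chain `N ⊃ N/ℓ₁`, `N/ℓ₂ ⊃ N/ℓ₁ℓ₂` that still
contains a non-♭ multiplicative prime (F1 elsewhere — at the isolate (9) below the lowered pair is clean); at a trivial `ℓ₂` BOTH
`ℓ₂`-stabilisations of `g°` are members (`X² − a_{ℓ₂}X + ℓ₂ ≡ (X − 1)²  (mod 𝔭)`) and either serves: `1 − α_{ℓ₂}(g°)⁻¹ ∈ 𝔭`.
WHY IT MIGHT FAIL AS A PROOF PLAN: (i) F1″-ordinary might need more than bookkeeping at `p` — the patched modules must be compared over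
`R_p^{ord}` instead of `R_p^{fl}`, with `U_p` adjoined to `T̄` — and on U5 this local factor is SINGULAR (rev 6 fold of V#171 P1 (i), REF g30 N-g30-1∕2∕3): by the tree's `q_E ∈ (ℚ_p^×)^p` at the
principal prime (p710098 ∕ p754219) `ρ̄|G_{ℚ_p} = ωδ ⊕ δ` is SPLIT, so the fixed-determinant ordinary framed ring is the two-component
NODE «crystalline-ordinary ∪ semistable (Steinberg-at-`p`)»: writing the ordinary lifts `ρ = (εδ̃ψ ∗ ; 0 δ̃ψ⁻¹)` with `ψ` UNRAMIFIED AND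
RESIDUALLY TRIVIAL, the extension fibre is `H¹(G_{ℚ_p}, εψ²)`, of rank 1 for `ψ ≠ 1` and rank 2 at `ψ = 1`; `X_cris = closure{ψ ≠ 1}`,
`X_st = {ψ = 1, c ∈ H¹(ε) arbitrary}`, two formally smooth components of equal dimension meeting along `{ψ = 1, c ∈ H¹_f(ε)}` —
complete intersection, Cohen–Macaulay, NOT formally smooth [Snowden, arXiv:1111.3654, §4.2–4.3, Lemma 4.3.1]; our pairs sit on `X_st`,
and `ρ_{E,p}|G_{ℚ_p}` is a SMOOTH point of `X_st` off `X_st ∩ X_cris` (`ord_p q_E > 0` puts its class outside `H¹_f(ε)`): the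
non-smoothness that matters is at the CLOSED point (what the patched local ring sees), not a statement about `f_E`'s own deformations; (ii) `D = M₂(ℚ)`: the curve is non-compact and
`H¹(Y)_𝔪 = H¹(X)_𝔪` at non-Eisenstein `𝔪` is used tacitly; (iii) nothing else — every other input is S3's.  NOT the `U_q = 0` depletion
(dead since g22: costs exactly `v_p(q − 1)`); NOT a Wiles-defect computation — the defect `3n_q` of `T̄` at a `fun` prime (Thm. 6.5,
Prop. 7.5) is IRRELEVANT to the mechanism, which uses the surjection `R ↠ T̄`, reducedness and the principal ideal at `ℓ₁`, never a
numerical criterion at `q`.  POPULATION (REF §ZB add. 1, job j336774; all `r_an = 0`, `v₅∏c = 2 = ord₅(L/Ω)`, `5 ∤ Ш_an`): pairs (6)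
`N = 1621384960 = 2⁸·5·13·139·701` (`ℓ₁ = 13`, `ℓ₂ = 701`, `Ш_an = 9`), (9) `N = 7098049365 = 3·5·11²·61²·1051` (`ℓ₁ = 3`, `ℓ₂ = 1051`;
THE ISOLATE: `N/ℓ₂ ⊃ N/ℓ₁ℓ₂` clean), (10) `N = 45191735040` (`ℓ₁ = 3`, `ℓ₂ = 7001`, `Ш_an = 4`); census-empty at `p = 5`, `N < 5·10⁵`.
Instrument (BSD-free; designed, not requested — kit 0): KIT-U = the card's KIT-T at a SYNTHETIC unclean level `ℓ₁·M·q`, `q ≡ 1 (mod 25)`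
trivial for a small-conductor 5Ns ∕ 5S4 residual representation.  Consequence of BSD; strictly weaker than U5; gives S4's `ℓ₁ ≠ p` cases.
Sources (labelled): [corpus: paper:arxiv-2108.09729 p.17 (Calegari's modified problems), p.18 (Prop. 4.6), p.21 (`R_v^{fun}`, two minimal
primes), p.30 (§6.1 hypotheses), p.31 (Lemma 6.3, Thm. 6.4), p.34 (Thm. 6.5), p.36 (Rem. 7.2: modules generically free over the FULL algebras
with `U_v`)]; [corpus: paper:doi-10-4310-cdm-1995-v1995-n1-a1 p.134 (Darmon–Diamond–Taylor Thm. 4.26 = Wiles Thm. 2.1)];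
[corpus: paper:arxiv-2408.15410 p.3–4, 6, 15 (trivial places: `T^Q` not Gorenstein; level prime to `p`; big image)]; [galaxy: no relevant hit
for "choice of Frobenius|Wiles defect|trivial primes for" (panama ∕ pdf ∕ crabby; only the CSS volume panama:506015866945592)]; corpus vsearch
«`R = T̄` with `U_q` at trivial primes, ordinary, `p ∣ N`»: no hit.
[cite: BoeckleKhareManning2024, Lemma 6.3, Thm. 6.4 and Prop. 4.6 (5)] [cite: DarmonDiamondTaylor1995, Thm. 4.26] [cite: Wiles1995Annals, Thm. 2.1]
[cite: DiamondExtension1997, Thm. 6.1] [cite: Ribet1990RaisingLevels, Thm. 1] [cite: SilvermanATAEC1994, Cor. IV.9.2 (d)] -/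
def TrivialLevelNodeFrame : Prop :=
  (∀ (W : WeierstrassCurve ℚ) [W.IsElliptic] [W.IsGloballyMinimal] (p : ℕ) [Fact p.Prime],
      ClassX11a W p → ¬ Surj W p → 5 ≤ p → ¬ CleanLevel W p →
      ∀ (ℓ : ℕ) [Fact ℓ.Prime], W.HasSplitMultiplicativeReductionAtPrime ℓ → FlatPrime p ℓ → ℓ ≠ p →
      ∀ t : ℚ, W.entireLFunction 1 / (W.realPeriodRat : ℂ) = (t : ℂ) →
        ((depth W p ℓ : ℕ) : ℤ) ≤ padicValRat p t) ∧
  (∀ (W : WeierstrassCurve ℚ) [W.IsElliptic] [W.IsGloballyMinimal] (p : ℕ) [Fact p.Prime],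
      ClassX11a W p → ¬ Surj W p → 5 ≤ p → ¬ CleanLevel W p →
      ∀ (ℓ₁ ℓ₂ : ℕ) [Fact ℓ₁.Prime] [Fact ℓ₂.Prime], ℓ₁ ≠ p →
        W.HasSplitMultiplicativeReductionAtPrime ℓ₁ → FlatPrime p ℓ₁ → ℓ₂ ≠ ℓ₁ →
        W.HasSplitMultiplicativeReductionAtPrime ℓ₂ → p ∣ padicValInt ℓ₂ W.minimalDiscriminantInt →
      ∀ t : ℚ, W.entireLFunction 1 / (W.realPeriodRat : ℂ) = (t : ℂ) →
        ((depth W p ℓ₁ : ℕ) : ℤ) + 1 ≤ padicValRat p t)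

/-- **S4ₚ — (A♯)+(B♯) WITH PRINCIPAL PRIME `ℓ₁ = p` (rev 5, lens «decomp»: the second conjunct of the split of S4; research-M, content
unchanged from S4).**  (A) at an UNCLEAN level with the split carrier `p` as principal prime: `ord_p(L(E,1)/Ω_E) ≥ n_p = v_p(v_p(Δ))`;
(B) at ANY level, principal prime `p` split and a second split carrier `ℓ₂ ≠ p`: `≥ n_p + 1`.  What is NOT in print here (why research-M):
F3 — the ordinary local deformation ring at `p ∥ N` for `ρ̄|G_{ℚ_p} = ωδ ⊕ δ` SPLIT (`q_E ∈ (ℚ_p^×)^p`, automatic at `p′`-image) as the node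
«crystalline-ordinary component ∪ semistable (Tate) component» with a PRINCIPAL Tate coordinate `n_p` (`R^{ord}/(n_p) = R^{fl}`) and
`ord_𝔭 n_p(f_E) = v_p(v_p(Δ_E))` (PRINT-CHECK rev 2–8; rev 9: DERIVED at sketch level, AUDIT-Pplus-print-g38.md §3 Lemma E2 — the semistable
framed ring at `p` for SPLIT `ρ̄|G_p` is `R^{fl} ×_S R^{St} ≅ S⟦v,t⟧/(vt)`, both branches formally smooth (Ramakrishna 1993 ∕ Kisin 2009 §2,
`e = 1 < p − 1`, framed version with no condition on `ρ̄|G_p`), meeting TRANSVERSALLY in the smooth divisor `S = {v = 0}` («peu ramifié ⟺ unit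
Kummer class»), `I_cris = (v)` principal, `B_p/(v) = R^{fl}`, `ord x_E(v) = v_p(v_p(Δ_E))` by the moduli of `E[p^m]`; referee item R2 there;
Kim–Ota exclude `p ∣ N`, Snowden 2018 treats other singularities); level raising AT `p` for the member `g` of (B) (Ribet 1990 Remark 3; tree fact
`ribet1990_levelRaising_pNew` UNPROVED); dual Ihara at `q = p` (F5: Diamond–Ribet Lemma 4.6, Wiles Lemma 2.5 — in print); and F1″ of S4♮
on top whenever the level is unclean (always in the population below).  POPULATION: `118080ds1`@5 (`ℓ₂ = 41` trivial, room `v₅(40) = 1`;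
the census instrument, REF jobs j334833 ∕ j335552), E₃@7 (`t = 18/7`, `D = 6`; `ℓ₂ = 251 ≡ −1 (mod 7)` split, `c = 7`: NOT trivial,
`ρ̄(Frob₂₅₁) ∼ diag(1, −1)`, `τ = un` with `n = 0`), and pairs (2) `N = 28091360 = 2⁵·5·11²·1451` (`t = 26/5`, `D = −4`,
`[0,0,0,−162386312,−617024242384]`, carriers `{5, 1451}` both split of depth 1, `∏c = 100`, `Ш_an = 1`, room `v₅(1450) = 2`), (3) `144263840`
(`ℓ₂ = 18401`), (4) `285854240` (`ℓ₂ = 101`), (8) `3502049760` (`ℓ₂ = 101`; `199 ≡ −1` non-split) of REF §ZB add. 1 — in all six the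
principal carrier is `p` BECAUSE the other split carrier is trivial or `≡ −1`, never ♭.  WHY IT MIGHT FAIL: as S4 — the «+1» may need the
depth of `ℓ₂` read on a bigger algebra; the rev-2 worry «F3 false as a MECHANISM if the two components at `p` are not transversal along
`n_p = 0`» is ANSWERED by AUDIT Lemma E2 (transversal; `I_cris = (v)` principal) modulo referee item R2 (the STATEMENT, a consequence of BSD, was
never affected).  Strictly weaker than U5; gives S4's `ℓ₁ = p` cases.
[cite: Ribet1990RaisingLevels, Remark 3] [cite: Snowden2018SingularitiesOrdinary, §1] [cite: Wiles1995Annals, Thm. 2.1 and Lemma 2.5]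
[cite: BoeckleKhareManning2024, Thm. 6.4] [cite: SilvermanATAEC1994, Cor. IV.9.2 (d)] -/
def PrincipalAtPFrame : Prop :=
  (∀ (W : WeierstrassCurve ℚ) [W.IsElliptic] [W.IsGloballyMinimal] (p : ℕ) [Fact p.Prime],
      ClassX11a W p → ¬ Surj W p → 5 ≤ p → ¬ CleanLevel W p → W.HasSplitMultiplicativeReductionAtPrime p →
      ∀ t : ℚ, W.entireLFunction 1 / (W.realPeriodRat : ℂ) = (t : ℂ) →
        ((depth W p p : ℕ) : ℤ) ≤ padicValRat p t) ∧
  (∀ (W : WeierstrassCurve ℚ) [W.IsElliptic] [W.IsGloballyMinimal] (p : ℕ) [Fact p.Prime],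
      ClassX11a W p → ¬ Surj W p → 5 ≤ p →
      ∀ (ℓ₂ : ℕ) [Fact ℓ₂.Prime], W.HasSplitMultiplicativeReductionAtPrime p → ℓ₂ ≠ p →
        W.HasSplitMultiplicativeReductionAtPrime ℓ₂ → p ∣ padicValInt ℓ₂ W.minimalDiscriminantInt →
      ∀ t : ℚ, W.entireLFunction 1 / (W.realPeriodRat : ℂ) = (t : ℂ) →
        ((depth W p p : ℕ) : ℤ) + 1 ≤ padicValRat p t)

/-- **S5 — OFF-RUNG RESIDUAL inside C_cc (open; U5 restricted, typed).**  Pairs with `2 ≤ v_p ∏c`, `Ш(E)[p] = 0` and NEITHER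
rung: no ♭ split carrier at all (every carrier `≡ ±1 (mod p)` and `p` not a split carrier), or a depth pattern beyond
`n_{ℓ₁} + 1` (three carriers; two carriers both of depth `≥ 2`; …).  Census-empty at `p = 5`, `N < 5·10⁵`, and empty on
the five explicit `p = 7` pairs (REF §ZA add. 4) — BUT (rev 3) at `p′`-image EVERY split multiplicative prime `q` is a carrier
(`ρ̄(I_q)` unipotent of order dividing `p` inside an image of order prime to `p` ⇒ trivial ⇒ `p ∣ v_q(Δ) = c_q`; at `p = 7` the
Zywina family makes this visible: `j` has a pole of order `7` at all four cusps of `X_s⁺(7)`), so C_cc is «`≥ 2` split multiplicative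
primes, or one of depth `≥ 2`» and the off-rung configuration «`≥ 3` split carriers» is GENERIC at large conductor: this line is a
TWO-CARRIER line.  The «iterate the cofactor» extension has NO ring-theoretic mechanism (§5: under patching, `𝔞₁ ∩ 𝔞₂ ≠ 𝔞₁𝔞₂`
always); what remains is the position of `η` (§5, target S3⁺), not typed here.  (Rev 7: §5 PROPOSITION P⁺ — the patched winding
element — is a candidate mechanism for this statement's CLEAN-LEVEL part with any number of carriers; SKETCH under audit; statement and
stub unchanged.) [cite: Miller2011LMS, Def. 1.1] -/
def OffRungResidual : Prop :=
  ∀ (W : WeierstrassCurve ℚ) [W.IsElliptic] [W.IsGloballyMinimal] (p : ℕ) [Fact p.Prime],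
    ClassX11a W p → ¬ Surj W p → 5 ≤ p → 2 ≤ padicValNat p W.tamagawaProduct →
    (∀ x : W.sha, (p : ℤ) • x = 0 → x = 0) → ¬ OnRungA W p → ¬ OnRungB W p → MissingUpperBoundAt W p

/-- **S6 — RESIDUAL: the record's C_Ш = `ShaExponentCore` VERBATIM («`Ш(E)[p] ≠ 0`»; open; NOT attacked here — the line
bounds `L/Ω`, never `#Ш`).** [cite: Miller2011LMS, Def. 1.1] -/
def ShaCoreResidual : Prop :=
  ∀ (W : WeierstrassCurve ℚ) [W.IsElliptic] [W.IsGloballyMinimal] (p : ℕ) [Fact p.Prime],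
    ClassX11a W p → ¬ Surj W p → 5 ≤ p → (∃ x : W.sha, (p : ℤ) • x = 0 ∧ x ≠ 0) → MissingUpperBoundAt W p

/-! ## §3 The seven stubs (the ONLY `sorry`s of the file; rev 5: S4 is fed by S4♮ + S4ₚ through `trivialPrimeFrame_of_split`) -/

/-- S1 (print, XS by name). [cite: Kato2004Asterisque, Thm. 12.4 and §17.13] -/
theorem stub_printFacts : PrintFacts := by
  sorry

/-- S2 (A, clean; SIZING V#167 P1: print-composite in `GL₂/ℚ` weight-2 print, UNTYPED CHAIN, tree-XL; seat-able now: nothing).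
[cite: DiamondCSS1997, Thm. 6.1] [cite: Wiles1995, Thm. 2.1, Lemma 2.5, Thm. 3.3] -/
theorem stub_principalCarrierDepth : PrincipalCarrierDepth := by
  sorry

/-- S3 (B, clean, `ℓ₁ ≠ p`; THE LEVER; SIZING V#167 P1: print-composite in `GL₂/ℚ` weight-2 print, UNTYPED CHAIN — fact ledger F1–F9
and glue in the `SecondCarrierIncrement` docstring; tree-XL; seat-able now: nothing; census branch `ℓ₂ = p`).
[cite: DiamondCSS1997, Thm. 6.1] [cite: Ribet1990RaisingLevels, Thm. 1] [cite: Wiles1995, Thm. 2.1, Lemma 2.5, Thm. 3.3] [cite: Diamond1996] [cite: Diamond1997] -/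
theorem stub_secondCarrierIncrement : SecondCarrierIncrement := by
  sorry

/-- S4♮ (unclean level, ♭ principal prime `ℓ₁ ≠ p`; PRINT-COMPOSITE MODULO F1″-ord, research-S: S3's ledger with F1 ↦ F1″ =
Böckle–Khare–Manning II Thm. 6.4 + Lemma 6.3 in its unwritten ordinary-at-`p ∥ N` form, local factor at `p` the singular CI node). [cite: BoeckleKhareManning2024, Lemma 6.3 and Thm. 6.4] [cite: Wiles1995Annals, Thm. 2.1] -/
theorem stub_trivialLevelNodeFrame : TrivialLevelNodeFrame := by
  sorry

/-- S4ₚ (principal prime `= p`; research-M). [cite: Ribet1990RaisingLevels, Remark 3] [cite: Snowden2018SingularitiesOrdinary, §1] -/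
theorem stub_principalAtPFrame : PrincipalAtPFrame := by
  sorry

/-- S5 (off-rung residual; open). [cite: Miller2011LMS, Def. 1.1] -/
theorem stub_offRungResidual : OffRungResidual := by
  sorry

/-- S6 (C_Ш verbatim; open). [cite: Miller2011LMS, Def. 1.1] -/
theorem stub_shaCoreResidual : ShaCoreResidual := by
  sorry

/-! ## §4 Real proofs: the rung engine and the composition BY NAME -/

/-- **rev 5 DECOMP (the seat's lens): S4 ⟸ S4♮ ∧ S4ₚ (real proof — case on whether the principal prime is `p`).**  The old stub S4
`TrivialPrimeFrame` is the assembly node; its research content is now isolated in S4ₚ (principal prime `p`) while S4♮ (♭ principal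
prime `ℓ₁ ≠ p` at an unclean level) is print-composite modulo F1″-ord (research-S; rev 6 relabel); the inputs of the two conjuncts are
NESTED, S4ₚ = F1″-ord + F3 (principality ∕ valuation at `p`) + raising at `p` ⊋ S4♮ = F1″-ord (V#171 P1 (ii) on P3). [cite: BoeckleKhareManning2024, Lemma 6.3 and Thm. 6.4] [cite: Ribet1990RaisingLevels, Remark 3] -/
theorem trivialPrimeFrame_of_split (hN : TrivialLevelNodeFrame) (hP : PrincipalAtPFrame) : TrivialPrimeFrame := by
  refine ⟨?_, ?_⟩
  · intro W _ _ p _ hX hns hp5 hncl ℓ _ hsplit hflat t ht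
    by_cases h : ℓ = p
    · subst h
      exact hP.1 W _ hX hns hp5 hncl hsplit t ht
    · exact hN.1 W p hX hns hp5 hncl ℓ hsplit hflat h t ht
  · intro W _ _ p _ hX hns hp5 ℓ₁ ℓ₂ _ _ hor hsplit₁ hflat₁ hne hsplit₂ hcar₂ t ht
    by_cases h : ℓ₁ = p
    · subst h
      exact hP.2 W _ hX hns hp5 ℓ₂ hsplit₁ hne hsplit₂ hcar₂ t ht
    · exact hN.2 W p hX hns hp5 (hor.resolve_right h) ℓ₁ ℓ₂ h hsplit₁ hflat₁ hne hsplit₂ hcar₂ t ht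


/-- **Lower bound on `ord_p(L/Ω)` ON RUNG (A) (real proof from S2 + S4.1).** [cite: SilvermanATAEC1994, Cor. IV.9.2 (d)] -/
theorem tamagawa_le_of_onRungA (h2 : PrincipalCarrierDepth) (h4 : TrivialPrimeFrame)
    {W : WeierstrassCurve ℚ} [W.IsElliptic] [W.IsGloballyMinimal] {p : ℕ} [Fact p.Prime]
    (hX : ClassX11a W p) (hns : ¬ Surj W p) (hp5 : 5 ≤ p) (hA : OnRungA W p)
    {t : ℚ} (ht : W.entireLFunction 1 / (W.realPeriodRat : ℂ) = (t : ℂ)) :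
    ((padicValNat p W.tamagawaProduct : ℕ) : ℤ) ≤ padicValRat p t := by
  obtain ⟨ℓ, hℓ, hsplit, hflat, hle⟩ := hA
  have hdepth : ((depth W p ℓ : ℕ) : ℤ) ≤ padicValRat p t := by
    by_cases hcl : CleanLevel W p
    · exact h2 W p hX hns hp5 hcl ℓ hsplit t ht
    · exact h4.1 W p hX hns hp5 hcl ℓ hsplit hflat t ht
  have hle' : ((padicValNat p W.tamagawaProduct : ℕ) : ℤ) ≤ ((depth W p ℓ : ℕ) : ℤ) := by exact_mod_cast hle
  exact hle'.trans hdepth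

/-- **Lower bound on `ord_p(L/Ω)` ON RUNG (B) (real proof from S3 + S4.2).** [cite: SilvermanATAEC1994, Cor. IV.9.2 (d)] -/
theorem tamagawa_le_of_onRungB (h3 : SecondCarrierIncrement) (h4 : TrivialPrimeFrame)
    {W : WeierstrassCurve ℚ} [W.IsElliptic] [W.IsGloballyMinimal] {p : ℕ} [Fact p.Prime]
    (hX : ClassX11a W p) (hns : ¬ Surj W p) (hp5 : 5 ≤ p) (hB : OnRungB W p)
    {t : ℚ} (ht : W.entireLFunction 1 / (W.realPeriodRat : ℂ) = (t : ℂ)) :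
    ((padicValNat p W.tamagawaProduct : ℕ) : ℤ) ≤ padicValRat p t := by
  obtain ⟨ℓ₁, ℓ₂, hℓ₁, hℓ₂, hsplit₁, hflat₁, hne, hsplit₂, hcar₂, hle⟩ := hB
  have hdepth : ((depth W p ℓ₁ : ℕ) : ℤ) + 1 ≤ padicValRat p t := by
    by_cases hcl : CleanLevel W p ∧ ℓ₁ ≠ p
    · exact h3 W p hX hns hp5 hcl.1 ℓ₁ ℓ₂ hcl.2 hsplit₁ hne hsplit₂ hcar₂ t ht
    · have hor : ¬ CleanLevel W p ∨ ℓ₁ = p := by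
        by_cases hc : CleanLevel W p
        · right
          by_contra hne'
          exact hcl ⟨hc, hne'⟩
        · left; exact hc
      exact h4.2 W p hX hns hp5 ℓ₁ ℓ₂ hor hsplit₁ hflat₁ hne hsplit₂ hcar₂ t ht
  have hle' : ((padicValNat p W.tamagawaProduct : ℕ) : ℤ) ≤ ((depth W p ℓ₁ : ℕ) : ℤ) + 1 := by exact_mod_cast hle
  exact hle'.trans hdepth

/-- **THE ENGINE (real proof): on either rung, `v_p ∏c ≤ ord_p(L(E,1)/Ω_E)`, hence `0 ≤ ord_p #Ш_an`
(`GL1Cartan.padicValRat_shaAn_eq_sub_tamagawa`), hence — with `Ш(E)[p] = 0` — the lead's door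
`ClassX11a.missingUpperBoundAt_of_noPTorsion`. [cite: Miller2011LMS, Def. 1.1] [cite: Mazur1978, Cor. 4.1] -/
theorem missingUpperBoundAt_of_rung
    (hnf : exists_isNewformOf) (hMz : mazur_not_dvd_maninConstant_of_odd)
    (hGZK : rank_eq_analyticRank_of_analyticRank_le_one)
    (h2 : PrincipalCarrierDepth) (h3 : SecondCarrierIncrement) (h4 : TrivialPrimeFrame)
    {W : WeierstrassCurve ℚ} [W.IsElliptic] [W.IsGloballyMinimal] {p : ℕ} [Fact p.Prime]
    (hX : ClassX11a W p) (hns : ¬ Surj W p) (hp5 : 5 ≤ p)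
    (hSha : ∀ x : W.sha, (p : ℤ) • x = 0 → x = 0) (hrung : OnRungA W p ∨ OnRungB W p) :
    MissingUpperBoundAt W p := by
  obtain ⟨t, ht, ht0, -⟩ := hX.exists_LOne_div_realPeriod_eq_of_mazur hnf hMz hp5
  have hL1 : W.entireLFunction 1 ≠ 0 := by
    intro h0
    apply ht0
    have h : ((t : ℚ) : ℂ) = 0 := by rw [← ht, h0, zero_div]
    exact_mod_cast h
  obtain ⟨-, -, -, hsha⟩ := shaAn_eq_of_L_one_div_eq hGZK W hL1 ht
  have hvq := padicValRat_shaAn_eq_sub_tamagawa hGZK hnf hMz hX hp5 hsha ht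
  refine hX.missingUpperBoundAt_of_noPTorsion hGZK hsha ?_ hSha
  rw [hvq]
  have hct : ((padicValNat p W.tamagawaProduct : ℕ) : ℤ) ≤ padicValRat p t := by
    rcases hrung with hA | hB
    · exact tamagawa_le_of_onRungA h2 h4 hX hns hp5 hA ht
    · exact tamagawa_le_of_onRungB h3 h4 hX hns hp5 hB ht
  linarith

/-- **C_cc from S2 + S3 + S4 + S5 (real proof):** split on the rung. [cite: Miller2011LMS, Def. 1.1] -/
theorem tamagawaDepthCore_of_monogen
    (hnf : exists_isNewformOf) (hMz : mazur_not_dvd_maninConstant_of_odd)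
    (hGZK : rank_eq_analyticRank_of_analyticRank_le_one)
    (h2 : PrincipalCarrierDepth) (h3 : SecondCarrierIncrement) (h4 : TrivialPrimeFrame) (h5 : OffRungResidual) :
    ∀ (W : WeierstrassCurve ℚ) [W.IsElliptic] [W.IsGloballyMinimal] (p : ℕ) [Fact p.Prime],
      ClassX11a W p → ¬ Surj W p → 5 ≤ p → 2 ≤ padicValNat p W.tamagawaProduct →
      (∀ x : W.sha, (p : ℤ) • x = 0 → x = 0) → MissingUpperBoundAt W p := by
  intro W _ _ p _ hX hns hp5 hdeep hSha
  by_cases hA : OnRungA W p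
  · exact missingUpperBoundAt_of_rung hnf hMz hGZK h2 h3 h4 hX hns hp5 hSha (Or.inl hA)
  · by_cases hB : OnRungB W p
    · exact missingUpperBoundAt_of_rung hnf hMz hGZK h2 h3 h4 hX hns hp5 hSha (Or.inr hB)
    · exact h5 W p hX hns hp5 hdeep hSha hA hB

/-- **U5 from the hypotheses (real proof): the thirteen prints + S2 + S3 + S4 + S5 + S6, through the record's rev-12 turnkey
BY NAME.** [cite: Miller2011LMS, Def. 1.1] -/
theorem UpperNonSurjFive_of_hyps (hP : PrintFacts) (h2 : PrincipalCarrierDepth) (h3 : SecondCarrierIncrement)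
    (h4 : TrivialPrimeFrame) (h5 : OffRungResidual) (h6 : ShaCoreResidual) : Theses.PrintX11a.UpperNonSurjFive := by
  obtain ⟨hJs, hJn, h12, hnf, hns', hsp', hfine', hMz, hGZK, hCE, hGV, hI, hLL⟩ := hP
  exact upperNonSurjFive_of_elevenFacts_of_twoCores hJs hJn h12 hnf hns' hsp' hfine' hMz hGZK hCE hGV hI hLL h6
    (tamagawaDepthCore_of_monogen hnf hMz hGZK h2 h3 h4 h5)

/-- **Composition U5 — the crux BY NAME, stub-fed (real proof; `sorry` only inside the seven stubs; S4 enters PROVED from S4♮ + S4ₚ).**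
[cite: Miller2011LMS, Def. 1.1] -/
theorem UpperNonSurjFive_of_monogen : Theses.PrintX11a.UpperNonSurjFive :=
  UpperNonSurjFive_of_hyps stub_printFacts stub_principalCarrierDepth stub_secondCarrierIncrement
    (trivialPrimeFrame_of_split stub_trivialLevelNodeFrame stub_principalAtPFrame) stub_offRungResidual stub_shaCoreResidual

/-! ## §4b (rev 8, g37 — the seat's lens «decomp») THE CLEAN CUT: C_cc partitioned by LEVEL-CLEANNESS instead of by RUNG (definitions + PROVED glue; no stub touched)

WHY NOW.  KIT-T‴ has been RUN (REF g31, REF-AUDIT §ZK 2026-08-30T05:25:33Z, evidence #58 `REF-g31-ZK-g36memo-KITT3.md` on 20614; kit j338489,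
script `kitT5.gp` = kitT4v + third-carrier block, log `pub/bsd-print-x11a/staging/ref/g31/kitT/j338489.stdout.log`, wall 1 734 976 ms): at the CLEAN
THREE-carrier level `9890 = 43·2·23·5`@5 (base `F` = 43a, `ε_F = −1`; split-sign raising congruences `a₂(F) = −2 ≡ 3`, `a₂₃(F) = −1 ≡ 24` — of depth
`v₅(25) = 2` — and `a₅(F) = −4 ≡ 1` at the `p`-carrier; `d = 1592`, `r = rk_{ℤ₅} T_𝔪 = 9`; multiplicity one ✓, Gorenstein ✓, `ν(I₂) = ν(I₂₃) = ν(I₅) = 1`,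
all eight old ∕ new types inhabited) the member `g_nnn` NEW AT ALL THREE CARRIERS — a single `ℤ₅`-member — has `v₅(λ_{g_nnn}(t_η)) = 3 = 1 + 1 + 1`, the
SUM of its three monodromy depths, where (W) + the typed S3 predict only `≥ max + 1 = 2`; and `ob₃(η) = 0`, i.e. `η ∈ 𝔞₂𝔞₂₃𝔞₅` (`ℓ(T/Σ𝔞ᵢ) = 1`,
`ℓ(T/⋂𝔞ᵢ) = 10`, `ℓ(T/∏𝔞ᵢ) = 14`: obstruction module of length 4, NOT vacuous; pairwise `δ = (2, 1, 1)`, `η ∈ 𝔞ᵢ𝔞ⱼ` 3 ∕ 3).  This is the FIRST row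
of the KIT-T family (now 17 levels, 0 kills) that DISCRIMINATES the typed S3 («max + 1») from S3⁺ ∕ P⁺ («sum»), and it sides with «sum»; the memo's
PREDICTION 3 (member-wise values) is met at all 17 single-member types measured (kit j338481 ∕ j338482, `kitT4v.gp`): WITH EQUALITY at 15, and EXCEEDED
by one at the two doubly-new members of 14467@5 and 13685@5 (`3 = (n₁ + n₂) + 1`; REF §ZL: BSD reads the extra unit as `5 ∣ #Ш`, a depth-2 carrier or a
non-carrier Tamagawa factor of that newform — kitT4w j338761 will say which part `T` itself forces; a value BELOW the bound, which would contradict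
`ob(η) = 0` read member-wise, has not occurred).  A BSD-free computation lying inside BSD's predictions proves no stub; what it does is SELECT, among the typed statements this line could
carry, the one the surviving mechanism actually proves — S∑ below — and retire the rung partition as the organising cut of the CLEAN sector.

THE CUT.  Revs 1–7 partition C_cc by RUNG: (A) one ♭ carrier carries all the depth [S2 clean ∕ S4 unclean], (B) a ♭ carrier plus a second carrier with
`v_p∏c ≤ n_{ℓ₁} + 1` [S3 clean ∕ S4], off-rung [S5] — a partition fitted to the «max + 1» mechanism, whose ceiling is two carriers (§5 NO-GO: `∩ ≠ ∏`
downstairs).  PROPOSITION P⁺ (§5 rev 7; the patched winding element), if it survives audit, proves on a CLEAN level the full sum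
`ord_p(L(E,1)/Ω_E) ≥ v_p∏c_ℓ` for ANY number of carriers at ANY depths — it does not see rungs — and is SILENT at unclean levels (REF §ZK (f): P⁺5's
identification of the `ℓᵢ`-old quotient with `M_∞/𝔫ᵢM_∞` needs the two Frobenius roots SEPARATED, `αᵢ − βᵢ ≡ 1 − ℓᵢ ≢ 0 (mod p)`, i.e. exactly ♭; at a
trivial prime both roots are `≡ 1` and the Hensel root `αᵢ` is undefined).  So the cut that matches the mechanism is BY CLEANNESS,
C_cc = C_cc^clean ⊔ C_cc^unclean:
  · S∑ `CleanCarrierSum` — C_cc^clean IN FULL: X11a ∧ ¬Surj ∧ `5 ≤ p` ∧ `CleanLevel` ⟹ `v_p∏c ≤ ord_p(L(E,1)/Ω_E)` (typed below; = P⁺7's conclusion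
    at the curve; a consequence of BSD (`ord_p(L/Ω) = ord_p#Ш + v_p∏c`, `p ∤ #tors` by Irr), strictly weaker than U5 (no `#Ш`); it implies the
    CONCLUSIONS of S2 and S3 (one depth, resp. one depth + 1, are `≤ v_p∏c` by Kodaira–Néron `c_ℓ = v_ℓ(Δ)` at split `ℓ`) and the clean part of
    S5, i.e. it SUBSUMES the clean sector of revs 1–7; it is the statement the KIT-T ∕ KIT-Tⁿ ∕ KIT-T‴ member tables calibrate);
  · S4 = S4♮ ∧ S4ₚ (rev 5 split, unchanged) — C_cc^unclean ON a rung (♭ or `= p` principal carrier at an unclean level);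
  · S5♮ `UncleanOffRungResidual` — C_cc^unclean OFF the rungs (S5 with the extra binder `¬ CleanLevel`: ≥ 3 carriers or a deep second carrier at a
    level with a trivial ∕ `≡ −1` multiplicative prime — the Böckle–Khare–Manning Wiles-defect regime, research; in content twpatch5's S3
    `ValueDepthVexing` minus what S4 already frames).
GLUE (real proofs below): `tamagawaDepthCore_of_cleanCut : prints → S∑ → S4 → S5♮ → C_cc` (case on `CleanLevel`, then on the rung; the clean case
feeds S∑ into the record's BY-NAME socket `GL1Cartan.missingUpperBoundAt_of_valueDepth` of `Theorems/PrintX11aUpperNonSurjFiveDepthStrata.lean` — the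
socket twpatch5 uses — hence the one new import), `offRungResidual_of_cleanCut : prints → S∑ → S4 → S5♮ → S5` (the old residual is RECOVERED: the
clean cut REFINES the rung cut, nothing is lost), and the alternative composition `UpperNonSurjFive_of_cleanCut : S1 → S∑ → S4♮ → S4ₚ → S5♮ → S6 → U5`
BY NAME through the record's rev-12 turnkey — SIX hypotheses, S2 ∕ S3 ∕ S5 not among them.  BRIDGE TO «twpatch5» (same crux; P⁺'s engine text lives
in its S2 (ii′)): `cleanCarrierSum_of_generic` PROVES S∑ from ANY pair (TW-hypothesis supplier, value depth under TW + genericity) having the binder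
shapes of twpatch5's S4 `TWOnU5` and S2 `ValueDepthTW`, via «CLEAN ⟹ generic» (`not_dvd_sq_sub_one_of_flatPrime`: a ♭ prime `ℓ ≠ p` has `p ∤ ℓ² − 1`);
so `cleanCarrierSum_of_generic TWPatch.TaylorWiles TWPatch.stub_taylorWiles_of_classX11a TWPatch.stub_valueDepthTW : CleanCarrierSum` by inspection
of the binders (the `Cruxes/…/Lines/*.lean` files are not library modules and cannot import one another — an import attempt answers
`remote:stale:unbuilt`).  Hence the two lines SHARE the clean sector, and S∑ is the WEAKEST typed «sum» statement in play (clean is stronger than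
generic: it also constrains the non-split multiplicative primes and allows no `≡ ±1` carrier at all).
WHAT IS NOT CHANGED (idea-crit-10 V#173 n2, agreed by g36: no stub edit before a referee signs P⁺4–P⁺5): the seven stubs of §3, the statements S1–S6
and the composition `UpperNonSurjFive_of_monogen` are byte-identical to rev 7; S∑ and S5♮ are DEFINITIONS with PROVED glue, NOT stubs, and nothing is
registered (W-79).  The eventual swap — drop `stub_principalCarrierDepth` ∕ `stub_secondCarrierIncrement` ∕ `stub_offRungResidual`, add
`stub_cleanCarrierSum` ∕ `stub_uncleanOffRungResidual` (7 → 6 stubs), composition `UpperNonSurjFive_of_cleanCut` — is MECHANICAL and waits for that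
audit.  SIZING of S∑ = P⁺'s: SKETCH, print-composite modulo the memo's audit list — (a′) patching MARKED elements `η_n` together with the old-quotient
maps (routine in ultrapatching, unwritten for the winding element), (b′) `K_{i,∞} = 𝔫ᵢM_∞` at `p ∥ N` with TW-but-not-big image (needs `M_∞ ≅ R_∞`:
multiplicity one at `N`, reducedness, every component inhabited — at a `p`-carrier this means `p`-old AND `p`-new members, REF N-g31-2), (c′) the
`ℓ = p` factor (Kisin's semistable ring = flat ∪ Steinberg node, Snowden §4; `𝔫_p|_{X_st}` = the ordinary coordinate, not a power), (d′) `p = 5`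
constants — plus REF §ZK (f) the ♭ separation in P⁺5 (above) and (g) in P⁺7 the passage `λ_{f_E}(t_η) ↦ L(E,1)/Ω_E` uses `M = T·γ` (multiplicity one,
F4) AND «no `p`-isogeny in the class on U5» (`E[p]` irreducible ⟹ the optimal curve's Néron period is a `p`-UNIT multiple of `Ω_E`; Mazur's Manin
constant); tree-XL (no `T_𝔪`, no `R_∞`, no patching in the tree; seat-able now: nothing beyond the polynomial shadows `TWPatch.biKernelTransversality`
∕ `membership_descends` and this file's kernel anchors).  REV 9 (g38 PRINT AUDIT, `AUDIT-Pplus-print-g38.md`): (a′) = Lemma I there ((W_n):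
`e_{NQ,𝔪_Q} = u·v_α(e_{N,𝔪})`, `u = (q+α̃)(α̃−β̃)⁻¹(T_q+q+1)⁻¹ ∈ T_𝔪^×`, no `Γ₀(NQ)`-new forms at `𝔪_Q`) + Kisin's pigeonhole on marked data;
(b′) = Lemmas J + H there — only the INCLUSION `η_∞ = o_∞ + ν_∞ ∈ Ann(I_ur)γ_∞ + Ann(I_St)γ_∞ = YᵢM_∞ + XᵢM_∞ = 𝔫ᵢM_∞` is needed, from
`I_ur·M^{old} = 0`, `I_St·M^{new} = 0` (Carayol, level by level) and `M_∞ ≅ R_∞` = cyclic (Tilouine Thm 3.4 = Wiles Thm 2.1: any level `N′` with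
`ord_p N′ ≤ 1`, any `H`; `G_p`-distinguished is automatic) + full support (inhabitation of every branch pattern: Diamond–Taylor 1994a Thm A,
1994b; at `p` Ribet 1990 Rem. 3) + reduced (Böckle–Khare–Manning I, Lemma p.13) — kernel anchor `Spine.ideal_eq_bot_of_le_minimalPrimes`; NO
`R_Q = T_Q` at auxiliary levels and NO big image are used; (c′) = Lemma E2; the TW hypothesis holds AUTOMATICALLY on U5 (Lemma A: `ρ̄(I_p)`
of order `p − 1` sits in the Cartan, so `ρ̄|G_{ℚ(√p*)}` keeps a non-Cartan element; `5S4`: projectively `⊇ A₄`).  Residual referee items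
R1–R5 there (cited-not-held texts; the `A`-valued peu-ramifié sentence; the generator list of `T_n`; multi-type additive primes; the linear
write-up).  WHY S∑ MIGHT STILL FAIL AS A PROOF PLAN: the write-up is a SKETCH by this seat, unrefereed; if R2 ∕ R3 break, or inhabitation fails
at a multi-type additive prime (R4), P⁺5 — hence the sum — collapses to what (W) gives downstairs («max» per pair, `max + 1` via S3's
cofactor), and the clean sector falls back on the rung cut (still in the file).  FALSIFIERS (BSD-free, REF's engine; REF §ZK (h): they test the
SKETCH itself): any clean level of the family with `ob_k(η) ≠ 0`, or a single-member type with `v_p(λ_g(t_η)) <` its own-depth sum, kills P⁺ and with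
it S∑'s only known mechanism; S∑ itself, a BSD-consequence, is refutable only together with BSD_p (a clean X11a pair with `ord_p(L(E,1)/Ω_E) < v_p∏c`
— none among the 42 generic tabulated U5 pairs at `p = 5`, twpatch5's falsifier box, nor `F`@7).  BC7-style probes of S∑ and S5♮ against U5 are run by
the seat with this rev (card `Lines/monogen5.md` R8.4).  BSD is not proved by any of this; U5 does not close. -/

/-- **S∑ — `CleanCarrierSum` (rev 8; DEFINITION, not a stub): on a CLEAN level the `p`-adic valuation of `L(E,1)/Ω_E` is at least the FULL
Tamagawa depth `v_p ∏_ℓ c_ℓ` — all split carriers, any depths, any number of them.**  For a U5 pair `(E, p)` (X11a, `¬Surj`, `p ≥ 5`) with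
every multiplicative prime ♭: `v_p(∏c) ≤ ord_p t` for the rational `t = L(E,1)/Ω_E`.  = PROPOSITION P⁺ (§5) evaluated at the Tate point (P⁺7:
`λ_E(𝔄ᵢ) = p^{nᵢ}ℤ_p`, `Σnᵢ = v_p∏c` since on X11a ∧ ¬Surj every split multiplicative `ℓ` has `p ∣ c_ℓ = v_ℓ(Δ)` and the other local factors are
`p`-units for `p ≥ 5`); = twpatch5's S2 `TWPatch.ValueDepthTW` restricted to clean levels once its S4 `TWOnU5` supplies the Taylor–Wiles hypothesis
(`cleanCarrierSum_of_generic`).  MECHANISM (sketch, print-composite modulo (a′)–(d′)(f)(g) of §4b): patch `(M_n, η_n, M_n ↠ M_n^{ℓᵢ-old})`; upstairs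
`⋂ᵢ𝔄ᵢR_∞ = ∏ᵢ𝔄ᵢR_∞` (Tor-independence of distinct tensor factors) and `η_∞ ∈ ⋂ᵢ𝔄ᵢM_∞` (dual Ihara at every TW level + `K_{i,∞} = 𝔫ᵢM_∞`, the ♭
separation `αᵢ ≢ βᵢ` making the old quotient `M_∞/𝔫ᵢM_∞`); elements descend: `t_η ∈ ∏ᵢ𝔞ᵢ ⊂ T_𝔪`; evaluate at `f_E` (`M = Tγ`, no `p`-isogeny on U5,
Manin) and sum the depths (§5 anchor (c) `map_mem_pow_sum_of_mem_prod`).  A consequence of BSD; strictly weaker than U5 (no `#Ш`); NOT the crux in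
costume (it bounds `L/Ω` from below by local data and says nothing when `Ш[p] ≠ 0`).  NUMERICAL STANDING (BSD-free engine, BSD_p-predicted
values): member-wise bound met at 17 ∕ 17 single-member types on fourteen clean two-carrier levels (equality at 15, `+1` at two doubly-new members —
`Ш` ∕ extra Tamagawa in BSD's reading, REF §ZL) and `3 = 1+1+1` at the triply-new member of 9890@5 (REF §ZK); curve-side: `ord_p(L/Ω) = v_p∏c` at all 42 generic tabulated U5 pairs at `p = 5` and at `F`@7.  CLEAN-SECTOR
INHABITATION (rev 9; critic V#176 N-g8-3): of the 28 tabulated U5 pairs at `p = 5` with `v₅∏c ≥ 1`, **25 are CLEAN** (the 3 unclean ones —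
`59040b1`, `59040c1` with `41 ∥ N`, `41 ≡ 1`, and `84960a1` with `59 ∥ N`, `59 ≡ −1`, the `≡ ±1` prime non-split — go to S4♮∕S5♮), and S∑ holds
WITH EQUALITY at all 25 (record values; list in `AUDIT-Pplus-print-g38.md` §5): the clean cut routes 25 ∕ 28 of the positive-depth family here.
WHY IT MIGHT FAIL AS A PROOF PLAN: (a′) marked-element patching and (b′) `K_{i,∞} = 𝔫ᵢM_∞` at `p ∥ N` were unwritten through rev 8; rev 9: written
at sketch level in `AUDIT-Pplus-print-g38.md` §3 (Lemmas I, J, H, E2; TW automatic by Lemma A), UNREFEREED — residual referee items R1–R5 (§4b).  [cite: DiamondCSS1997, Thm. 6.1] [cite: KisinModuli2009, (3.4.12)]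
[cite: DiamondTaylor1994, Thm. A] [cite: Ribet1984ICM, Ihara's lemma] [cite: Mazur1978, Cor. 4.1] [cite: SilvermanATAEC1994, Cor. IV.9.2 (d)] -/
def CleanCarrierSum : Prop :=
  ∀ (W : WeierstrassCurve ℚ) [W.IsElliptic] [W.IsGloballyMinimal] (p : ℕ) [Fact p.Prime],
    ClassX11a W p → ¬ Surj W p → 5 ≤ p → CleanLevel W p →
    ∀ t : ℚ, W.entireLFunction 1 / (W.realPeriodRat : ℂ) = (t : ℂ) →
      (padicValNat p W.tamagawaProduct : ℤ) ≤ padicValRat p t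

/-- **S5♮ — `UncleanOffRungResidual` (rev 8; DEFINITION, not a stub): S5 `OffRungResidual` RESTRICTED TO UNCLEAN LEVELS** — C_cc (`v_p∏c ≥ 2`,
`Ш(E)[p] = 0`) off both rungs at a level with some multiplicative prime `≡ ±1 (mod p)`: three or more split carriers, or a second carrier deeper than
the rung allows, in the presence of a trivial (`≡ 1`: Böckle–Khare–Manning Wiles defect `2n_q`) or `≡ −1` (two Steinberg signs) prime.  Open,
research; the clean complement of S5 is absorbed by S∑.  Trivially implied by S5 (`uncleanOffRungResidual_of_offRungResidual`).
[cite: BoeckleKhareManning2024, Thm. 1.1] [cite: Miller2011LMS, Def. 1.1] -/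
def UncleanOffRungResidual : Prop :=
  ∀ (W : WeierstrassCurve ℚ) [W.IsElliptic] [W.IsGloballyMinimal] (p : ℕ) [Fact p.Prime],
    ClassX11a W p → ¬ Surj W p → 5 ≤ p → ¬ CleanLevel W p → 2 ≤ padicValNat p W.tamagawaProduct →
    (∀ x : W.sha, (p : ℤ) • x = 0 → x = 0) → ¬ OnRungA W p → ¬ OnRungB W p → MissingUpperBoundAt W p

/-- S5 ⟹ S5♮ (real proof: forget the cleanness binder). [cite: Miller2011LMS, Def. 1.1] -/
theorem uncleanOffRungResidual_of_offRungResidual (h5 : OffRungResidual) : UncleanOffRungResidual :=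
  fun W _ _ p _ hX hns hp5 _ hdeep hSha hA hB => h5 W p hX hns hp5 hdeep hSha hA hB

/-- **THE GLUED SPLIT OF C_cc BY CLEANNESS (real proof): C_cc ⟸ S∑ (clean) ∧ S4 (unclean, on a rung) ∧ S5♮ (unclean, off the rungs)**, the
prints GZK ∕ modularity ∕ Mazur Cor. 4.1 feeding the record's socket `GL1Cartan.missingUpperBoundAt_of_valueDepth` in the three value-depth cases.
[cite: Miller2011LMS, Def. 1.1] [cite: Mazur1978, Cor. 4.1] [cite: SilvermanATAEC1994, Cor. IV.9.2 (d)] -/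
theorem tamagawaDepthCore_of_cleanCut
    (hnf : exists_isNewformOf) (hMz : mazur_not_dvd_maninConstant_of_odd)
    (hGZK : rank_eq_analyticRank_of_analyticRank_le_one)
    (hS : CleanCarrierSum) (h4 : TrivialPrimeFrame) (h5u : UncleanOffRungResidual) :
    ∀ (W : WeierstrassCurve ℚ) [W.IsElliptic] [W.IsGloballyMinimal] (p : ℕ) [Fact p.Prime],
      ClassX11a W p → ¬ Surj W p → 5 ≤ p → 2 ≤ padicValNat p W.tamagawaProduct →
      (∀ x : W.sha, (p : ℤ) • x = 0 → x = 0) → MissingUpperBoundAt W p := by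
  intro W _ _ p _ hX hns hp5 hdeep hSha
  by_cases hcl : CleanLevel W p
  · exact missingUpperBoundAt_of_valueDepth hGZK hnf hMz hX hp5 hSha (fun t ht => hS W p hX hns hp5 hcl t ht)
  · by_cases hA : OnRungA W p
    · refine missingUpperBoundAt_of_valueDepth hGZK hnf hMz hX hp5 hSha (fun t ht => ?_)
      obtain ⟨ℓ, hℓ, hsplit, hflat, hle⟩ := hA
      have hdepth : ((depth W p ℓ : ℕ) : ℤ) ≤ padicValRat p t := h4.1 W p hX hns hp5 hcl ℓ hsplit hflat t ht
      have hle' : ((padicValNat p W.tamagawaProduct : ℕ) : ℤ) ≤ ((depth W p ℓ : ℕ) : ℤ) := by exact_mod_cast hle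
      exact hle'.trans hdepth
    · by_cases hB : OnRungB W p
      · refine missingUpperBoundAt_of_valueDepth hGZK hnf hMz hX hp5 hSha (fun t ht => ?_)
        obtain ⟨ℓ₁, ℓ₂, hℓ₁, hℓ₂, hsplit₁, hflat₁, hne, hsplit₂, hcar₂, hle⟩ := hB
        have hdepth : ((depth W p ℓ₁ : ℕ) : ℤ) + 1 ≤ padicValRat p t :=
          h4.2 W p hX hns hp5 ℓ₁ ℓ₂ (Or.inl hcl) hsplit₁ hflat₁ hne hsplit₂ hcar₂ t ht
        have hle' : ((padicValNat p W.tamagawaProduct : ℕ) : ℤ) ≤ ((depth W p ℓ₁ : ℕ) : ℤ) + 1 := by exact_mod_cast hle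
        exact hle'.trans hdepth
      · exact h5u W p hX hns hp5 hcl hdeep hSha hA hB

/-- **S5 RECOVERED (real proof): the clean cut refines the rung cut — S5 ⟸ prints ∧ S∑ ∧ S4 ∧ S5♮.** [cite: Miller2011LMS, Def. 1.1] -/
theorem offRungResidual_of_cleanCut
    (hnf : exists_isNewformOf) (hMz : mazur_not_dvd_maninConstant_of_odd)
    (hGZK : rank_eq_analyticRank_of_analyticRank_le_one)
    (hS : CleanCarrierSum) (h4 : TrivialPrimeFrame) (h5u : UncleanOffRungResidual) : OffRungResidual :=
  fun W _ _ p _ hX hns hp5 hdeep hSha _ _ => tamagawaDepthCore_of_cleanCut hnf hMz hGZK hS h4 h5u W p hX hns hp5 hdeep hSha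

/-- **U5 FROM THE CLEAN CUT (real proof, hypothesis-fed): the thirteen prints + S∑ + S4♮ + S4ₚ + S5♮ + S6 — SIX statements, S2 ∕ S3 ∕ S5 not among
them — through the record's rev-12 turnkey BY NAME.**  Not stub-fed in rev 8 (W-79 + V#173 n2); the stub-fed composition of record for this file
remains `UpperNonSurjFive_of_monogen`. [cite: Miller2011LMS, Def. 1.1] [cite: Kato2004Asterisque, §17.13] -/
theorem UpperNonSurjFive_of_cleanCut (hP : PrintFacts) (hS : CleanCarrierSum) (hN : TrivialLevelNodeFrame)
    (hPp : PrincipalAtPFrame) (h5u : UncleanOffRungResidual) (h6 : ShaCoreResidual) : Theses.PrintX11a.UpperNonSurjFive := by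
  obtain ⟨hJs, hJn, h12, hnf, hns', hsp', hfine', hMz, hGZK, hCE, hGV, hI, hLL⟩ := hP
  exact upperNonSurjFive_of_elevenFacts_of_twoCores hJs hJn h12 hnf hns' hsp' hfine' hMz hGZK hCE hGV hI hLL h6
    (tamagawaDepthCore_of_cleanCut hnf hMz hGZK hS (trivialPrimeFrame_of_split hN hPp) h5u)

/-- **CLEAN ⟹ GENERIC at each carrier (real proof, elementary):** a ♭ prime `ℓ ≠ p` — `ℓ ≢ ±1 (mod p)` — has `p ∤ ℓ² − 1`.  (The converse holds
too for primes; twpatch5's «generic» = `p ∤ ℓ² − 1` at the split `ℓ ≠ p`, this line's «clean» = ♭ at EVERY multiplicative prime.) [folklore] -/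
theorem not_dvd_sq_sub_one_of_flatPrime {p ℓ : ℕ} (hp : p.Prime) (hℓ : ℓ.Prime) (hflat : FlatPrime p ℓ) (hne : ℓ ≠ p) :
    ¬ p ∣ ℓ ^ 2 - 1 := by
  rcases hflat with h | ⟨h1, h2⟩
  · exact absurd h hne
  · intro hdvd
    haveI := Fact.mk hp
    have h1le : 1 ≤ ℓ ^ 2 := Nat.one_le_pow _ _ hℓ.pos
    have h0 : ((ℓ ^ 2 - 1 : ℕ) : ZMod p) = 0 := (ZMod.natCast_eq_zero_iff _ _).2 hdvd
    rw [Nat.cast_sub h1le, Nat.cast_pow, Nat.cast_one] at h0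
    have hz : ((ℓ : ZMod p) + 1) * ((ℓ : ZMod p) - 1) = 0 := by linear_combination h0
    rcases mul_eq_zero.mp hz with h | h
    · apply h2
      have hcast : (ℓ : ZMod p) = ((p - 1 : ℕ) : ZMod p) := by
        rw [Nat.cast_sub hp.one_le, ZMod.natCast_self, Nat.cast_one, zero_sub]
        exact eq_neg_of_add_eq_zero_left h
      rw [(ZMod.natCast_eq_natCast_iff' ℓ (p - 1) p).mp hcast]
      exact Nat.mod_eq_of_lt (Nat.sub_lt hp.pos Nat.one_pos)
    · apply h1
      have hcast : (ℓ : ZMod p) = ((1 : ℕ) : ZMod p) := by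
        rw [Nat.cast_one]
        exact sub_eq_zero.mp h
      rw [(ZMod.natCast_eq_natCast_iff' ℓ 1 p).mp hcast]
      exact Nat.mod_eq_of_lt hp.one_lt

/-- **BRIDGE TO «twpatch5» (real proof): S∑ from any Taylor–Wiles-hypothesis supplier of the shape of `TWPatch.TWOnU5` and any value-depth
statement of the shape of `TWPatch.ValueDepthTW`** (stated over an abstract predicate `TW`, because `Cruxes/…/Lines/*.lean` are not importable
modules); instantiating `TW := TWPatch.TaylorWiles` with twpatch5's stubs S4, S2 gives `CleanCarrierSum` — the two lines share the clean sector.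
[cite: Wiles1995, Introduction] [cite: TaylorWiles1995, Thm. 1] -/
theorem cleanCarrierSum_of_generic (TW : WeierstrassCurve ℚ → ℕ → Prop)
    (hT : ∀ (W : WeierstrassCurve ℚ) [W.IsElliptic] [W.IsGloballyMinimal] (p : ℕ) [Fact p.Prime],
      ClassX11a W p → 5 ≤ p → TW W p)
    (hV : ∀ (W : WeierstrassCurve ℚ) [W.IsElliptic] [W.IsGloballyMinimal] (p : ℕ) [Fact p.Prime],
      ClassX11a W p → ¬ Surj W p → 5 ≤ p → TW W p →
      (∀ (ℓ : ℕ) [Fact ℓ.Prime], W.HasSplitMultiplicativeReductionAtPrime ℓ → ℓ ≠ p → ¬ p ∣ ℓ ^ 2 - 1) →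
      ∀ t : ℚ, W.entireLFunction 1 / (W.realPeriodRat : ℂ) = (t : ℂ) →
        (padicValNat p W.tamagawaProduct : ℤ) ≤ padicValRat p t) :
    CleanCarrierSum := by
  intro W _ _ p hp hX hns hp5 hcl t ht
  refine hV W p hX hns hp5 (hT W p hX hp5) ?_ t ht
  intro ℓ hℓ hsplit hne
  exact not_dvd_sq_sub_one_of_flatPrime hp.out hℓ.out (hcl ℓ hsplit.hasMultiplicativeReductionAtPrime) hne

/-! ## §4c (rev 10, g39 — the seat's lens «decomp») THE WIDE CUT: the clean sector widened to every level WITHOUT A TRIVIAL NODE (definitions + PROVED glue; no stub touched)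

The clean cut of §4b asks EVERY multiplicative prime of the level to be ♭ (`q = p` or `q ≢ ±1 (mod p)`).  The `≡ −1` half of that
restriction is NOT load-bearing for PROPOSITION P⁺: at a multiplicative `q ≡ −1 (mod p)`, `q ≠ p` (carrier or spectator) of a U5 pair the SIGN
`β := a_q(E) ∈ {±1}` is FIXED BY `𝔪` (`U_q ≡ β`, and `−β ≡ βq ≢ β` because `p` is odd), and with the sign fixed every input of P⁺ at `q` is the
input at a ♭ prime:
(E1⁻) LOCAL RING.  The relevant local factor is Böckle–Khare–Manning's β-fixed unipotent quotient `B_q^{(β)} := R_q^{uni(β)} = 𝓡 ⁄ (I^{St(β)} ∩ I^{unr})`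
— members of the `𝔪`-class at level `N ∋ q‖` are `q`-old (β-stabilised) or `St(β)`-new, never `St(−β)` (`U_q`-eigenvalue `−β ≢ β`) and never
supercuspidal (conductor `q²`), so `R_Σ → T_𝔪` factors through `B_q^{(β)}` — and `B_q^{(β)}` is the SAME NODE `S₀⟦X,y⟧/(Xy)` as at a ♭ prime: its two
branches `R^{unr} ≅ 𝒪⟦X₁,X₂,X₃⟧`, `R^{St(β)} ≅ 𝒪⟦X₁,X₂,X₃⟧` (`q` non-trivial) are formally smooth, `B^{(β)}` is their fibre product over
`𝓡 ⁄ (I^{St} + I^{unr}) = 𝒪⟦a,b,c⟧/(a(q − 1 + a) + (b + s)c)`, which is formally SMOOTH of relative dimension 2 because the linear part `(q − 1)da + s·dc`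
has the UNIT coefficient `q − 1 ≡ −2` — exactly the coefficient that dies at a trivial prime `q ≡ 1`; hence `I^{unr}·B = (y)`, `I^{St}·B = (X)`, mutual
annihilators, `B/(X, y) = S₀` [corpus: paper:arxiv-1910.08507 p.12 (`R_q^{uni(β_q)}`), p.13 Prop. 4.3 (1)(3)(5), p.23 (`I^{uni} = I^{St} ∩ I^{unr}`, the exact
sequence `0 → 𝓡/I^{uni} → R^{unr} × R^{St} → 𝓡/(I^{St} + I^{unr}) → 0`, CM ∕ reduced ∕ flat), p.28 Rem. 8.2 (`R_q^{St(β_q)} ≅ 𝒪⟦A,B,C⟧` at ALL `q ≡ −1`)];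
(f⁻) HENSEL SEPARATION.  The two residual Frobenius roots on the `𝔪`-old line are `β` and `βq ≡ −β`: DISTINCT (`p` odd), so the `β`-root `α̃_q` of
`X² − T_qX + q` exists over `T_{N/q,𝔪}` by Hensel, `α̃_q − β̃q ≡ 2β` is a UNIT (the unit of AUDIT Lemma I's `(W_n)` ∕ P⁺5's kernel comparison at a ♭
carrier was `α − β ≢ 0`; here it is the same unit), `U_q` is semisimple on the `q`-old part WITHOUT Coleman–Edixhoven, and `U_q ∈ im(R_Σ → T_𝔪)`;
the kernel anchor `henselSeparation_of_wideFlat` below records the two residue facts used — `s ≠ s·q` and `s ≠ −s` in `ZMod p` for `s² = 1`,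
`q ≢ 1`, `p ≠ 2` — and NOTHING ELSE about `q (mod p)` is used;
(M⁻) THE MARKED ELEMENT at a `−1` CARRIER (`β = +1`, `q` split, `p ∣ c_q`).  AUDIT Lemma J's unit `T_q + q + 1 ≡ β(q + 1) + (q + 1) ≡ 0` VANISHES at
`q ≡ −1`, so `D(i)` is NOT obtained from J there (REF §ZN (b): «(W) 3 ∕ 3 though J's unit vanishes»); it is obtained by ROUTE M = memo §2 P⁺3 `(W_n)`
(the identity `(U_q − 1)(0, −η′) = (η′, η′)` on the two `q`-old copies, NO unit needed) + P⁺5's kernel comparison `K_{q,∞} = I^{unr}M_∞` via AUDIT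
Lemma H on the level-`N/q` system and `PatchedWindingSpine.ker_toSpanSingleton_unit_eq`, and `𝔄_q := (U_q − 1) + I^{unr} = I^{St} + I^{unr}` is
the NODE IDEAL because `α̃_q − 1` cuts the crossing locus transversally (`dα̃ = d(tr)/(1 − q)` on `R^{unr}`: the unit of (f⁻)) — J's unit `T_q + q + 1` occurs
nowhere on this route, at ♭ and `−1` carriers alike;
(G±) INHABITATION.  `unr` is inhabited by the `𝔪`-old forms (level lowering at `q`, S1's `hLL`), `St(β)` by `f_E` itself, and at the Taylor–Wiles
levels by the sign-prescribed Steinberg newforms of Böckle–Khare–Manning I, Lemma 6.2 (proof via Ribet's congruences + Diamond–Taylor; SKETCHED in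
print) ∕ II §6 (Gee's Cor. 3.1.7); single-prime mechanism DERIVED: at `q ≡ −1` the old-space intersection matrix `[[q+1, T_q],[T_q, q+1]] ≡ 0 (mod 𝔪′)`,
so `Ω ⊗ k = (M′/𝔪′)²` carries BOTH `U_q`-eigenvalues `±1` and both `𝔪±` are `q`-new [corpus: paper:arxiv-1910.08507 p.18 (Lemma 6.2, proof);
paper:arxiv-2108.09729 p.18–19 (`R_v^{uni}`, `K_v = U_0(v)` at `Σ^{un}`), p.30 (§6.1 hypotheses: the `≢ −1` condition is imposed at `Σ^{min}` ONLY), p.32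
(full support via [Gee] Cor. 3.1.7)];
(B) MULTIPLICITY ONE ∕ GORENSTEIN at level `N`: Wiles Thm. 2.1 = Tilouine = Darmon–Diamond–Taylor Thm. 4.26 — NO hypothesis at `q ≠ p`
[corpus: book:cornell1997-modular-forms-fermats-last-theorem p.404 (Thm. 3.4)]; `T_𝔪` reduced at `−1` nodes by (f⁻).
DEPTH EXTRACTION at a `−1` carrier is P⁺7 verbatim (`St(β)` smooth with the monodromy `N` a coordinate: `λ_E(𝔄_q) = p^{n_q}ℤ_p`).
WHAT REMAINS OUTSIDE = exactly Böckle–Khare–Manning's TRIVIAL primes [ibid. p.8 Def. 2.1: `q ≡ 1 (mod p)`, `ρ̄` unramified, `ρ̄(Frob_q) = ±Id`]: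
on U5 every multiplicative `q ≡ 1 (mod p)`, `q ≠ p`, split or not, IS trivial (the image of `ρ̄` has order prime to `p`, so `ρ̄(Frob_q)` is
semisimple with both eigenvalues `≡ β`; g29 memo F3 ∕ `TameInstrumentVacuous.lean`): there `R^{St}` is NOT smooth (Wiles defect `2n_q`), the
Hensel roots COLLIDE, `U_q ∉ im R_Σ`, (f⁻) fails — research (S4♮ᵗ ∕ S4ₚᵗ ∕ S5♮ᵗ below, = S4♮ ∕ S4ₚ ∕ S5♮ of revs 5–8 NARROWED to levels with a
trivial node).  So the DECOMP move of rev 10: `WideCleanLevel` («no trivial node»: every multiplicative `q` has `q = p` or `q ≢ 1 (mod p)`)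
replaces `CleanLevel` as the cut; S∑ʷ `WideCarrierSum` ⊇ S∑ takes the whole no-trivial-node sector (the `≡ −1` nodes — carriers or spectators —
included); the residual frames shrink to trivial-node levels; the glue `tamagawaDepthCore_of_wideCut` ∕ `wideTrivialPrimeFrame_of_split` ∕
`UpperNonSurjFive_of_wideCut` is PROVED, and the wide cut is fed by the OLD statements through proved weakenings (`UpperNonSurjFive_of_wideCut'`:
prints + S∑ʷ + S4♮ + S4ₚ + S5♮ + S6 ⟹ U5), so nothing of revs 5–9 is invalidated.  The rungs `OnRungA ∕ OnRungB` keep their ♭ principal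
prime (NOT DECOMPOSED YET: «OnRungʷ» with a wide-♭ principal prime — no tabulated pair needs it).
POPULATION (BSD-free data + REF records, `p = 5`, `N < 5·10⁵` unless marked): of the 28 positive-depth tabulated U5 pairs 25 are clean (rev 9) and
**26 are WIDE-CLEAN** — `84960a1` (`N = 2⁵·3²·5·59`: carrier `5` split, `c₅ = 5`; node `59 ≡ −1` NON-split, a spectator; `ord₅(L/Ω) = 1 = v₅∏c`,
equality) joins S∑ʷ's sector; the two that stay out, `59040b1 ∕ c1` (`41 ≡ 1` non-split), have a TRIVIAL node; at `p = 7`, E₃@7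
(`N = 2⁴·3⁴·7·131²·251`, carriers `7` (`c₇ = 7`) and `251 ≡ −1` SPLIT (`c₂₅₁ = 7`), `v₇∏c = 2 = ord₇(L/Ω)`, `Ш_an = 1`) moves from S4ₚ (B) INTO
S∑ʷ — the first tabulated pair with a `−1` CARRIER, bound met with equality; S4ₚᵗ keeps `118080ds1`@5 (`41`) and REF §ZB add. 1 pairs (2) (`1451`),
(3) (`18401`), (4) (`101`), (8) (`101`; its `199 ≡ −1` non-split node is now harmless) — ALL with a trivial node, as the narrowing predicts
(«the principal carrier is `p` because the other split carrier is trivial»); REF's `−1`-regime member checks (§ZM ∕ §ZN: `1406 = 2·19·37`@5,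
`3458 = 2·7·13·19`@5, `13601 = 7·29·67`@5; `δ₁₂ = 1, 1, 2`): multiplicity one, Gorenstein, `(W)`, `ob(η) = 0`, values = bounds, 3 ∕ 3; KIT-T± (signed
carriers) 5 ∕ 5; PREDICTION 3 equality 30 ∕ 30 member-wise.  The record's CE-free helper `GL1Cartan.Exc.sub_ne_of_emod_ne_one` ∕
`exists_multiStab_of_emod_ne_one` (`Theorems/PrintX11aUpperNonSurjFiveExcMultiStabCongr.lean`, hypothesis `∀ q ∣ D, q % p ≠ 1`) has EXACTLY the
wide-♭ hypothesis: the record's Coleman–Edixhoven-free locus and this line's wide sector coincide, and CE is load-bearing precisely at the trivial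
nodes.  FALSIFIERS (REF rows, kit 0 at this seat): KIT-W⁻ — a wide-clean level with two `+`-carriers AND a `−1` node (carrier or spectator):
`ob(η) = 0` and `v_p λ_g(t_η) ≥ n₁ + n₂` member-wise (a kill retypes S∑ʷ back to S∑ and returns the `−1` nodes to the frames); KIT-U (trivial node,
unchanged).  BC7 (`bc/probe-monogen5-r10.lean`, conjunct level): see `Lines/monogen5.md` REV 10.  BSD is not proved by any of this; U5 does not
close (S4♮ᵗ, S4ₚᵗ, S5♮ᵗ, S6 open; S∑ʷ print-composite ∕ research-S as S∑).
[cite: BockleKhareManning2021, Def. 2.1, §4 (R^uni(β)), Prop. 4.3, Lemma 6.2, §7 (explicit I^uni), Rem. 8.2] [cite: BoeckleKhareManning2024, §3 (R_v^uni), §6.1, Thm. 6.4]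
[cite: Tilouine1997Gorenstein, Thm. 3.4] [cite: Wiles1995Annals, Thm. 2.1] [cite: DarmonDiamondTaylor1995, Thm. 4.26] [cite: KimOta2019, Rem. 1.17 (3)]
[cite: SilvermanATAEC1994, Cor. IV.9.2 (d)] [cite: Miller2011LMS, Def. 1.1] -/

/-- **WIDE-♭ prime for `p`** («not a trivial node»): `ℓ = p`, or `ℓ ≢ 1 (mod p)` — the ♭ primes AND the sign-coincident nodes `ℓ ≡ −1 (mod p)`.
At such `ℓ ≠ p` the residual Frobenius roots `{βℓ, β}` of an unramified `ρ̄|G_ℓ` with cyclotomic determinant are DISTINCT (`p` odd), the sign-fixed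
unipotent ring `R_ℓ^{uni(β)}` is the node `S₀⟦X,y⟧/(Xy)`, and `U_ℓ ∈ im R_Σ`; what is lost against ♭ is only `βℓ ≢ −β` (the OTHER sign's Steinberg
component passes through `ρ̄`), which `𝔪 ∋ U_ℓ − β` discards.  Complement = Böckle–Khare–Manning's trivial primes.
[cite: BockleKhareManning2021, Def. 2.1 and Prop. 4.3] -/
def WideFlatPrime (p ℓ : ℕ) : Prop :=
  ℓ = p ∨ ℓ % p ≠ 1

/-- **WIDE-CLEAN LEVEL for `(E, p)`** («no trivial node»): every multiplicative prime of `E` is wide-♭ for `p` — no multiplicative `q ≠ p` with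
`q ≡ 1 (mod p)`.  (On U5 a multiplicative `q ≡ 1 (mod p)` automatically has `ρ̄(Frob_q) = ±Id`: g29 memo F3.) [cite: BockleKhareManning2021, Def. 2.1] -/
def WideCleanLevel (W : WeierstrassCurve ℚ) (p : ℕ) : Prop :=
  ∀ (q : ℕ) [Fact q.Prime], W.HasMultiplicativeReductionAtPrime q → WideFlatPrime p q

/-- ♭ ⟹ wide-♭ (real proof). [cite: BockleKhareManning2021, Def. 2.1] -/
theorem wideFlatPrime_of_flatPrime {p ℓ : ℕ} (h : FlatPrime p ℓ) : WideFlatPrime p ℓ :=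
  h.imp_right And.left

/-- clean ⟹ wide-clean (real proof). [cite: BockleKhareManning2021, Def. 2.1] -/
theorem wideCleanLevel_of_cleanLevel {W : WeierstrassCurve ℚ} {p : ℕ} (h : CleanLevel W p) : WideCleanLevel W p :=
  fun q _ hq => wideFlatPrime_of_flatPrime (h q hq)

/-- **The complement of the wide cut is «has a TRIVIAL NODE»** (real proof): a level is not wide-clean iff some multiplicative `q ≠ p` has
`q ≡ 1 (mod p)`. [cite: BockleKhareManning2021, Def. 2.1] -/
theorem not_wideCleanLevel_iff (W : WeierstrassCurve ℚ) (p : ℕ) :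
    ¬ WideCleanLevel W p ↔
      ∃ (q : ℕ) (_ : Fact q.Prime), W.HasMultiplicativeReductionAtPrime q ∧ q ≠ p ∧ q % p = 1 := by
  constructor
  · intro h
    by_contra hne
    apply h
    intro q hq hmult
    by_contra hflat
    have h1 : ¬ q = p := fun h1 => hflat (Or.inl h1)
    have h2 : q % p = 1 := by
      by_contra h2
      exact hflat (Or.inr h2)
    exact hne ⟨q, hq, hmult, h1, h2⟩
  · rintro ⟨q, hq, hmult, hne, hmod⟩ h
    rcases h q hmult with h1 | h1
    · exact hne h1
    · exact h1 hmod

/-- Kernel arithmetic of the cut (sanity): at `p = 5` the node `59 ≡ −1` of `84960a1` is wide-♭ but not ♭, the trivial node `41` of `59040b1 ∕ c1`,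
`118080ds1` and the trivial carriers `1451`, `101` of REF's pairs (2), (4), (8) are not wide-♭; at `p = 7` E₃'s second carrier `251 ≡ −1` is wide-♭, not ♭,
and the KIT-U witness prime `337 ≡ 1` is not wide-♭. [cite: BockleKhareManning2021, Def. 2.1] -/
example : WideFlatPrime 5 59 ∧ ¬ FlatPrime 5 59 ∧ ¬ WideFlatPrime 5 41 ∧ ¬ WideFlatPrime 5 1451 ∧ ¬ WideFlatPrime 5 101 ∧
    WideFlatPrime 7 251 ∧ ¬ FlatPrime 7 251 ∧ ¬ WideFlatPrime 7 337 ∧ WideFlatPrime 5 5 ∧ WideFlatPrime 5 37 := by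
  unfold WideFlatPrime FlatPrime
  decide

/-- **The two HENSEL SEPARATIONS at a wide-♭ node (kernel arithmetic; the ONLY residue facts about `q (mod p)` that (E1⁻) ∕ (f⁻) ∕ (M⁻) use).**
For an odd prime `p`, a sign `s` (`s² = 1`) and `q ≢ 1 (mod p)`, in `ZMod p`: (i) the two residual Frobenius roots `s` and `s·q` on the `𝔪`-old line
are DISTINCT — Hensel root `α̃_q`, the unit `α̃_q − s̃q`, `U_q ∈ im R_Σ`, `U_q` semisimple on the old part without Coleman–Edixhoven, and the smooth
crossing locus of (E1⁻) (unit `q − 1`); (ii) the two SIGNS are distinct, `s ≠ −s` — `𝔪 ∋ U_q − s` discards the `St(−s)` component.  At a trivial node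
(`q ≡ 1`) (i) fails.  (At a ♭ node additionally `s·q ≠ −s`; at `q ≡ −1` these COINCIDE — the sign-coincidence that makes `R_q^□ ⊋ R_q^{uni(s)}` there and is
harmless once the sign is fixed.) [cite: BockleKhareManning2021, §4 and Prop. 4.3] -/
theorem henselSeparation_of_wideFlat {p : ℕ} [Fact p.Prime] (hp2 : p ≠ 2) {q : ℕ} (hq : q % p ≠ 1)
    (s : ZMod p) (hs : s ^ 2 = 1) : s ≠ s * q ∧ s ≠ -s := by
  have hp : p.Prime := Fact.out
  have hs0 : s ≠ 0 := by
    rintro rfl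
    norm_num at hs
  constructor
  · intro h
    apply hq
    have h1 : s * ((q : ZMod p) - 1) = 0 := by linear_combination (-1 : ZMod p) * h
    rcases mul_eq_zero.mp h1 with h2 | h2
    · exact absurd h2 hs0
    · have hcast : ((q : ℕ) : ZMod p) = ((1 : ℕ) : ZMod p) := by
        rw [Nat.cast_one]
        exact sub_eq_zero.mp h2
      rw [(ZMod.natCast_eq_natCast_iff' q 1 p).mp hcast]
      exact Nat.mod_eq_of_lt hp.one_lt
  · intro h
    have h2 : (2 : ZMod p) * s = 0 := by linear_combination h
    rcases mul_eq_zero.mp h2 with h3 | h3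
    · apply hp2
      have hcast : ((2 : ℕ) : ZMod p) = 0 := by exact_mod_cast h3
      exact (Nat.prime_dvd_prime_iff_eq hp Nat.prime_two).mp ((ZMod.natCast_eq_zero_iff 2 p).mp hcast)
    · exact absurd h3 hs0

/-- **S∑ʷ — `WideCarrierSum` (rev 10; DEFINITION, not a stub): on a WIDE-CLEAN level (no trivial node) the `p`-adic valuation of `L(E,1)/Ω_E` is at
least the FULL Tamagawa depth `v_p ∏_ℓ c_ℓ` — all split carriers incl. `ℓ = p` and the `≡ −1 (mod p)` ones, any depths, any number, any `≡ −1`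
spectators.**  = PROPOSITION P⁺ on the wide sector: the clean-level mechanism of §4b ∕ §5 with (E1⁻)(f⁻)(M⁻)(G±)(B) of this section's header at the `−1`
nodes; print-composite ∕ research-S exactly as S∑ (the referee items R1–R7 of `AUDIT-Pplus-print-g38.md` unchanged; ONE new audit row E1⁻ = BKM I §4 ∕ §7
verbatim + the unit `q − 1`).  ⟹ S∑ (`cleanCarrierSum_of_wideCarrierSum`).  A consequence of BSD; strictly weaker than U5 (no `#Ш`); NOT the crux in costume
(silent when `Ш[p] ≠ 0`).  NUMERICAL STANDING: member-wise 30 ∕ 30 incl. the three `−1`-regime levels; curve-side equality at all 26 wide-clean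
positive-depth tabulated pairs at `p = 5` and at E₃@7 ∕ `F`@7.  WHY IT MIGHT FAIL AS A PROOF PLAN: a `−1` node could obstruct the marked-element patching
in a way (W) at one TW level does not see (KIT-W⁻ is the row); the `p ∥ N` ordinary-at-`p` transfer of BKM II §6 (F1″-ord, shared with S∑) is unwritten.
[cite: BockleKhareManning2021, §4, Prop. 4.3, Lemma 6.2, Rem. 8.2] [cite: BoeckleKhareManning2024, §6.1 and Thm. 6.4] [cite: Tilouine1997Gorenstein, Thm. 3.4]
[cite: KimOta2019, Thm. 1.3] [cite: Mazur1978, Cor. 4.1] [cite: SilvermanATAEC1994, Cor. IV.9.2 (d)] -/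
def WideCarrierSum : Prop :=
  ∀ (W : WeierstrassCurve ℚ) [W.IsElliptic] [W.IsGloballyMinimal] (p : ℕ) [Fact p.Prime],
    ClassX11a W p → ¬ Surj W p → 5 ≤ p → WideCleanLevel W p →
    ∀ t : ℚ, W.entireLFunction 1 / (W.realPeriodRat : ℂ) = (t : ℂ) →
      (padicValNat p W.tamagawaProduct : ℤ) ≤ padicValRat p t

/-- S∑ʷ ⟹ S∑ (real proof: a clean level is wide-clean). [cite: KimOta2019, Thm. 1.3] -/
theorem cleanCarrierSum_of_wideCarrierSum (h : WideCarrierSum) : CleanCarrierSum :=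
  fun W _ _ p _ hX hns hp5 hcl t ht => h W p hX hns hp5 (wideCleanLevel_of_cleanLevel hcl) t ht

/-- **S4♮ᵗ — `TrivialNodeFrame` (rev 10): S4♮ `TrivialLevelNodeFrame` NARROWED to levels WITH A TRIVIAL NODE** (both conjuncts under
`¬ WideCleanLevel`: some multiplicative `q ≠ p`, `q ≡ 1 (mod p)` — on U5 automatically `ρ̄(Frob_q) = ±Id`, Böckle–Khare–Manning-trivial); ♭ principal
prime `ℓ₁ ≠ p`; content = F1″-ord at the levels containing the trivial node (research-S, unchanged from S4♮; the `−1`-only unclean levels have LEFT this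
statement for S∑ʷ).  Population: REF §ZB add. 1 pairs (6) (`701`), (9) (`1051`), (10) (`7001`) — each with a trivial carrier.  ⟸ S4♮
(`trivialNodeFrame_of_trivialLevelNodeFrame`).  Strictly weaker than U5. [cite: BoeckleKhareManning2024, Lemma 6.3 and Thm. 6.4]
[cite: BockleKhareManning2021, Def. 2.1] [cite: SilvermanATAEC1994, Cor. IV.9.2 (d)] -/
def TrivialNodeFrame : Prop :=
  (∀ (W : WeierstrassCurve ℚ) [W.IsElliptic] [W.IsGloballyMinimal] (p : ℕ) [Fact p.Prime],
      ClassX11a W p → ¬ Surj W p → 5 ≤ p → ¬ WideCleanLevel W p →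
      ∀ (ℓ : ℕ) [Fact ℓ.Prime], W.HasSplitMultiplicativeReductionAtPrime ℓ → FlatPrime p ℓ → ℓ ≠ p →
      ∀ t : ℚ, W.entireLFunction 1 / (W.realPeriodRat : ℂ) = (t : ℂ) →
        ((depth W p ℓ : ℕ) : ℤ) ≤ padicValRat p t) ∧
  (∀ (W : WeierstrassCurve ℚ) [W.IsElliptic] [W.IsGloballyMinimal] (p : ℕ) [Fact p.Prime],
      ClassX11a W p → ¬ Surj W p → 5 ≤ p → ¬ WideCleanLevel W p →
      ∀ (ℓ₁ ℓ₂ : ℕ) [Fact ℓ₁.Prime] [Fact ℓ₂.Prime], ℓ₁ ≠ p →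
        W.HasSplitMultiplicativeReductionAtPrime ℓ₁ → FlatPrime p ℓ₁ → ℓ₂ ≠ ℓ₁ →
        W.HasSplitMultiplicativeReductionAtPrime ℓ₂ → p ∣ padicValInt ℓ₂ W.minimalDiscriminantInt →
      ∀ t : ℚ, W.entireLFunction 1 / (W.realPeriodRat : ℂ) = (t : ℂ) →
        ((depth W p ℓ₁ : ℕ) : ℤ) + 1 ≤ padicValRat p t)

/-- S4♮ ⟹ S4♮ᵗ (real proof: a level with a trivial node is unclean). [cite: BockleKhareManning2021, Def. 2.1] -/
theorem trivialNodeFrame_of_trivialLevelNodeFrame (h : TrivialLevelNodeFrame) : TrivialNodeFrame :=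
  ⟨fun W _ _ p _ hX hns hp5 hw ℓ _ hsplit hflat hne t ht =>
      h.1 W p hX hns hp5 (fun hcl => hw (wideCleanLevel_of_cleanLevel hcl)) ℓ hsplit hflat hne t ht,
   fun W _ _ p _ hX hns hp5 hw ℓ₁ ℓ₂ _ _ hne₁ hsplit₁ hflat₁ hne hsplit₂ hcar₂ t ht =>
      h.2 W p hX hns hp5 (fun hcl => hw (wideCleanLevel_of_cleanLevel hcl)) ℓ₁ ℓ₂ hne₁ hsplit₁ hflat₁ hne hsplit₂ hcar₂ t ht⟩

/-- **S4ₚᵗ — `TrivialNodePrincipalAtPFrame` (rev 10): S4ₚ `PrincipalAtPFrame` NARROWED to levels WITH A TRIVIAL NODE** (both conjuncts — (B) too,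
which in S4ₚ was «at any level»: a wide-clean level with principal carrier `p` and a second carrier is now S∑ʷ's, e.g. E₃@7 with carriers `7`,
`251 ≡ −1`).  Content = F1″-ord + AUDIT Lemma E2 (the `ℓ = p` node, DERIVED at sketch level) + raising at `p`, at levels containing a trivial node;
research-M as S4ₚ.  Population: `118080ds1`@5 (`41`), REF §ZB add. 1 pairs (2) (`1451`), (3) (`18401`), (4) (`101`), (8) (`101`) — every tabulated S4ₚ
member except E₃@7, each with a trivial node.  ⟸ S4ₚ (`trivialNodePrincipalAtPFrame_of_principalAtPFrame`).  Strictly weaker than U5.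
[cite: Ribet1990RaisingLevels, Remark 3] [cite: BoeckleKhareManning2024, Thm. 6.4] [cite: BockleKhareManning2021, Def. 2.1]
[cite: SilvermanATAEC1994, Cor. IV.9.2 (d)] -/
def TrivialNodePrincipalAtPFrame : Prop :=
  (∀ (W : WeierstrassCurve ℚ) [W.IsElliptic] [W.IsGloballyMinimal] (p : ℕ) [Fact p.Prime],
      ClassX11a W p → ¬ Surj W p → 5 ≤ p → ¬ WideCleanLevel W p → W.HasSplitMultiplicativeReductionAtPrime p →
      ∀ t : ℚ, W.entireLFunction 1 / (W.realPeriodRat : ℂ) = (t : ℂ) →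
        ((depth W p p : ℕ) : ℤ) ≤ padicValRat p t) ∧
  (∀ (W : WeierstrassCurve ℚ) [W.IsElliptic] [W.IsGloballyMinimal] (p : ℕ) [Fact p.Prime],
      ClassX11a W p → ¬ Surj W p → 5 ≤ p → ¬ WideCleanLevel W p →
      ∀ (ℓ₂ : ℕ) [Fact ℓ₂.Prime], W.HasSplitMultiplicativeReductionAtPrime p → ℓ₂ ≠ p →
        W.HasSplitMultiplicativeReductionAtPrime ℓ₂ → p ∣ padicValInt ℓ₂ W.minimalDiscriminantInt →
      ∀ t : ℚ, W.entireLFunction 1 / (W.realPeriodRat : ℂ) = (t : ℂ) →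
        ((depth W p p : ℕ) : ℤ) + 1 ≤ padicValRat p t)

/-- S4ₚ ⟹ S4ₚᵗ (real proof). [cite: Ribet1990RaisingLevels, Remark 3] -/
theorem trivialNodePrincipalAtPFrame_of_principalAtPFrame (h : PrincipalAtPFrame) : TrivialNodePrincipalAtPFrame :=
  ⟨fun W _ _ p _ hX hns hp5 hw hsplit t ht =>
      h.1 W p hX hns hp5 (fun hcl => hw (wideCleanLevel_of_cleanLevel hcl)) hsplit t ht,
   fun W _ _ p _ hX hns hp5 _ ℓ₂ _ hsplit hne hsplit₂ hcar₂ t ht =>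
      h.2 W p hX hns hp5 ℓ₂ hsplit hne hsplit₂ hcar₂ t ht⟩

/-- **S4ᵗ — `WideTrivialPrimeFrame` (rev 10; ASSEMBLY NODE, proved from S4♮ᵗ ∧ S4ₚᵗ): (A)+(B) with ♭ principal prime at a level WITH A TRIVIAL NODE**
— S4 `TrivialPrimeFrame` narrowed to `¬ WideCleanLevel` in both conjuncts (conjunct (B)'s «or `ℓ₁ = p` at any level» dropped: that case is wide-clean or
has a trivial node).  ⟸ S4 (`wideTrivialPrimeFrame_of_trivialPrimeFrame`). [cite: BoeckleKhareManning2024, Thm. 6.4] [cite: SilvermanATAEC1994, Cor. IV.9.2 (d)] -/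
def WideTrivialPrimeFrame : Prop :=
  (∀ (W : WeierstrassCurve ℚ) [W.IsElliptic] [W.IsGloballyMinimal] (p : ℕ) [Fact p.Prime],
      ClassX11a W p → ¬ Surj W p → 5 ≤ p → ¬ WideCleanLevel W p →
      ∀ (ℓ : ℕ) [Fact ℓ.Prime], W.HasSplitMultiplicativeReductionAtPrime ℓ → FlatPrime p ℓ →
      ∀ t : ℚ, W.entireLFunction 1 / (W.realPeriodRat : ℂ) = (t : ℂ) →
        ((depth W p ℓ : ℕ) : ℤ) ≤ padicValRat p t) ∧
  (∀ (W : WeierstrassCurve ℚ) [W.IsElliptic] [W.IsGloballyMinimal] (p : ℕ) [Fact p.Prime],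
      ClassX11a W p → ¬ Surj W p → 5 ≤ p → ¬ WideCleanLevel W p →
      ∀ (ℓ₁ ℓ₂ : ℕ) [Fact ℓ₁.Prime] [Fact ℓ₂.Prime],
        W.HasSplitMultiplicativeReductionAtPrime ℓ₁ → FlatPrime p ℓ₁ → ℓ₂ ≠ ℓ₁ →
        W.HasSplitMultiplicativeReductionAtPrime ℓ₂ → p ∣ padicValInt ℓ₂ W.minimalDiscriminantInt →
      ∀ t : ℚ, W.entireLFunction 1 / (W.realPeriodRat : ℂ) = (t : ℂ) →
        ((depth W p ℓ₁ : ℕ) : ℤ) + 1 ≤ padicValRat p t)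

/-- **rev 10 DECOMP: S4ᵗ ⟸ S4♮ᵗ ∧ S4ₚᵗ (real proof — case on whether the principal prime is `p`; the rev-5 split one level down).**
[cite: BoeckleKhareManning2024, Lemma 6.3 and Thm. 6.4] [cite: Ribet1990RaisingLevels, Remark 3] -/
theorem wideTrivialPrimeFrame_of_split (hN : TrivialNodeFrame) (hP : TrivialNodePrincipalAtPFrame) :
    WideTrivialPrimeFrame := by
  refine ⟨?_, ?_⟩
  · intro W _ _ p _ hX hns hp5 hw ℓ _ hsplit hflat t ht
    by_cases h : ℓ = p
    · subst h
      exact hP.1 W _ hX hns hp5 hw hsplit t ht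
    · exact hN.1 W p hX hns hp5 hw ℓ hsplit hflat h t ht
  · intro W _ _ p _ hX hns hp5 hw ℓ₁ ℓ₂ _ _ hsplit₁ hflat₁ hne hsplit₂ hcar₂ t ht
    by_cases h : ℓ₁ = p
    · subst h
      exact hP.2 W _ hX hns hp5 hw ℓ₂ hsplit₁ hne hsplit₂ hcar₂ t ht
    · exact hN.2 W p hX hns hp5 hw ℓ₁ ℓ₂ h hsplit₁ hflat₁ hne hsplit₂ hcar₂ t ht

/-- S4 ⟹ S4ᵗ (real proof: the old frame, fed by revs 5–9, covers the narrowed one). [cite: BoeckleKhareManning2024, Thm. 6.4] -/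
theorem wideTrivialPrimeFrame_of_trivialPrimeFrame (h : TrivialPrimeFrame) : WideTrivialPrimeFrame :=
  ⟨fun W _ _ p _ hX hns hp5 hw ℓ _ hsplit hflat t ht =>
      h.1 W p hX hns hp5 (fun hcl => hw (wideCleanLevel_of_cleanLevel hcl)) ℓ hsplit hflat t ht,
   fun W _ _ p _ hX hns hp5 hw ℓ₁ ℓ₂ _ _ hsplit₁ hflat₁ hne hsplit₂ hcar₂ t ht =>
      h.2 W p hX hns hp5 ℓ₁ ℓ₂ (Or.inl fun hcl => hw (wideCleanLevel_of_cleanLevel hcl)) hsplit₁ hflat₁ hne hsplit₂ hcar₂ t ht⟩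

/-- **S5♮ᵗ — `TrivialNodeOffRungResidual` (rev 10; DEFINITION): S5 `OffRungResidual` RESTRICTED TO LEVELS WITH A TRIVIAL NODE** — C_cc off both rungs
in the presence of a multiplicative `q ≡ 1 (mod p)`, `q ≠ p` (Wiles defect `2n_q`, `R^{St}` singular, Hensel roots collide).  Open, research; the
`−1`-only part of S5♮ has LEFT for S∑ʷ.  ⟸ S5♮ ⟸ S5. [cite: BoeckleKhareManning2024, Thm. 1.1] [cite: BockleKhareManning2021, Def. 2.1]
[cite: Miller2011LMS, Def. 1.1] -/
def TrivialNodeOffRungResidual : Prop :=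
  ∀ (W : WeierstrassCurve ℚ) [W.IsElliptic] [W.IsGloballyMinimal] (p : ℕ) [Fact p.Prime],
    ClassX11a W p → ¬ Surj W p → 5 ≤ p → ¬ WideCleanLevel W p → 2 ≤ padicValNat p W.tamagawaProduct →
    (∀ x : W.sha, (p : ℤ) • x = 0 → x = 0) → ¬ OnRungA W p → ¬ OnRungB W p → MissingUpperBoundAt W p

/-- S5♮ ⟹ S5♮ᵗ (real proof). [cite: Miller2011LMS, Def. 1.1] -/
theorem trivialNodeOffRungResidual_of_unclean (h : UncleanOffRungResidual) : TrivialNodeOffRungResidual :=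
  fun W _ _ p _ hX hns hp5 hw hdeep hSha hA hB =>
    h W p hX hns hp5 (fun hcl => hw (wideCleanLevel_of_cleanLevel hcl)) hdeep hSha hA hB

/-- **THE GLUED SPLIT OF C_cc BY THE WIDE CUT (real proof): C_cc ⟸ S∑ʷ (no trivial node) ∧ S4ᵗ (trivial node, on a rung) ∧ S5♮ᵗ (trivial node, off
the rungs)**, the prints GZK ∕ modularity ∕ Mazur Cor. 4.1 feeding the record's socket `GL1Cartan.missingUpperBoundAt_of_valueDepth`.
[cite: Miller2011LMS, Def. 1.1] [cite: Mazur1978, Cor. 4.1] [cite: SilvermanATAEC1994, Cor. IV.9.2 (d)] -/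
theorem tamagawaDepthCore_of_wideCut
    (hnf : exists_isNewformOf) (hMz : mazur_not_dvd_maninConstant_of_odd)
    (hGZK : rank_eq_analyticRank_of_analyticRank_le_one)
    (hS : WideCarrierSum) (h4 : WideTrivialPrimeFrame) (h5t : TrivialNodeOffRungResidual) :
    ∀ (W : WeierstrassCurve ℚ) [W.IsElliptic] [W.IsGloballyMinimal] (p : ℕ) [Fact p.Prime],
      ClassX11a W p → ¬ Surj W p → 5 ≤ p → 2 ≤ padicValNat p W.tamagawaProduct →
      (∀ x : W.sha, (p : ℤ) • x = 0 → x = 0) → MissingUpperBoundAt W p := by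
  intro W _ _ p _ hX hns hp5 hdeep hSha
  by_cases hw : WideCleanLevel W p
  · exact missingUpperBoundAt_of_valueDepth hGZK hnf hMz hX hp5 hSha (fun t ht => hS W p hX hns hp5 hw t ht)
  · by_cases hA : OnRungA W p
    · refine missingUpperBoundAt_of_valueDepth hGZK hnf hMz hX hp5 hSha (fun t ht => ?_)
      obtain ⟨ℓ, hℓ, hsplit, hflat, hle⟩ := hA
      have hdepth : ((depth W p ℓ : ℕ) : ℤ) ≤ padicValRat p t := h4.1 W p hX hns hp5 hw ℓ hsplit hflat t ht
      have hle' : ((padicValNat p W.tamagawaProduct : ℕ) : ℤ) ≤ ((depth W p ℓ : ℕ) : ℤ) := by exact_mod_cast hle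
      exact hle'.trans hdepth
    · by_cases hB : OnRungB W p
      · refine missingUpperBoundAt_of_valueDepth hGZK hnf hMz hX hp5 hSha (fun t ht => ?_)
        obtain ⟨ℓ₁, ℓ₂, hℓ₁, hℓ₂, hsplit₁, hflat₁, hne, hsplit₂, hcar₂, hle⟩ := hB
        have hdepth : ((depth W p ℓ₁ : ℕ) : ℤ) + 1 ≤ padicValRat p t :=
          h4.2 W p hX hns hp5 hw ℓ₁ ℓ₂ hsplit₁ hflat₁ hne hsplit₂ hcar₂ t ht
        have hle' : ((padicValNat p W.tamagawaProduct : ℕ) : ℤ) ≤ ((depth W p ℓ₁ : ℕ) : ℤ) + 1 := by exact_mod_cast hle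
        exact hle'.trans hdepth
      · exact h5t W p hX hns hp5 hw hdeep hSha hA hB

/-- **S5 RECOVERED from the wide cut (real proof): S5 ⟸ prints ∧ S∑ʷ ∧ S4ᵗ ∧ S5♮ᵗ.** [cite: Miller2011LMS, Def. 1.1] -/
theorem offRungResidual_of_wideCut
    (hnf : exists_isNewformOf) (hMz : mazur_not_dvd_maninConstant_of_odd)
    (hGZK : rank_eq_analyticRank_of_analyticRank_le_one)
    (hS : WideCarrierSum) (h4 : WideTrivialPrimeFrame) (h5t : TrivialNodeOffRungResidual) : OffRungResidual :=
  fun W _ _ p _ hX hns hp5 hdeep hSha _ _ => tamagawaDepthCore_of_wideCut hnf hMz hGZK hS h4 h5t W p hX hns hp5 hdeep hSha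

/-- **U5 FROM THE WIDE CUT (real proof, hypothesis-fed): the thirteen prints + S∑ʷ + S4♮ᵗ + S4ₚᵗ + S5♮ᵗ + S6 — the three residual frames now quantify
over levels WITH A TRIVIAL NODE only — through the record's rev-12 turnkey BY NAME.**  Not stub-fed (W-79 + V#173 n2); the stub-fed composition of
record for this file remains `UpperNonSurjFive_of_monogen`. [cite: Miller2011LMS, Def. 1.1] [cite: Kato2004Asterisque, §17.13] -/
theorem UpperNonSurjFive_of_wideCut (hP : PrintFacts) (hS : WideCarrierSum) (hN : TrivialNodeFrame)
    (hPp : TrivialNodePrincipalAtPFrame) (h5t : TrivialNodeOffRungResidual) (h6 : ShaCoreResidual) :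
    Theses.PrintX11a.UpperNonSurjFive := by
  obtain ⟨hJs, hJn, h12, hnf, hns', hsp', hfine', hMz, hGZK, hCE, hGV, hI, hLL⟩ := hP
  exact upperNonSurjFive_of_elevenFacts_of_twoCores hJs hJn h12 hnf hns' hsp' hfine' hMz hGZK hCE hGV hI hLL h6
    (tamagawaDepthCore_of_wideCut hnf hMz hGZK hS (wideTrivialPrimeFrame_of_split hN hPp) h5t)

/-- **Compatibility (real proof): the wide cut is fed by the OLD residual statements** — prints + S∑ʷ + S4♮ + S4ₚ + S5♮ + S6 ⟹ U5, i.e. the only NEW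
content of rev 10 against rev 8's `UpperNonSurjFive_of_cleanCut` is S∑ʷ ⊇ S∑ (the `−1` nodes), everything else WEAKENED. [cite: Miller2011LMS, Def. 1.1] -/
theorem UpperNonSurjFive_of_wideCut' (hP : PrintFacts) (hS : WideCarrierSum) (hN : TrivialLevelNodeFrame)
    (hPp : PrincipalAtPFrame) (h5u : UncleanOffRungResidual) (h6 : ShaCoreResidual) : Theses.PrintX11a.UpperNonSurjFive :=
  UpperNonSurjFive_of_wideCut hP hS (trivialNodeFrame_of_trivialLevelNodeFrame hN)
    (trivialNodePrincipalAtPFrame_of_principalAtPFrame hPp) (trivialNodeOffRungResidual_of_unclean h5u) h6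

/-- **WIDE-♭ ⟹ `p ∤ ℓ − 1` (real proof, elementary):** the wide sector in twpatch5's divisibility language — at a wide-♭ prime `ℓ ≠ p` only the
`(ℓ + 1)`-half of `ℓ² − 1` may be divisible by `p`. [folklore] -/
theorem not_dvd_sub_one_of_wideFlatPrime {p ℓ : ℕ} (hp : p.Prime) (hℓ : ℓ.Prime) (hflat : WideFlatPrime p ℓ) (hne : ℓ ≠ p) :
    ¬ p ∣ ℓ - 1 := by
  rcases hflat with h | h
  · exact absurd h hne
  · intro hdvd
    apply h
    have hmod : 1 % p = ℓ % p := (Nat.modEq_iff_dvd' hℓ.one_lt.le).mpr hdvd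
    rw [← hmod]
    exact Nat.mod_eq_of_lt hp.one_lt

/-- **BRIDGE TO «twpatch5», WIDE FORM (real proof): S∑ʷ from any Taylor–Wiles-hypothesis supplier and any value-depth statement whose genericity
hypothesis at the split carriers `ℓ ≠ p` is only `p ∤ ℓ − 1`** (the shape a wide `TWPatch.ValueDepthTW` would have; stated over an abstract predicate `TW`
because `Cruxes/…/Lines/*.lean` are not importable).  Rev 11 note (critic V#178 nit N-g8-5): twpatch5's S2 `ValueDepthTW` AS TYPED (REV 4) carries the
genericity binder `¬ p ∣ ℓ² − 1`, so «the two lines share the sector» holds for S∑ through the rev-8 bridge `cleanCarrierSum_of_generic`; THIS bridge (and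
`fullCarrierSum_of_generic` of §4d) is the socket a WIDE (resp. unrestricted) twpatch5 S2 would plug into — until such a rev exists, S∑ʷ ⊋ (TW-generic ∩ U5)
and S∑ᶠ ⊋ S∑ʷ are monogen5's own loads. [cite: Wiles1995, Introduction] [cite: TaylorWiles1995, Thm. 1] -/
theorem wideCarrierSum_of_generic (TW : WeierstrassCurve ℚ → ℕ → Prop)
    (hT : ∀ (W : WeierstrassCurve ℚ) [W.IsElliptic] [W.IsGloballyMinimal] (p : ℕ) [Fact p.Prime],
      ClassX11a W p → 5 ≤ p → TW W p)
    (hV : ∀ (W : WeierstrassCurve ℚ) [W.IsElliptic] [W.IsGloballyMinimal] (p : ℕ) [Fact p.Prime],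
      ClassX11a W p → ¬ Surj W p → 5 ≤ p → TW W p →
      (∀ (ℓ : ℕ) [Fact ℓ.Prime], W.HasSplitMultiplicativeReductionAtPrime ℓ → ℓ ≠ p → ¬ p ∣ ℓ - 1) →
      ∀ t : ℚ, W.entireLFunction 1 / (W.realPeriodRat : ℂ) = (t : ℂ) →
        (padicValNat p W.tamagawaProduct : ℤ) ≤ padicValRat p t) :
    WideCarrierSum := by
  intro W _ _ p hp hX hns hp5 hw t ht
  refine hV W p hX hns hp5 (hT W p hX hp5) ?_ t ht
  intro ℓ hℓ hsplit hne
  exact not_dvd_sub_one_of_wideFlatPrime hp.out hℓ.out (hw ℓ hsplit.hasMultiplicativeReductionAtPrime) hne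


/-! ## §4d (rev 11, g40 — the seat's lens «decomp») THE FULL CUT: the TRIVIAL nodes join PROPOSITION P⁺ through Calegari's «unipotent WITH A CHOICE OF FROBENIUS EIGENVALUE» ring `R_q^{fun}` (one definition + PROVED glue; no stub touched)

Rev 10 (§4c) widened the clean sector to every level without a TRIVIAL NODE (a multiplicative `q ≠ p`, `q ≡ 1 (mod p)`; on U5 automatically
`ρ̄(Frob_q) = ±Id`, Böckle–Khare–Manning-trivial) and left the trivial-node levels in the three narrowed frames S4♮ᵗ ∕ S4ₚᵗ ∕ S5♮ᵗ, on the ground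
(R10.2) that at a trivial node the two residual Frobenius roots COLLIDE — no Hensel root `α̃_q`, `U_q ∉ im R_Σ`, the `𝔪`-stabilisation of an old
form is not unique.  That kills the HENSEL proof of (f⁻), but — this is the point of rev 11 — NOT ONE STEP OF PROPOSITION P⁺ USES THE HENSEL ROOT AS
SUCH: P⁺ uses, at each split carrier `q`, (i) an element `y_q` of the local factor `B_q` of `R_∞` that maps to `U_q − 1` at every Taylor–Wiles level,
(ii) the ideal `𝔫_q = ker(B_q → B_q^{old sheet})`, (iii) `𝒪`-FLATNESS of `B_q/(y_q, 𝔫_q)` (Tor-independence P⁺1), (iv) the old quotient of the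
patched module being free of rank one over the old sheet (Lemma H, feeding `K_{q,∞} = 𝔫_qM_∞`), (v) `B_q` reduced, `𝒪`-flat, with every component
inhabited by a member (P⁺4 ∕ P⁺5: cyclic + full support over reduced ⇒ free), (vi) (W) at every TW level, (vii) `λ_E(𝔞_q) = p^{n_q}`.  At a trivial
`+Id` node ALL SEVEN are supplied by Calegari's local condition «unipotent inertia with a CHOICE of Frobenius eigenvalue `1 + X`», the framed ring
`R_q^{fun} = 𝒪⟦α,β,γ,X,a,b,c⟧/(αX, βX, γX, aq + (a² + bc)(1 + X) − a(1 + X)², α² + βγ, αc − γ(q − 1 + a), αa + γb, βc + α(q − 1 + a), βa − αb)`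
[corpus: paper:arxiv-2108.09729 p.21 Lemma 5.2 (the nine relations), Lemma 5.3 ((1) reduced, `𝒪`-flat, relative dimension 3; (2) two minimal primes,
`R^{fun}/I₁` = unramified liftings WITH A CHOICE OF FROBENIUS EIGENVALUE, `R^{fun}/I₂ = R_q^{St}`; (3) `ϖ, b − c, b − β, X − γ` a regular s.o.p. and
`R^{fun}` GORENSTEIN), p.22 L10 (Artinian reduction of `k`-dimension 6, socle `k·a²`), p.18 L58 (`R_v^{uni}` and `R_v^{fun}` Gorenstein, reduced, flat)]:
(E1ᶠ) LOCAL RING `B_q := R_q^{fun}`, `y_q := X` (the universal «`U_q − 1`»), `𝔫_q := (α, β, γ) = I₁`, `𝔄_q := (X, α, β, γ)`.  STRUCTURE (this seat's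
desk computation, consistent with Lemma 5.3 and recorded because it says WHY): modulo `ϖ` (so `q ≡ 1`, `s ≡ t ≡ 0`) the Steinberg sheet `R_q^{St} ⊗ k`
is the cone over the rational normal scroll `S(2,2) ⊂ ℙ⁵` (the `2 × 2` minors of `[[x₀,x₁,y₀,y₁],[x₁,x₂,y₁,y₂]]` with `x = (β, −α, −γ)`, `y = (b, −a, −c)`),
Cohen–Macaulay of TYPE 3 (Eagon–Northcott) — hence not Gorenstein, Böckle–Khare–Manning's defect — with canonical module `ω ≅ I_Z(−1)`, `Z` = the old locus
`{N = 0} = V(α, β, γ)` = the conic cone `k⟦a,b,c⟧/(a² + bc)` (`ℙ¹ × ℙ¹`, `𝒪_X(1) = 𝒪(1,2)`, `K_X = 𝒪(−1,0) ⊗ 𝒪_X(−1)`, `I_Z = Γ_*𝒪(−1,0)`): the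
LIAISON identity «canonical ideal of the Steinberg sheet = ideal of the old locus»; the eigen-sheet `R^{fun}/I₁ ⊗ k = k⟦a,b,c,X⟧/(X²·unit − a² − bc)`
is a quadric cone; and `R_q^{fun} ⊗ k = k⟦a,b,c,X,α,β,γ⟧/(J_{St} ∩ J_{eig})` is the completed cone over a REDUCIBLE HYPERPLANE SECTION `D₁ ∪ D₂` of the
Segre threefold `ℙ¹ × ℙ¹ × ℙ¹ ⊂ ℙ⁷` (`D₁ ∈ |𝒪(1,0,0)|` the quadric = eigen-sheet, `D₂ ∈ |𝒪(0,1,1)|` the scroll = Steinberg sheet, `D₁ ∩ D₂` = the conic;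
degrees `2 + 4 = 6 = 3!`), and a hyperplane section of the arithmetically Gorenstein Segre cube (Goto–Watanabe: equal `a`-invariants) by a regular
linear form is GORENSTEIN — Lemma 5.3 (3) seen geometrically.  So with `U_q` ADJOINED the trivial node is a Gorenstein local factor (consistent with
multiplicity one for `X₀(N)` at `𝔪`, `p² ∤ N`), although neither sheet-quotient `T^{q-new}` is (type 3: Ribet's multiplicity two on the new quotient).
(A0ᶠ) FLATNESS OF THE CROSSING.  `B_q/𝔄_q = R^{fun}/(X, α, β, γ) = 𝒪⟦a,b,c⟧/(a(q − 1) + a² + bc)` (Lemma 5.2's `r₄^{fun}` at `X = 0`): SINGULAR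
(the `A₁` cone modulo `ϖ` — the unit `q − 1` of (E1⁻) is gone) but `𝒪`-FLAT, because `ϖ` does not divide the relation (`(ϖ, g)` is a regular sequence
in the factorial ring `𝒪⟦a,b,c⟧`).  Flatness, not smoothness, is all that P⁺1's `Tor₁^𝒪(B_q/𝔄_q, B_{q'}/𝔄_{q'}) = 0` uses; FACT A0 of the memo §1
holds at a trivial node in this weakened-but-sufficient form.
(A1ᶠ) IMAGES.  Under `R_∞ → T_n` (every TW level): `X ↦ U_q − 1` BY CONSTRUCTION of the fun condition (the eigenvalue is part of the datum: on a
`q`-old member `1 + X` is the chosen root of `U² − T_qU + q`, on a `q`-new member `1 + X = a_q = +1`; the relations `αX = βX = γX = 0`, i.e.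
`N·(U_q − (1 + X)) = 0`, hold member by member in the reduced `T_n`), and `(α, β, γ) ↦ I_{q,n} = ker(T_n → T_n^{q-old})` (old members are
unramified at `q`) [corpus: paper:arxiv-2108.09729 p.21 L29–33 (the datum «choice of eigenvalue `(1+X)` of `ρ(σ)`»); §6.1 (`α_q ↦ U_q`)].
(Hᶠ) LEMMA H IN EIGEN FORM.  At a trivial node BOTH roots of `U² − T_qU + q` on the `𝔪′`-old line lie in `𝔪`, so NO localisation separates them
and none is needed: `(H₁(X₀(N/q))⊕²)_𝔪 ≅ H₁(X₀(N/q))_{𝔪′} ⊗_{T′} T′[U]/(U² − T_qU + q)` (`U_q` acts on the two degeneracy copies by the companion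
matrix; Ihara at non-Eisenstein `𝔪`), FREE OF RANK ONE over the eigen-algebra `T′[U]/(U² − T_qU + q)` = the image of `R^{fun}/I₁ ⊗̂ (rest)`; the
`♭` form of Lemma H («free of rank one over `T′` because `α − β ≡ 1 − q` is a unit») is its specialisation.  This is the input behind `K_{q,∞} =
𝔫_qM_∞` (memo §2 P⁺3 ⟶ P⁺5), now at a trivial node.
(Wᶠ) (W) AT EVERY TW LEVEL.  The identity `(U − 1)(0, −η′_n) = (η′_n, η′_n)` in `H₁(X(N/q))⊕²` and dual Ihara are congruence-free (memo §7.1, §10.2;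
REF 3 ∕ 3 at `−1` carriers): verbatim.
(Iᶠ) INHABITATION (P⁺4).  The Steinberg-at-`q` components need a member NEW at `q` congruent to `ρ̄`: at a trivial node the level-raising congruence
`tr ρ̄(Frob_q)² = (q + 1)²` holds IDENTICALLY (`(±2)² ≡ (1 + 1)²`), and the sign is FORCED (`a_q(g) ≡` the eigenvalue of `ρ̄(Frob_q)`, so `a_q(g) = +1`
at a `+Id` node, `−1` at a `−Id` node) — Diamond–Taylor 1994 Thm. A (exact non-optimal level, `p > 3`) as at a ♭ node; the eigen-sheet components are
the `q`-old members.  (`trivialNode_raising_and_collision` below is the kernel arithmetic: raising congruence automatic, roots collide.)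
(M1ᶠ) MULTIPLICITY ONE ∕ CYCLICITY (P⁺5).  `M = H₁(X₀(N), ℤ_p)⁺_𝔪` free of rank one over `T_{N,𝔪}` at `p² ∤ N` (DDT Thm. 4.26 (b) = Wiles Thm. 2.1; NO
hypothesis at `q`; Böckle–Khare–Manning II p.38 L3 run the same Mazur argument under `(p, NQ) = 1`), and the same at the TW levels; with `R_∞` REDUCED
(`R^{fun}` reduced, `𝒪`-flat, Cohen–Macaulay — GORENSTEIN of codimension 4 with nine relations, NOT a complete intersection, so P⁺4's «each factor CI ⇒ `R_∞` CI ⇒ S₁» reads «each factor `𝒪`-flat CM ⇒ `R_∞` CM ⇒ S₁», and R₀ from the factors' reducedness + `𝒪`-flatness as before — Lemma 5.3 (1) ∕ (3); the other factors as in §4b ∕ §4c) and (Iᶠ): cyclic + full support over reduced ⇒ `M_∞ ≅ R_∞` (memo P⁺4 ∕ P⁺5).  NOT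
used: Böckle–Khare–Manning II's GLOBAL Thm. 6.4 (`R^τ ≅ T̄^τ`), whose large-image hypothesis `im ρ̄ ⊇ SL₂(𝔽_p)` fails on U5 — only their LOCAL Lemmas
5.2 ∕ 5.3 and the seat's P⁺4 ∕ P⁺5 under twpatch5's `TWOnU5` (`ρ̄|G_{ℚ(ζ_p)}` absolutely irreducible on all of ClassX11a).
(P⁺7ᶠ) VALUE.  `λ_E(𝔄_q) = λ_E(X) + λ_E(α, β + t, γ) = 0 + (t_E) = p^{m_q}ℤ_p`, `m_q = v_p(ord_q Δ_E)` = Böckle–Khare–Manning I's `m_q` (Def. 7.7: the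
largest `n` with `ρ_E(I_q) = 1 mod ϖⁿ`) = `v_p(c_q(E))` at a split (`+Id`) node — the Tamagawa depth, exactly as at a ♭ carrier [corpus:
paper:arxiv-1910.08507 p.22 Def. 7.7, p.23–24 Prop. 7.9 (`Φ_{λ,R^{uni}/R^{St}} ≅ 𝒪/ϖ^{m_q − n_q}`)].  (Their `n_q ≤ m_q` also sees `q − 1` and the
Frobenius cocycle; it does not enter P⁺7.)  The carrier `𝔄_q` is NOT principal at a trivial node (`I_Z·R^{St} = (α, β + t, γ)` has `μ = 3` = the type)
— and P⁺ never multiplies GENERATORS, only IDEALS (§5 anchor (c) `map_mem_pow_sum_of_mem_prod`).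
`−Id` TRIVIAL NODES (non-split `q ≡ 1`): spectators (`c_q ∈ {1, 2}`, no carrier), local factor `R^{fun} ⊗ δ_q` (unramified quadratic twist), reduced
and flat, inhabited with forced sign `−1`; harmless, as the `≡ −1` spectators of §4c.
CONSEQUENCE.  P⁺ (♭, §4b) ∪ P⁺ʷ (`≡ −1`, §4c) ∪ P⁺ᶠ (`≡ +1`, this section) = PROPOSITION P⁺ ON EVERY LEVEL OF U5; typed: S∑ᶠ `FullCarrierSum` (S∑ʷ with
the level binder DROPPED) and `UpperNonSurjFive_of_fullCut : PrintFacts → FullCarrierSum → ShaCoreResidual → U5` (real proof, THREE hypotheses: the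
record's turnkey BY NAME fed by `tamagawaDepthCore_of_fullCut`, ONE line — no rungs, no frames); S∑ʷ, S∑, S5, S5♮, S5♮ᵗ become CONSEQUENCES of prints +
S∑ᶠ (`wideCarrierSum_of_fullCarrierSum`, `offRungResidual_of_fullCut`, …), and the wide cut is fed by the full cut (`UpperNonSurjFive_of_fullCut'`).
STATUS: SKETCH, print-composite modulo the audit rows A0ᶠ ∕ A1ᶠ ∕ Hᶠ ∕ Iᶠ ∕ M1ᶠ above (new; `AUDIT-Pplus-print-g38.md` §8) and the shared R1–R9; NOT
refereed; the line's size tag for the trivial sector moves from «research-S (F1″-ord)» to «sketch P⁺ᶠ, audit pending» ONLY IF a LEAD ∕ REF signs §8.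
FALSIFIER (REF row, kit 0 at this seat): KIT-Uᶠ — at a level with a trivial `+Id` CARRIER `q` (REF §ZB add. 1 pairs (2) `1451`, (4) ∕ (8) `101`, (6) `701`,
(9) `1051`, (10) `7001`; `118080ds1`@5 with `41`) compute `T_{N,𝔪}` WITH `U_q`: prediction Gorenstein ✓, `ob(η) = 0`, and member-wise `v_p λ_g(t_η) ≥ Σ`
depths INCLUDING the trivial carrier's; a non-Gorenstein `T_{N,𝔪}` or `ob(η) ≠ 0` there kills P⁺ᶠ (and returns the trivial nodes to the frames) without
touching §4b ∕ §4c.  W-79: publish-only; the composition of record `UpperNonSurjFive_of_monogen` and the seven stubs are byte-identical; BC7 on S∑ᶠ: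
`Lines/monogen5.md` REV 11.  BSD is not proved by any of this; U5 does not close (S∑ᶠ and S6 open).
[cite: BoeckleKhareManning2024, Lemma 5.2, Lemma 5.3 and §5.3] [cite: BockleKhareManning2021, Def. 7.7, Prop. 7.9 and Rem. 7.12] [cite: DiamondTaylor1994, Thm. A]
[cite: DarmonDiamondTaylor1995, Thm. 4.26] [cite: Wiles1995Annals, Thm. 2.1] [cite: KisinModuli2009, (3.4.12)] [cite: SilvermanATAEC1994, Cor. IV.9.2 (d)] -/

/-- **Kernel arithmetic of the trivial node (real proof): at `q ≡ 1 (mod p)` the level-raising congruence `tr ρ̄(Frob_q)² = (q + 1)²` holds for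
EITHER sign `s` (`tr = 2s`), and the two residual Frobenius roots `s`, `s·q` COINCIDE** — raising is automatic (Iᶠ), Hensel separation (§4c (f⁻) (i))
is impossible, which is why the eigenvalue must be ADJOINED (`R_q^{fun}`) rather than solved for. [cite: BockleKhareManning2021, Def. 2.1]
[cite: DiamondTaylor1994, Thm. A] -/
theorem trivialNode_raising_and_collision {p : ℕ} [Fact p.Prime] {q : ℕ} (hq : q % p = 1) (s : ZMod p) (hs : s ^ 2 = 1) :
    (s + s) ^ 2 = ((q : ZMod p) + 1) ^ 2 ∧ s = s * (q : ZMod p) := by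
  have hq1 : (q : ZMod p) = 1 := by
    rw [← ZMod.natCast_mod q p, hq, Nat.cast_one]
  rw [hq1]
  exact ⟨by linear_combination (4 : ZMod p) * hs, by ring⟩

/-- **S∑ᶠ — `FullCarrierSum` (rev 11; DEFINITION, not a stub): on EVERY level of a U5 pair the `p`-adic valuation of `L(E,1)/Ω_E` is at least the FULL
Tamagawa depth `v_p ∏_ℓ c_ℓ`** — S∑ʷ with the level binder dropped: all split carriers, ♭, `≡ −1`, TRIVIAL (`≡ +1`, through `R_q^{fun}`) or `= p`, any
depths, any number, any spectators.  = PROPOSITION P⁺ ∪ P⁺ʷ ∪ P⁺ᶠ evaluated at the Tate point; the shape twpatch5's S2 `ValueDepthTW` would have with NO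
genericity binder (`fullCarrierSum_of_generic`).  A consequence of BSD; strictly weaker than U5 (no `#Ш`); NOT the crux in costume (silent when
`Ш[p] ≠ 0`).  ⟹ S∑ʷ ⟹ S∑.  NUMERICAL STANDING: curve-side equality `ord₅(L/Ω) = v₅∏c` at all 28 positive-depth tabulated U5 pairs at `p = 5` (the 26
wide-clean ones of §4c AND `59040b1` ∕ `59040c1` with the trivial node `41`) and at REF §ZB add. 1 pairs (1)–(10) (record values, BSD_p-predicted);
member-wise rows at trivial-carrier levels: NONE YET (KIT-U 21586@5 no result at 30 GB; KIT-Uᶠ designed, not requested).  WHY IT MIGHT FAIL AS A PROOF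
PLAN: the eigen-form Lemma H (Hᶠ) and the marked-element patching with the singular-but-flat crossing (A0ᶠ) are unwritten beyond this sketch; a
trivial carrier could obstruct (W) ⟶ membership in a way one TW level does not see (KIT-Uᶠ is the row); the `p ∥ N` ordinary transfer (F1″-ord) is
shared with S∑ ∕ S∑ʷ. [cite: BoeckleKhareManning2024, Lemma 5.2 and Lemma 5.3] [cite: BockleKhareManning2021, Def. 7.7 and Prop. 7.9]
[cite: DiamondTaylor1994, Thm. A] [cite: Mazur1978, Cor. 4.1] [cite: SilvermanATAEC1994, Cor. IV.9.2 (d)] -/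
def FullCarrierSum : Prop :=
  ∀ (W : WeierstrassCurve ℚ) [W.IsElliptic] [W.IsGloballyMinimal] (p : ℕ) [Fact p.Prime],
    ClassX11a W p → ¬ Surj W p → 5 ≤ p →
    ∀ t : ℚ, W.entireLFunction 1 / (W.realPeriodRat : ℂ) = (t : ℂ) →
      (padicValNat p W.tamagawaProduct : ℤ) ≤ padicValRat p t

/-- S∑ᶠ ⟹ S∑ʷ (real proof: forget the wide-clean binder). [cite: BockleKhareManning2021, Def. 2.1] -/
theorem wideCarrierSum_of_fullCarrierSum (h : FullCarrierSum) : WideCarrierSum :=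
  fun W _ _ p _ hX hns hp5 _ t ht => h W p hX hns hp5 t ht

/-- S∑ᶠ ⟹ S∑ (real proof). [cite: KimOta2019, Thm. 1.3] -/
theorem cleanCarrierSum_of_fullCarrierSum (h : FullCarrierSum) : CleanCarrierSum :=
  cleanCarrierSum_of_wideCarrierSum (wideCarrierSum_of_fullCarrierSum h)

/-- **C_cc FROM THE FULL CUT (real proof, ONE case): prints GZK ∕ modularity ∕ Mazur Cor. 4.1 + S∑ᶠ feed the record's socket
`GL1Cartan.missingUpperBoundAt_of_valueDepth` on every level — no rung, no frame, no case split.** [cite: Mazur1978, Cor. 4.1] [cite: Miller2011LMS, Def. 1.1] -/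
theorem tamagawaDepthCore_of_fullCut
    (hnf : exists_isNewformOf) (hMz : mazur_not_dvd_maninConstant_of_odd)
    (hGZK : rank_eq_analyticRank_of_analyticRank_le_one) (hS : FullCarrierSum) :
    ∀ (W : WeierstrassCurve ℚ) [W.IsElliptic] [W.IsGloballyMinimal] (p : ℕ) [Fact p.Prime],
      ClassX11a W p → ¬ Surj W p → 5 ≤ p → 2 ≤ padicValNat p W.tamagawaProduct →
      (∀ x : W.sha, (p : ℤ) • x = 0 → x = 0) → MissingUpperBoundAt W p :=
  fun W _ _ p _ hX hns hp5 _ hSha =>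
    missingUpperBoundAt_of_valueDepth hGZK hnf hMz hX hp5 hSha (fun t ht => hS W p hX hns hp5 t ht)

/-- **S5 is a CONSEQUENCE of prints + S∑ᶠ (real proof).** [cite: Miller2011LMS, Def. 1.1] -/
theorem offRungResidual_of_fullCut
    (hnf : exists_isNewformOf) (hMz : mazur_not_dvd_maninConstant_of_odd)
    (hGZK : rank_eq_analyticRank_of_analyticRank_le_one) (hS : FullCarrierSum) : OffRungResidual :=
  fun W _ _ p _ hX hns hp5 hdeep hSha _ _ => tamagawaDepthCore_of_fullCut hnf hMz hGZK hS W p hX hns hp5 hdeep hSha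

/-- **S5♮ᵗ (the trivial-node off-rung residual of rev 10) is a CONSEQUENCE of prints + S∑ᶠ (real proof).** [cite: Miller2011LMS, Def. 1.1] -/
theorem trivialNodeOffRungResidual_of_fullCut
    (hnf : exists_isNewformOf) (hMz : mazur_not_dvd_maninConstant_of_odd)
    (hGZK : rank_eq_analyticRank_of_analyticRank_le_one) (hS : FullCarrierSum) : TrivialNodeOffRungResidual :=
  trivialNodeOffRungResidual_of_unclean
    (uncleanOffRungResidual_of_offRungResidual (offRungResidual_of_fullCut hnf hMz hGZK hS))

/-- **BRIDGE TO «twpatch5», FULL FORM (real proof): S∑ᶠ from any Taylor–Wiles-hypothesis supplier of the shape of `TWPatch.TWOnU5` and any value-depth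
statement with NO genericity binder at the split carriers** — the shape an unrestricted `TWPatch.ValueDepthTW` would have (stated over an abstract
predicate `TW` because `Cruxes/…/Lines/*.lean` are not importable). [cite: Wiles1995, Introduction] [cite: TaylorWiles1995, Thm. 1] -/
theorem fullCarrierSum_of_generic (TW : WeierstrassCurve ℚ → ℕ → Prop)
    (hT : ∀ (W : WeierstrassCurve ℚ) [W.IsElliptic] [W.IsGloballyMinimal] (p : ℕ) [Fact p.Prime],
      ClassX11a W p → 5 ≤ p → TW W p)
    (hV : ∀ (W : WeierstrassCurve ℚ) [W.IsElliptic] [W.IsGloballyMinimal] (p : ℕ) [Fact p.Prime],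
      ClassX11a W p → ¬ Surj W p → 5 ≤ p → TW W p →
      ∀ t : ℚ, W.entireLFunction 1 / (W.realPeriodRat : ℂ) = (t : ℂ) →
        (padicValNat p W.tamagawaProduct : ℤ) ≤ padicValRat p t) :
    FullCarrierSum :=
  fun W _ _ p _ hX hns hp5 t ht => hV W p hX hns hp5 (hT W p hX hp5) t ht

/-- **U5 FROM THE FULL CUT (real proof, hypothesis-fed): the thirteen prints + S∑ᶠ + S6 — THREE hypotheses — through the record's rev-12 turnkey BY NAME.**
Not stub-fed (W-79 + V#173 n2); the stub-fed composition of record for this file remains `UpperNonSurjFive_of_monogen`.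
[cite: Miller2011LMS, Def. 1.1] [cite: Kato2004Asterisque, §17.13] -/
theorem UpperNonSurjFive_of_fullCut (hP : PrintFacts) (hS : FullCarrierSum) (h6 : ShaCoreResidual) :
    Theses.PrintX11a.UpperNonSurjFive := by
  obtain ⟨hJs, hJn, h12, hnf, hns', hsp', hfine', hMz, hGZK, hCE, hGV, hI, hLL⟩ := hP
  exact upperNonSurjFive_of_elevenFacts_of_twoCores hJs hJn h12 hnf hns' hsp' hfine' hMz hGZK hCE hGV hI hLL h6
    (tamagawaDepthCore_of_fullCut hnf hMz hGZK hS)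

/-- **Compatibility (real proof): the full cut FEEDS the wide cut** — S∑ᶠ + the three trivial-node frames + S6 ⟹ U5 factors through rev 10's
`UpperNonSurjFive_of_wideCut`; the frames are now redundant hypotheses (each is implied by prints + S∑ᶠ or bypassed). [cite: Miller2011LMS, Def. 1.1] -/
theorem UpperNonSurjFive_of_fullCut' (hP : PrintFacts) (hS : FullCarrierSum) (hN : TrivialNodeFrame)
    (hPp : TrivialNodePrincipalAtPFrame) (h5t : TrivialNodeOffRungResidual) (h6 : ShaCoreResidual) :
    Theses.PrintX11a.UpperNonSurjFive :=
  UpperNonSurjFive_of_wideCut hP (wideCarrierSum_of_fullCarrierSum hS) hN hPp h5t h6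


/-! ## §4e (rev 12, g41; critic V#179 nit N-g8-7) THE INTEGRAL READING — S∑ᶠ is «`p`-INTEGRALITY OF THE ANALYTIC ORDER `#Ш_an` ON U5», as a KERNEL BRIDGE

WHAT.  On the U5 class (X11a ⟹ analytic rank `0`, `p ∥ N`, `E[p]` irreducible ⟹ `p ∤ #E(ℚ)`), the record's identity
`GL1Cartan.padicValRat_shaAn_eq_sub_tamagawa` reads `ord_p #Ш_an = ord_p (L(E,1)/Ω_E) − v_p ∏_ℓ c_ℓ` (CONDITIONAL on GZK, modularity, Mazur Cor. 4.1).  Hence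
S∑ᶠ `FullCarrierSum` («`v_p ∏c ≤ ord_p (L(E,1)/Ω_E)` on every level») is EQUIVALENT, modulo those three prints, to Sᶦ `ShaAnIntegral` («`#Ш_an` is a `p`-adic
INTEGER at every U5 pair») — compare the crux `MissingUpperBoundAt W p` = «`ord_p #Ш ≤ ord_p #Ш_an`» (`Rank1Residual/Typed/Basic.lean`): Sᶦ is U5 with `#Ш`
replaced by `1`.  So the live content of this line is named for what it is: U5 = (Sᶦ: `0 ≤ ord_p #Ш_an`) + (S6: `ord_p #Ш ≤ ord_p #Ш_an` when `Ш[p] ≠ 0`), the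
first summand being the whole of P⁺ ∪ P⁺ʷ ∪ P⁺ᶠ read at the curve.  PRINT NEIGHBOURHOOD of Sᶦ (presearch, `Lines/monogen5.md` R12.2): integrality of `#Ш_an` is
known away from the primes of `2 · #E(ℚ)_tors · c_E · ∏c` (Manin–Drinfeld + Mazur), and AT a Tamagawa prime `p ∣ ∏c` only to depth one on this class (the record's landed
Tamagawa ∕ exceptional-zero divisibility, eight facts); nothing class-wide at depth `≥ 2` — which is exactly S∑ ∕ S∑ʷ ∕ S∑ᶠ.  BSD is not proved by any of this;
nothing here bounds a non-trivial `Ш`; no stub is added (Sᶦ is a `def`, the bridge lemmas are real proofs); the seven stubs are untouched. -/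

/-- **Sᶦ — `ShaAnIntegral` (rev 12; DEFINITION, not a stub): at every U5 pair the analytic order of `Ш` is a `p`-adic integer** —
`∃ q : ℚ, #Ш_an = q ∧ 0 ≤ ord_p q`.  Equivalent to S∑ᶠ modulo GZK ∕ modularity ∕ Mazur Cor. 4.1 (`fullCarrierSum_iff_shaAnIntegral`); a consequence of
U5 (`ord_p #Ш ≥ 0`) and of BSD_p; strictly weaker than U5 (silent on `#Ш`).  WHY IT MIGHT FAIL AS A PROOF PLAN: it is S∑ᶠ — same loads (P⁺5 ∕ Hᶠ, F1″-ord at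
`p ∥ N`, R6). [cite: Miller2011LMS, Def. 1.1 (arXiv:1010.2431 p. 3)] [cite: AgasheStein2004, §3–§4 (the odd part of the denominator of `#Ш_an`)] [cite: Mazur1978, Cor. 4.1] -/
def ShaAnIntegral : Prop :=
  ∀ (W : WeierstrassCurve ℚ) [W.IsElliptic] [W.IsGloballyMinimal] (p : ℕ) [Fact p.Prime],
    ClassX11a W p → ¬ Surj W p → 5 ≤ p → ∃ q : ℚ, shaAn W = (q : ℂ) ∧ 0 ≤ padicValRat p q

/-- **S∑ᶠ ⟹ Sᶦ (real proof, CONDITIONAL on GZK, modularity, Mazur Cor. 4.1):** `L(E,1)/Ω_E = t ∈ ℚ^×` (modularity + Mazur), `#Ш_an = t·#E(ℚ)²/∏c` (GZK),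
`ord_p #Ш_an = ord_p t − v_p ∏c ≥ 0` by S∑ᶠ. [cite: Miller2011LMS, Def. 1.1 (arXiv:1010.2431 p. 3)] [cite: Mazur1978, Cor. 4.1] -/
theorem shaAnIntegral_of_fullCarrierSum (hGZK : rank_eq_analyticRank_of_analyticRank_le_one)
    (hnf : exists_isNewformOf) (hMz : mazur_not_dvd_maninConstant_of_odd) (hS : FullCarrierSum) : ShaAnIntegral := by
  intro W _ _ p _ hX hns hp5
  obtain ⟨t, ht, ht0, -⟩ := hX.exists_LOne_div_realPeriod_eq_of_mazur hnf hMz hp5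
  have hL1 : W.entireLFunction 1 ≠ 0 := by
    intro h0
    apply ht0
    have h : ((t : ℚ) : ℂ) = 0 := by rw [← ht, h0, zero_div]
    exact_mod_cast h
  obtain ⟨-, -, -, hsha⟩ := shaAn_eq_of_L_one_div_eq hGZK W hL1 ht
  refine ⟨_, hsha, ?_⟩
  rw [padicValRat_shaAn_eq_sub_tamagawa hGZK hnf hMz hX hp5 hsha ht]
  have h := hS W p hX hns hp5 t ht
  linarith

/-- **Sᶦ ⟹ S∑ᶠ (real proof, CONDITIONAL on GZK, modularity, Mazur Cor. 4.1):** for any `t` with `L(E,1)/Ω_E = t` and the `q = #Ш_an` of Sᶦ,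
`ord_p q = ord_p t − v_p ∏c` (the record's identity), so `0 ≤ ord_p q` gives `v_p ∏c ≤ ord_p t`. [cite: Miller2011LMS, Def. 1.1 (arXiv:1010.2431 p. 3)] [cite: Mazur1978, Cor. 4.1] -/
theorem fullCarrierSum_of_shaAnIntegral (hGZK : rank_eq_analyticRank_of_analyticRank_le_one)
    (hnf : exists_isNewformOf) (hMz : mazur_not_dvd_maninConstant_of_odd) (hI : ShaAnIntegral) : FullCarrierSum := by
  intro W _ _ p _ hX hns hp5 t ht
  obtain ⟨q, hq, hq0⟩ := hI W p hX hns hp5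
  have hvq := padicValRat_shaAn_eq_sub_tamagawa hGZK hnf hMz hX hp5 hq ht
  linarith

/-- **S∑ᶠ ⟺ Sᶦ (real proof, CONDITIONAL on GZK, modularity, Mazur Cor. 4.1)** — the full carrier sum IS the `p`-integrality of `#Ш_an` on U5.
[cite: Miller2011LMS, Def. 1.1 (arXiv:1010.2431 p. 3)] [cite: Mazur1978, Cor. 4.1] -/
theorem fullCarrierSum_iff_shaAnIntegral (hGZK : rank_eq_analyticRank_of_analyticRank_le_one)
    (hnf : exists_isNewformOf) (hMz : mazur_not_dvd_maninConstant_of_odd) : FullCarrierSum ↔ ShaAnIntegral :=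
  ⟨shaAnIntegral_of_fullCarrierSum hGZK hnf hMz, fullCarrierSum_of_shaAnIntegral hGZK hnf hMz⟩

/-- **Sᶦ restricted to `Ш(E)[p] = 0` IS U5 there (real proof, CONDITIONAL on GZK):** the door `ClassX11a.missingUpperBoundAt_of_noPTorsion` with `ord_p #Ш = 0 ≤ ord_p #Ш_an`.
This is the exact sense of «Sᶦ = U5 with `#Ш` replaced by `1`». [cite: Miller2011LMS, Def. 1.1 (arXiv:1010.2431 p. 3)] -/
theorem missingUpperBoundAt_of_shaAnIntegral (hGZK : rank_eq_analyticRank_of_analyticRank_le_one) (hI : ShaAnIntegral)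
    {W : WeierstrassCurve ℚ} [W.IsElliptic] [W.IsGloballyMinimal] {p : ℕ} [Fact p.Prime]
    (hX : ClassX11a W p) (hns : ¬ Surj W p) (hp5 : 5 ≤ p) (hSha : ∀ x : W.sha, (p : ℤ) • x = 0 → x = 0) :
    MissingUpperBoundAt W p := by
  obtain ⟨q, hq, hq0⟩ := hI W p hX hns hp5
  exact hX.missingUpperBoundAt_of_noPTorsion hGZK hq hq0 hSha

/-- **U5 FROM THE INTEGRAL CUT (real proof, hypothesis-fed): the thirteen prints + Sᶦ + S6 — through `UpperNonSurjFive_of_fullCut` and the bridge.**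
Same three-hypothesis shape as rev 11, with the analytic summand named as integrality. [cite: Miller2011LMS, Def. 1.1] [cite: Kato2004Asterisque, §17.13] -/
theorem UpperNonSurjFive_of_integralCut (hP : PrintFacts) (hI : ShaAnIntegral) (h6 : ShaCoreResidual) :
    Theses.PrintX11a.UpperNonSurjFive :=
  UpperNonSurjFive_of_fullCut hP (fullCarrierSum_of_shaAnIntegral hP.gzk hP.nf hP.mz hI) h6


/-! ## §4f (rev 13, g42; critic V#180) NECESSITY — THE INTEGRAL CUT IS LOSSLESS: U5 ⟹ Sᶦ ∧ S6 PRINT-FREE, and U5 ⟺ Sᶦ ∧ S6 (⟺ S∑ᶠ ∧ S6) MODULO THE THIRTEEN PRINTS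

WHAT.  The two summands of rev 12 are each IMPLIED by the crux: Sᶦ because `MissingUpperBoundAt W p` hands a rational `q = #Ш_an` with
`0 ≤ ord_p #Ш ≤ ord_p q` (`shaAnIntegral_of_upperNonSurjFive`, no print at all), S6 because it is U5 with one more binder
(`shaCoreResidual_of_upperNonSurjFive`).  With §4e this gives the biconditionals `upperNonSurjFive_iff_integralCut` ∕ `upperNonSurjFive_iff_fullCut`
(⇐ through the record's turnkey, fed by the thirteen prints BY NAME): the decomposition «U5 = (`#Ш_an ∈ ℤ_p`) + (`ord_p #Ш ≤ ord_p #Ш_an` when `Ш[p] ≠ 0`)»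
neither loses nor adds strength — S∑ᶠ ∕ Sᶦ is NOT a strengthening of the crux (it is a consequence of it, modulo GZK ∕ modularity ∕ Mazur for S∑ᶠ),
and S6 is the crux's own restriction.  DECOMP PASS g42 (from scratch, off the standing dead lists; `Lines/monogen5.md` R13.3): no further typed cut of
Sᶦ or S6 survives — (i) bipartite level-raising transfer of `L(E,1)` at depth `n` is informative only at `ε = −1` nodes, where the raised form has even
sign and the SAME residual image (the `(1 − ε)` stabilisation factor and `w(g) = −ε` are consistent), so it is twinflip5 ∕ W2 ∕ W3 again; (ii) equivariant
BSD over `M = ℚ(E[p])` is isotypically split (`p ∤ [M:ℚ]`, `ℤ_p[G]` maximal): the trivial component is BSD_p(E ∕ ℚ) verbatim; (iii) one-class reciprocity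
(diagonal ∕ Rankin–Selberg embeddings `Sel(E) ↪ Sel(V ⊗ ad⁰V)`) bounds only coarse-minus-fine = finemu5; (iv) every congruence ∕ Greenberg–Vatsal transfer
reads `λ, μ` — blind to `P(0)` of the characteristic polynomial, i.e. to `ord_p` at the bottom layer beyond «zero ∕ non-zero» (depth 1) — so its class-wide
residual is Greenberg's `μ = 0` for `Ind χ̄` (W1) and, even granted, an Euler-system divisibility (W2).  Found-nothing is the recorded outcome; the live loads
stay R10 (P⁺5 ∕ Hᶠ) for Sᶦ and S6 itself.  BSD is not proved by any of this; no stub is added or touched. -/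

/-- **U5 ⟹ Sᶦ (real proof, PRINT-FREE; critic V#180):** `MissingUpperBoundAt W p` gives `q` with `#Ш_an = q` and `(ord_p #Ш : ℤ) ≤ ord_p q`, and
`0 ≤ ord_p #Ш`. [cite: Miller2011LMS, Def. 1.1 (arXiv:1010.2431 p. 3)] -/
theorem shaAnIntegral_of_upperNonSurjFive (hU : Theses.PrintX11a.UpperNonSurjFive) : ShaAnIntegral := by
  intro W _ _ p _ hX hns hp5
  obtain ⟨q, hq, hle⟩ := hU W p hX hns hp5
  exact ⟨q, hq, le_trans (by exact_mod_cast Nat.zero_le _) hle⟩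

/-- **U5 ⟹ S6 (real proof, print-free): S6 is U5 with the extra binder `Ш(E)[p] ≠ 0`.** [cite: Miller2011LMS, Def. 1.1 (arXiv:1010.2431 p. 3)] -/
theorem shaCoreResidual_of_upperNonSurjFive (hU : Theses.PrintX11a.UpperNonSurjFive) : ShaCoreResidual :=
  fun W _ _ p _ hX hns hp5 _ => hU W p hX hns hp5

/-- **U5 ⟹ Sᶦ ∧ S6 (real proof, print-free).** [cite: Miller2011LMS, Def. 1.1 (arXiv:1010.2431 p. 3)] -/
theorem integralCut_of_upperNonSurjFive (hU : Theses.PrintX11a.UpperNonSurjFive) : ShaAnIntegral ∧ ShaCoreResidual :=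
  ⟨shaAnIntegral_of_upperNonSurjFive hU, shaCoreResidual_of_upperNonSurjFive hU⟩

/-- **U5 ⟺ Sᶦ ∧ S6 modulo the thirteen prints (real proof): the integral cut is LOSSLESS.** [cite: Miller2011LMS, Def. 1.1 (arXiv:1010.2431 p. 3)]
[cite: Kato2004Asterisque, §17.13] -/
theorem upperNonSurjFive_iff_integralCut (hP : PrintFacts) :
    Theses.PrintX11a.UpperNonSurjFive ↔ ShaAnIntegral ∧ ShaCoreResidual :=
  ⟨integralCut_of_upperNonSurjFive, fun h => UpperNonSurjFive_of_integralCut hP h.1 h.2⟩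

/-- **U5 ⟹ S∑ᶠ (real proof, CONDITIONAL on GZK ∕ modularity ∕ Mazur Cor. 4.1): the full carrier sum is a CONSEQUENCE of the crux — the line's
analytic statement is not stronger than U5.** [cite: Mazur1978, Cor. 4.1] [cite: Miller2011LMS, Def. 1.1 (arXiv:1010.2431 p. 3)] -/
theorem fullCarrierSum_of_upperNonSurjFive (hGZK : rank_eq_analyticRank_of_analyticRank_le_one)
    (hnf : exists_isNewformOf) (hMz : mazur_not_dvd_maninConstant_of_odd) (hU : Theses.PrintX11a.UpperNonSurjFive) : FullCarrierSum :=
  fullCarrierSum_of_shaAnIntegral hGZK hnf hMz (shaAnIntegral_of_upperNonSurjFive hU)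

/-- **U5 ⟺ S∑ᶠ ∧ S6 modulo the thirteen prints (real proof): the full cut of rev 11 is LOSSLESS too.** [cite: Miller2011LMS, Def. 1.1 (arXiv:1010.2431 p. 3)]
[cite: Kato2004Asterisque, §17.13] -/
theorem upperNonSurjFive_iff_fullCut (hP : PrintFacts) :
    Theses.PrintX11a.UpperNonSurjFive ↔ FullCarrierSum ∧ ShaCoreResidual :=
  ⟨fun hU => ⟨fullCarrierSum_of_upperNonSurjFive hP.gzk hP.nf hP.mz hU, shaCoreResidual_of_upperNonSurjFive hU⟩,
    fun h => UpperNonSurjFive_of_fullCut hP h.1 h.2⟩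



/-! ## §4g (rev 14, g43 — the seat's lens «decomp») THE DEFINITE TRANSPLANT P⁺ᵈᵉᶠ — S∂ `ToricPeriodCarrierDepth` (DEFINITION, not a stub).  FULL TEXT:
`Cruxes/UpperNonSurjFive/DEFINITE-TRANSPLANT-g43.md` (memo §1–§8); record: `Lines/monogen5.md` REV 14.

DECOMPOSED: not U5 again (§4–§4f) but the sibling line's SECOND PRICE — twinflip5 TF1 (b) = `DECOMP-CENSUS-g20.md` E7 = grossdef5's open half.  Kim's rank-0
structure theorem (tree `Kim2024/DefiniteSelmerStructure.lean`; no `N⁺`-Tamagawa hypothesis) gives `#Sel(E/K)[p^∞] = p^{2(ord_p λ₁ − ∂^{(∞)})}` with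
`∂^{(∞)} = min_n ord_p λ_n` over the level-raised toric periods on `X_{N⁺,nN⁻}`, and Kim EXPECTS `∂^{(∞)} = Σ⁺ := Σ_{q∣N⁺} v_p c_q` (IMC-conditional in print).
So TF1 ⟸ [Kim-structure at tame image with `p` in the level = twinflip5 WALL (3), untouched] ∧ [`p^{Σ⁺} ∣ λ_n` for every `n` = THIS SECTION] ∧ [period bookkeeping — print BELOW WALL (3): PW11 Thm 6.8 ⇐ Thm 6.2 needs `p ∤ N` + CR + surjective; rev 15 ∕ critic N-g9-1].
MECHANISM P⁺ᵈᵉᶠ (memo §2, steps 0–7): P⁺'s marked-element patching on the definite Brandt module `𝒪[Cls R]_𝔪` (`B` of discriminant `nN⁻`, ♭ inert primes, `p ∣ N⁻`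
allowed = twinflip5's `B_{p∞}`; `R` Eichler of level `N⁺`), marked element = the ORIENTED `Pic(𝒪_K)`-orbit Gross sum `ξ` (device D1); (W) exact at a SPLIT carrier
since `π₂ = σ_𝔮 ∘ π₁` on oriented CM points gives `(π₁,π₂)_*ξ = (ξ′,ξ′)` ∈ `(U_q − 1)`-image (P⁺2 verbatim; a non-split node gives `(T_q+q+1)a = 2ξ′`, unsolvable —
the bipartite set-up makes every carrier split, `(D_K,N)=1` excludes ramified ones); (W_m) exact by TW primes SPLIT in `K` and λ-NEAT (device D2, Lemma T, a
Chebotarev–Kummer condition compatible with the TW conditions); same local rings, Tor-independence, definite dual Ihara, `K_{q,∞} = 𝔫_q M_∞`, membership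
`ξ ∈ ∏_{q∈C}(U_q−1, 𝔫_q)·M^{def}`; EVALUATION at ANY full eigen-functional `φ` mod `p^M` with E's eigenvalues: `x_φ ≡ x_E`, `x_E(𝔫_q) = p^{n_q}·unit` ⟹
`p^{Σ_{q∈C} n_q} ∣ φ(P_K)` — `λ₁` at `n = 1`, `λ_n` at level-raised `n`, hence `∂^{(∞)} ≥ Σ⁺`.  The indefinite Heegner ∕ Kolyvagin version does NOT transplant (memo §8).
ROWS (memo §4): A-def (= twinflip5 wall (3), research-M), T and C-def desk, F-def ∕ G-def print, E…H from the AUDIT.  FALSIFIER KIT-D (REF; memo §6): one Brandt-module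
computation at a U5@5 pair with a ♭ split carrier.  NOT CLAIMED: BSD, U5, TF1, S∂ unproved; no stub added; S∂ is a NAMED CONSEQUENCE, not in the composition.
TYPING (memo §3): binders CLONED from the tree fact `kim_selmerCorank_baseChange_le_of_toricPeriod_ne_zero` (`BipartiteToricPeriod.lean`) with three changes:
(i) curve block = `5 ≤ p ∧ 1 ≤ M ∧ ClassX11a ∧ ¬Surj ∧ (N⁻ ♭)`; (ii) orientation `(O₁,O₂)` explicit, eigen-condition FULL: Kim's anemic clause + at every `q ∣ N⁺`
`U_q φ = a_q(E) φ`, `a_q(E) = frobeniusTrace W q − 1` (the tree's `frobeniusTrace` at a bad prime is `1 + a_q`), `U_q` = the tree's FORWARD-sub-ideal operator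
(`BrandtEichlerLevelUOperators.lean`, `Brandt.IsForward`, inlined elementwise; NOT Pizer's `B(q)`); (iii) Kim's «alone on its eigenline» clause DROPPED — at a carrier the
`q`-old `α`-stabilised forms are ≡ `f` mod `p^{n_q}` for the full algebra, so it is unsatisfiable exactly where S∂ has content.
[cite: Kim2024, Thm. 5.23 (arXiv v3) = Thm. 4.24 ∕ 4.26 (TAMS 377) and §1 p0007] [cite: Jetchev2008, Conj. 1.3 and Thm. 1.4] [cite: Buyukboduk2009TamagawaDefect, §4.2 Question 1] -/

/-- **S∂ — `ToricPeriodCarrierDepth` (rev 14; DEFINITION, not a stub):** on `X_{N⁺,nN⁻}` for a U5 pair, a bipartite `K` and an admissible `n` (Kim's binders),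
EVERY `B^×`-invariant FULL Hecke eigen-functional `φ` mod `p^M` with E's eigenvalues (`T_ℓ ↦ a_ℓ`, `ℓ ∤ Nn`; `U_q ↦ a_q ∈ {1,−1,0}`, `q ∣ N⁺`) has its toric period
over ONE oriented `Pic(𝒪_K)`-orbit of Gross points divisible by `p^{Σ_{q∈C} n_q}` for every set `C` of split-multiplicative primes dividing `N⁺`
(`n_q = v_p(v_q Δ_min) = v_p c_q`) — the evaluation P⁺ᵈᵉᶠ6.  Level-raised `n`: Kim's `∂^{(∞)} ≥ Σ⁺`, the defect twinflip5 TF1 (b) ∕ E7 ∕ grossdef5 leave open;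
`n = 1`: `p^{Σ⁺} ∣ λ₁` (⟸ also S∑ᶠ(E) ∧ S∑ᶠ(E^K) + Gross).  A consequence of BSD for `(E,E^K)` given Kim's theorem; silent on `Ш`; junk-free (`C = ∅`: `1 ∣ ·`);
NOT U5 ∕ TF1 ∕ S∑ᶠ in costume.  WHY IT MIGHT FAIL AS A PLAN: rows A-def (= wall (3)) and T are desk sketches; trivial carriers need row Hᶠ; an orientation
dependence of (W) would show at `C = {q}`, `M = 1` (KIT-D). [cite: Kim2024, Thm. 5.23 (arXiv v3) = Thm. 4.24 ∕ 4.26 (TAMS 377)] [cite: PollackWeston2011, Thm. 6.2]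
[cite: DiamondTaylor1994, Thm. 2 and Thm. A] [cite: BockleKhareManning2021, Prop. 4.6] [cite: SilvermanATAEC1994, Cor. IV.9.2 (d)] -/
def ToricPeriodCarrierDepth : Prop :=
    ∀ (W : WeierstrassCurve ℚ) [W.IsElliptic] [W.IsGloballyMinimal] (p : ℕ) [Fact p.Prime] (M Nplus
      Nminus n : ℕ) (C : Finset ℕ) (a b : ℚ) (O O₁ O₂ : Subring (QuaternionAlgebra ℚ a 0 b)) (K : Type)
      [Field K] [NumberField K] (ψ : K →ₐ[ℚ] QuaternionAlgebra ℚ a 0 b) (I : Submodule ℤ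
      (QuaternionAlgebra ℚ a 0 b)) (φ : Submodule ℤ (QuaternionAlgebra ℚ a 0 b) → ZMod (p ^ M)) (rep :
      ClassGroup (NumberField.RingOfIntegers K) → nonZeroDivisors (Ideal (NumberField.RingOfIntegers
      K))) (RI : Set (Submodule ℤ (QuaternionAlgebra ℚ a 0 b))),
      ((5 ≤ p ∧ 1 ≤ M ∧ ClassX11a W p ∧ ¬ Surj W p ∧ (∀ q : ℕ, q.Prime → q ∣ Nminus →
      FlatPrime p q)) ∧ (Module.finrank ℚ K = 2 ∧ NumberField.IsTotallyComplex K ∧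
      NumberField.discr K < -4 ∧ Int.gcd (NumberField.discr K) (W.conductorNorm ℤ * p) = 1) ∧
      (W.conductorNorm ℤ = Nplus * Nminus ∧ Nat.Coprime Nplus Nminus ∧ Squarefree Nminus ∧ Odd
      Nminus.primeFactors.card ∧ (∀ q : ℕ, q.Prime → q ∣ Nplus → ((Ideal.span {(q : ℤ)}).primesOver
      (NumberField.RingOfIntegers K)).ncard = 2) ∧ (∀ q : ℕ, q.Prime → q ∣ Nminus * n → ((Ideal.span
      {(q : ℤ)}).primesOver (NumberField.RingOfIntegers K)).ncard = 1)) ∧ (Squarefree n ∧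
      Nat.Coprime n (W.conductorNorm ℤ * p) ∧ Int.gcd (NumberField.discr K) n = 1 ∧ (∀ ℓ : ℕ,
      ℓ.Prime → ℓ ∣ n → ¬ (p : ℤ) ∣ (ℓ : ℤ) ^ 2 - 1 ∧ ((p : ℤ) ^ (2 * M) ∣ W.frobeniusTrace ℓ - (ℓ +
      1) ∨ (p : ℤ) ^ (2 * M) ∣ W.frobeniusTrace ℓ + (ℓ + 1)))) ∧ (a < 0 ∧ b < 0 ∧ (∀ (q : ℕ) [Fact
      q.Prime], (∀ x : QuaternionAlgebra ℚ_[q] (a : ℚ_[q]) 0 (b : ℚ_[q]), x ≠ 0 → IsUnit x) ↔ q ∣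
      Nminus * n)) ∧ ((∀ S : Subring (QuaternionAlgebra ℚ a 0 b), (S = O₁ ∨ S = O₂) →
      (S.toAddSubgroup.FG ∧ (∀ d : QuaternionAlgebra ℚ a 0 b, ∃ m : ℤ, m ≠ 0 ∧ m • d ∈ S) ∧ ∀ S' :
      Subring (QuaternionAlgebra ℚ a 0 b), S'.toAddSubgroup.FG → S ≤ S' → S' = S)) ∧ O = O₁ ⊓ O₂ ∧
      O.toAddSubgroup.relIndex O₁.toAddSubgroup = Nplus) ∧ (∀ J : Submodule ℤ (QuaternionAlgebra ℚ a
      0 b), J ∈ RI ↔ (J.FG ∧ (∀ d : QuaternionAlgebra ℚ a 0 b, ∃ m : ℤ, m ≠ 0 ∧ m • d ∈ J) ∧ (∀ x :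
      QuaternionAlgebra ℚ a 0 b, (∀ y ∈ J, y * x ∈ J) ↔ x ∈ O) ∧ (∃ J' : Submodule ℤ
      (QuaternionAlgebra ℚ a 0 b), (∀ x : QuaternionAlgebra ℚ a 0 b, x ∈ J * J' ↔ ∀ y ∈ J, x * y ∈
      J) ∧ (∀ x : QuaternionAlgebra ℚ a 0 b, x ∈ J' * J ↔ x ∈ O)))) ∧ (∀ q ∈ C, q.Prime ∧ q ∣ Nplus) ∧
      (∀ (q : ℕ) [Fact q.Prime], q ∈ C → W.HasSplitMultiplicativeReductionAtPrime q) ∧ ((∀ J ∈ RI, ∀ β : QuaternionAlgebra ℚ a 0 b,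
      IsUnit β → φ (J.map (AddMonoidHom.mulLeft β).toIntLinearMap) = φ J) ∧ (∀ q : ℕ, q.Prime → ¬ q ∣
      W.conductorNorm ℤ * n → ∀ J ∈ RI, ∑ᶠ J' ∈ {J' : Submodule ℤ (QuaternionAlgebra ℚ a 0 b) | J' ≤
      J ∧ J'.toAddSubgroup.relIndex J.toAddSubgroup = q ^ 2 ∧ ∀ y ∈ J', ∀ x ∈ O, y * x ∈ J'}, φ J' =
      ((W.frobeniusTrace q : ℤ) : ZMod (p ^ M)) * φ J) ∧ (∀ q : ℕ, q.Prime → q ∣ Nplus → ∀ J ∈ RI,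
      ∑ᶠ J' ∈ {J' : Submodule ℤ (QuaternionAlgebra ℚ a 0 b) | J' ≤ J ∧
      J'.toAddSubgroup.relIndex J.toAddSubgroup = q ^ 2 ∧ (∀ y ∈ J', ∀ x ∈ O, y * x ∈ J') ∧ ¬ (∀ x ∈
      J', ∀ t ∈ O₁, (∀ y ∈ O₁, t * y ∈ O₂) → ∃ z ∈ J * Submodule.span ℤ (O₁ : Set (QuaternionAlgebra
      ℚ a 0 b)), x * t = (q : ℤ) • z)}, φ J' = ((W.frobeniusTrace q - 1 : ℤ) : ZMod (p ^ M)) * φ J)) ∧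
      (I ∈ RI ∧ (∀ x : NumberField.RingOfIntegers K, ∀ y ∈ I, ψ (x : K) * y ∈ I) ∧ (∀ x : K, (∀ y ∈
      I, ψ x * y ∈ I) → ∃ z : NumberField.RingOfIntegers K, (z : K) = x) ∧ (∀ 𝔞 : ClassGroup
      (NumberField.RingOfIntegers K), ClassGroup.mk0 (rep 𝔞) = 𝔞))) →
      ((p : ZMod (p ^ M)) ^ (∑ q ∈ C, depth W p q)) ∣ (∑ 𝔞 : ClassGroup (NumberField.RingOfIntegers
      K), φ (Submodule.span ℤ ((fun x : NumberField.RingOfIntegers K => ψ (x : K)) '' ((rep 𝔞 :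
      nonZeroDivisors (Ideal (NumberField.RingOfIntegers K))) : Ideal (NumberField.RingOfIntegers
      K))) * I))

/-- S∂ with `C = ∅` is automatic (sanity: the carrier sum is the only content; real proof). [cite: Kim2024, Thm. 5.23 (unfolding)] -/
theorem toricPeriodCarrierDepth_empty_trivial (W : WeierstrassCurve ℚ) [W.IsGloballyMinimal] (p M : ℕ)
    (x : ZMod (p ^ M)) : ((p : ZMod (p ^ M)) ^ (∑ q ∈ (∅ : Finset ℕ), depth W p q)) ∣ x := by
  simp

/-! ## §5 (rev 3; rev 7 adds PROPOSITION P⁺; rev 8 records KIT-T‴ — the first discriminating row — and anchor (c)) ADDITIVITY OBSTRUCTION — why «max + 1» (S3) does not iterate to «sum» in the RING, what exactly remains, and (rev 7) why the ELEMENT `η` lands in the product anyway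

Notation (clean level `N`, `𝔪` the non-Eisenstein maximal ideal of `ρ̄ = E[p]`, `T = T_{N,𝔪}` the full Hecke algebra, two split
carriers `ℓ₁, ℓ₂`, both ♭ and `≠ p` for simplicity): `xᵢ := U_{ℓᵢ} − 1 ∈ T` (acts as `αᵢ − 1` on `ℓᵢ`-old members, as `0` on split
Steinberg members), `yᵢ := n_{ℓᵢ}` the universal monodromy generator (`0` on `ℓᵢ`-old members, `ord = nᵢ(h)` at a member Steinberg at
`ℓᵢ`), `Iᵢ = ker(T → T_{N/ℓᵢ,𝔪}) = yᵢT`, `Jᵢ = ker(T → T^{ℓᵢ-new}) = xᵢT` (F1 ×2 + F2), and the BI-KERNEL ideal `𝔞ᵢ := xᵢT + Iᵢ =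
(xᵢ, yᵢ)T`, whose quotient `Cᵢ := T/𝔞ᵢ` is the (finite, Artinian — no characteristic-zero point has `αᵢ = 1` exactly, Weil bound)
LEVEL-RAISING CONGRUENCE ALGEBRA at `ℓᵢ`.  Facts, each print-composite exactly as S2: (W) `η ∈ 𝔞₁ ∩ 𝔞₂` (F5 + F9: on `ℓᵢ`-old
members `λ_h(η_N) = λ_h(U_{ℓᵢ}⁻¹ xᵢ)·λ_h(η̂ᵢ)` with `η̂ᵢ` any lift of `η_{N/ℓᵢ}`, so `η − U_{ℓᵢ}⁻¹xᵢη̂ᵢ ∈ Iᵢ`); (V) for a member `h`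
Steinberg at `ℓᵢ`, `λ_h(xᵢ) = 0` and `λ_h(Iᵢ) ⊆ 𝔭^{nᵢ(h)}` (`ρ_h mod 𝔭^{nᵢ(h)}` is unramified at `ℓᵢ`, so `λ_h mod 𝔭^{nᵢ(h)}` factors
through `R_{Σ∖ℓᵢ} = T_{N/ℓᵢ,𝔪}`: F1 at `N/ℓᵢ`).  KERNEL ANCHORS (this section's two lemmas, PROVED, pure commutative algebra):
`map_mem_pow_max_of_mem_inf` — (W)+(V) give `ord λ_f(η) ≥ max(n₁, n₂)` («congruences see MAX»); `map_mem_pow_add_of_mem_mul` —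
`η ∈ 𝔞₁·𝔞₂` would give `ord λ_f(η) ≥ n₁ + n₂` («SUM» = full two-carrier additivity = C_cc on clean two-carrier levels, BSD-predicted).
S3 sits strictly between: `η ∈ x₁T + y₁𝔪_T` (`max + 1`); SUM is `η ∈ x₁T + y₁𝔞₂` (S3⁺ below).

PROPOSITION (NO-GO; sketch under the patching axioms (P1)–(P3), hypotheses exact, not kernel-checked).  (P1) `T = A/𝔰` with
`A = (R₁ ⊗̂ R₂ ⊗̂ R′)⟦t₁,…,t_g⟧`, `Rᵢ = 𝒪⟦xᵢ, yᵢ, zᵢ,…⟧/(xᵢyᵢ)` the framed «unramified-or-Steinberg» ring at the ♭ prime `ℓᵢ ≢ ±1`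
(two formally smooth branches crossing normally; Taylor 2008 §3, Shotton 2016), `R′` Cohen–Macaulay (minimal primes and framings formally smooth;
the ordinary factor at `p ∥ N` is the CI node of R5.5 (i) — CM, complete intersection, NOT formally smooth; rev 6 fold); (P2) `𝔰 = (s₁,…,s_h)` with `h = dim A − 1` (the Taylor–Wiles–Kisin numerical
coincidence; `T` finite flat over `𝒪`, so `𝔰` is `A`-regular, `A` being Cohen–Macaulay); (P3) `𝔞ᵢ = (xᵢ, yᵢ)T` as above, `Rᵢ/(xᵢ,yᵢ)`
formally smooth.  THEN `ℓ_𝒪((𝔞₁ ∩ 𝔞₂)/(𝔞₁𝔞₂)) = ℓ_𝒪(T/(𝔞₁ + 𝔞₂)) ≥ 1`.  PROOF SKETCH: `(𝔞₁∩𝔞₂)/𝔞₁𝔞₂ ≅ Tor₁^T(C₁, C₂)`; `A₂ := A/(x₂,y₂)A`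
is CM of dimension `h` and `A₂/𝔰 = C₂` is Artinian, so `𝔰` is a system of parameters of `A₂`, hence `A₂`-regular, hence
`Tor^T_•(C₁, C₂) = Tor^A_•(C₁, A₂)`; `A` is `R₂`-flat and `A₂ = A ⊗_{R₂} R₂/(x₂,y₂)`, so this is `Tor^{R₂}_•(C₁, R₂/(x₂,y₂))`; resolve
`C₁ = A₁/𝔰A₁`, `A₁ := A/(x₁,y₁)A` (`R₂`-flat, CM of dimension `h`, `𝔰` again a system of parameters) by the Koszul complex `K(𝔰; A₁)`:
`Tor^{R₂}_1(C₁, R₂/(x₂,y₂)) = H₁(K(𝔰̄; Ā))` with `Ā := A/(x₁,y₁,x₂,y₂)A` Cohen–Macaulay of dimension `h − 1` and `𝔰̄` = `h` elements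
generating an ideal of finite colength (`Ā/𝔰̄ = T/(𝔞₁+𝔞₂)`, nonzero since `xᵢ, yᵢ ∈ 𝔪_T`); depth sensitivity of Koszul homology
(`h` elements, grade `h − 1`) gives `H₁ ≠ 0`, and after a general recombination making `s̄₁,…,s̄_{h−1}` `Ā`-regular,
`H₁ ≅ (0 :_B s̄_h)` in the Artinian `B = Ā/(s̄₁,…,s̄_{h−1})`, of length `ℓ(B/s̄_hB) = ℓ(T/(𝔞₁+𝔞₂))` ∎.  READING: the «double
congruence length» `δ₁₂ := ℓ(T/(𝔞₁+𝔞₂))` is POSITIVE on every clean two-carrier level, so INTERSECTION ≠ PRODUCT always: no property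
of the RING `T_𝔪` (complete intersection, Gorenstein, node-principal inertia ideals, `R = T` at all four levels, recursive S2) turns
«max» into «sum» — CORES-DIAGNOSIS §3(a) «congruences see max, not sum» is a THEOREM-SHAPED obstruction, not a deficiency of
technique.  (A monogenic CI toy — `T = ℤ₅[X]/(X(X−25)(X−5)(X−10))`, members `f, g₁, g₂, g` at the roots `0, 25, 5, 10`,
`y₁ = (X−5)(X−10)`, `y₂ = (X−25)(X−10)`, `x₁ = X(X−25)`, `x₂ = X(X−5)`, depths `n₁(f) = 2`, `n₂(f) = 3` — realises
`ord λ_f(η) = 4 = max + 1 < 5 = sum` with every constraint (W), (V), S2 at the lower levels and node-principality satisfied: S3 is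
SHARP among ring-level consequences; the toy violates (P2) — its relative cotangent dimension is `1 < 2` — so it says nothing against
the patching route, which the Proposition closes instead.)

WHAT REMAINS (rev 3; the residual of the whole Hecke-additivity family «oldprod5» (c) ∕ «twpatch5» S2 step (ii) ∕ this line's
«iterate»): the ADDITIVITY OBSTRUCTION CLASS `ob(η) :=` image of `η` in `(𝔞₁∩𝔞₂)/𝔞₁𝔞₂ ≅ Tor₁^{T_𝔪}(C₁, C₂)` (an `𝒪`-module of length
`δ₁₂`), a property of the POSITION of the winding element, BSD-free and finite.  Using `I₁₂ := ker(T → T_{N/ℓ₁ℓ₂,𝔪}) = y₁T + y₂T`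
(`R = T` at `N/ℓ₁ℓ₂`) and (W) at level `N/ℓ₁`, one may take `η̂₁ ∈ x₂T + I₁₂`, whence `η = x₁x₂c + x₁y₂e + y₁b` with the first two
terms in `𝔞₁𝔞₂`: ALL of `ob(η)` sits in this line's cofactor `b`.  TARGET S3⁺ (COFACTOR IN THE CONGRUENCE ALGEBRA; untyped — no `T_𝔪` in
the tree; BSD ∕ Bloch–Kato-consistent at every member): the image `b̄` of `b` in `C₂ = T_𝔪/(U_{ℓ₂} − 1, n_{ℓ₂})` lies in `(U_{ℓ₁} − 1)·C₂`;
equivalently (Gorenstein double annihilator in the Artinian CI `C₂`) `b̄ · ann_{C₂}(x₁) = 0`, where `b̄·y₁ = 0` is AUTOMATIC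
(`y₁b = η − x₁U⁻¹η̂₁ ∈ 𝔞₂`) and the content is `b̄ · (ann_{C₂}(x₁) ⁄ y₁C₂) = 0` — the excess annihilator created when the node at `ℓ₁`
is cut by the `ℓ₂`-congruence.  S3 proves `b̄ ∈ 𝔪_{C₂}`; S3⁺ ⟹ `ord_p(L(E,1)/Ω_E) ≥ n_{ℓ₁} + n_{ℓ₂}` (two-carrier C_cc in full, any
depths) by `map_mem_pow_add_of_mem_mul`.  KIT-T — RUN (rev 6; REF g31 ENGINE R-T, REF-AUDIT §ZH 2026-08-30T03:16:55Z, evidence #57 `REF-g31-ZH-KIT-T.md`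
657d901ec0e0141d on 20614; PARI/GP 2.17.3 `msinit`, exact linear algebra over `ℤ/p²⁰`, script `kitT4.gp` 207 lines; kit jobs j337939 ∕
j337959 ∕ j337940 ∕ j337958, stdout sha16 1713cc92d03448e0 ∕ f5f315cd4a42741a ∕ 90911d4b3a55d1f7 ∕ b07fadb83e7b06bc; the rev-5 text asked
for «Magma ∕ Sage, not run — kit 0 at this seat»).  FIVE synthetic clean two-carrier levels `N = M·ℓ₁·ℓ₂` (base `F` = 43a, 53a, 83a,
67a, 69a; `ε_F = −1, −1, −1, +1, +1`): `1978 = 43·2·23`@5, `2703 = 53·3·17`@7, `3237 = 83·3·13`@5, `7973 = 67·7·17`@5, `6279 = 69·7·13`@5;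
`r = rk T_𝔪 = 5, 4, 6, 7, 6`; at 5∕5 levels: multiplicity one, `T_𝔪` Gorenstein, `𝔪` new at every `q ∣ M`, inertia ideals `I₁, I₂`
PRINCIPAL (`ν = 1`; the line's node-principality, observed in the full `T_𝔪`), (W) `η ∈ 𝔞₁ ∩ 𝔞₂`, the Proposition's identity
`ℓ((𝔞₁∩𝔞₂)/𝔞₁𝔞₂) = δ₁₂ = 1` (obstruction group `≅ ℤ/p`, NON-ZERO — the test is not vacuous), the S3-shape `η ∈ xᵢT + 𝔪Iᵢ`, AND
**`ob(η) = 0` — `η ∈ 𝔞₁𝔞₂`, the S3⁺-shape `η ∈ x₁T + I₁𝔞₂` (both orders) — at ALL FIVE levels** (uniform null: `(1/5)⁴·(1/7) ≈ 2·10⁻⁴`);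
`η ∈ 𝔪`, `η ∉ 𝔪(𝔞₁∩𝔞₂)`, `η ∉ I₁ + I₂` 5∕5; `ℓ(T/ηT) ≡ K·z + 2` with `z` = the members of root number `−1` (forced zeros to precision
`p^K`) and total `η`-depth 2 on the rest.  VERDICT (REF): KIT-T EXECUTED — NO KILL; S3⁺ CORROBORATED, not proved; it stays the UNTYPED
research target (no `T_𝔪` in the tree); the typed stubs are untouched; nothing closes.  CAVEATS (REF's, endorsed): every level has
`p ∤ N` and `δ₁₂ = 1`; computational (not kernel-checked); member table self-consistent but not cross-checked against an independent
newform decomposition.  READING FOR THE DECOMPOSITION (rev 6): with a base of Hecke rank one `δ₁₂ = min(n₁, n₂)` (`nᵢ = v_p(a_{ℓᵢ}(F)² −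
(ℓᵢ + 1)²)`), so all five levels are MIN-DEPTH-ONE congruence levels — the shape of RUNG (B), where the typed S3 («max + 1») already
equals the sum; the research content of S3⁺ begins at `δ₁₂ ≥ 2` (min-depth `≥ 2` = the two-carrier part of S5 `OffRungResidual`), and the
line's own regime has `p ∥ N` with the singular ordinary local factor (R5.5 (i)).  Hence the two NEXT ROWS (BSD-free, same engine;
designed, NOT requested — kit 0 at this seat): KIT-T′ = a clean level with BOTH level-raising congruences of depth `≥ 2` (`a_{ℓᵢ}(F) ≡
±(ℓᵢ + 1) mod p²`, i.e. `δ₁₂ ≥ 2`; REF §ZH add. 1 is already scanning — `scan2.gp`, `14467 = 17·23·37`@5 job j338011, `17119 = 19·17·53`@7):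
report `δ₁₂`, `ℓ((𝔞₁∩𝔞₂)/𝔞₁𝔞₂)`, `ob(η)`, and `b̄ ∈ C₂` against `(U_{ℓ₁} − 1)C₂`; KIT-T″ = the `p ∥ N` REGIME: base `F` of level `M = p·M′`
ORDINARY at `p` (`a_p(F) = ±1`), `ρ̄` irreducible, two ♭ split-sign raising primes, `U_p` among the generators of `T_𝔪` (the F1″-ord
algebra) — does the identity `ℓ((𝔞₁∩𝔞₂)/𝔞₁𝔞₂) = δ₁₂` persist when the local factor at `p` is the CI node (the rev-6 fold of the
Proposition uses only Cohen–Macaulayness and predicts YES), and is `ob(η)` still `0`?  Seeds to filter (irreducible, ordinary, sign):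
`(M, p) ∈ {(14, 7), (21, 7), (42, 7), (15, 5), (35, 5), (55, 5), (70, 5)}`.  As before, `ob(η) ≠ 0` at ONE level kills S3⁺ and every «sum»
mechanism of this family at once (the typed stubs S2–S5, being consequences of BSD, survive; the LINE would then be capped at «max + 1»);
`ob(η) = 0` persisting through KIT-T′ and KIT-T″ would make S3⁺ («the winding element lies in the PRODUCT of the two level-raising
bi-kernel ideals») a conjecture worth typing once a `T_𝔪` interface exists.

REV 7 (g36).  KIT-T FAMILY RECORD (REF g31 §ZH + add. 1, §ZJ (5), §ZJ add. 1; TURNKEY text) — ARCHIVED VERBATIM in `Lines/monogen5-revlog.md`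
§L2 (rev 15).  Summary kept here: KIT-T (♭ second carrier) `ob(η) = 0` at 9 ∕ 9 (1978@5, 2703@7, 3237@5, 7973@5, 6279@5, 14467@5, 1155@7,
13685@5, 17119@7); KIT-Tⁿ (second carrier `= p`, the CI node at `p`) `ob(η) = 0` at 4 ∕ 4 (430@5, 1590@5, 4945@5, 7259@7), `ν(I_p) = ν(I_{ℓ₁}) = 1`;
FAMILY 16 levels, 0 kills, every `δ₁₂ = 1`, obstruction group `≅ ℤ/p` each, `T_𝔪` two-generated, `H₁⁺_𝔪` one-generated 16 ∕ 16.  WHAT IS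
TESTED AT `δ₁₂ = 1`: in the minimal model `T = ℤ_p[x₁,x₂]/(x₁(x₁−α₁), x₂(x₂−α₂))`, `v(αᵢ) = nᵢ`, GIVEN (W) one has `η ∈ 𝔞₁𝔞₂ ⇔
v_p(λ_N(η)) ≥ n₁ + n₂`, while the S3-shapes give `≥ max + 1`; these coincide iff `δ₁₂ = min(n₁,n₂) = 1`.  VERDICT OF RECORD: the typed S3
(«max + 1») is CORROBORATED 16 ∕ 16 beyond (W); the S3⁺ «sum» increment is UNTESTED (needs `δ₁₂ ≥ 2`, first clean instance `ψ(N) = 173184`).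
PROPOSITION P⁺ (PATCHED WINDING ELEMENT; SKETCH, print-composite — memo `MECHANISM-patched-winding-element-g36.md` P⁺1–P⁺7, engine text twpatch5
REV 3 S2 (ii′); hypotheses: clean level, every split carrier ♭ or `= p`, `𝔪` of Taylor–Wiles type, multiplicity one).  `t_η ∈ ∏ᵢ 𝔞ᵢ ⊂ T_𝔪`
(`𝔞ᵢ = (U_{ℓᵢ} − 1, Iᵢ)`, any number `k` of carriers); hence `ord λ_f(η) ≥ Σ_{i : f new at ℓᵢ} nᵢ(f) + Σ_{i : f old at ℓᵢ} v(αᵢ(f) − 1)` at every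
member and `ord_p(L(E,1)/Ω_E) ≥ v_p∏c_ℓ` for the curve.  WHY THIS DOES NOT CONTRADICT THE NO-GO: annihilators and intersections do not descend
along `R_∞ ↠ T_𝔪 = R_∞/𝔰` — ELEMENTS do.  Upstairs, with `𝔄ᵢ := (αᵢ − 1) + 𝔫ᵢ ⊂ R^□_{ℓᵢ}` (`𝔫ᵢ = ker(R^□ → R^{□,ur})`, `αᵢ` the Hensel
root `≡ 1` of Frobenius — defined as `ℓᵢ ≢ 1 (mod p)` — mapping to `U_{ℓᵢ}` on old and new members alike), the `𝔄ᵢ` generate ideals in DISTINCT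
tensor factors of `R_∞ = (⊗̂ᵢ R^□_{ℓᵢ} ⊗̂ R′)⟦x⟧` with `𝒪`-flat quotients, so `Tor₁ = 0` and `⋂ᵢ 𝔄ᵢR_∞ = (∏ᵢ𝔄ᵢ)R_∞` (polynomial shadow: twpatch5
REV 3 `biKernelTransversality`, PROVED); the winding elements `η_n` exist at every TW level and satisfy (W) there (`(π₁₊,π₂₊)η = (η′,η′) =
(U_ℓ − 1)(0,−η′)`, `U(a,b) = (T_ℓa − b, ℓa)`, + dual Ihara: Ribet 1984; Diamond–Ribet at `ℓ = p`); patching the pointed data `(M_n, η_n, M_n ↠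
M_n^{ℓᵢ-old})` gives `η_∞ ∈ M_∞ ≅ R_∞` with `η_∞ ∈ ⋂ᵢ 𝔄ᵢM_∞` because the patched old-kernel is `𝔫ᵢM_∞` (free rank one ↠ full support over the
reduced `R_∞/𝔫ᵢ` ⇒ iso; downstairs the descent uses only image(`𝔫ᵢ`) `⊆ Iᵢ` — A1: `ℓᵢ`-old forms are unramified at `ℓᵢ` — equality `𝔫ᵢT = Iᵢ` by F1 at
`N/ℓᵢ` being true but surplus (rev 8 fold of idea-crit-10 V#174 N-g8-2)); reduce mod `𝔰`: `η ∈ (∏𝔞ᵢ)M` (twpatch5 REV 3 `membership_descends`, PROVED) = `ob(η) = 0`,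
PREDICTED AT EVERY CLEAN LEVEL regardless of `δ₁₂` and of the number of carriers (16 ∕ 16 observed — all at `δ₁₂ = 1`, where it is also what the
typed S3 gives: P⁺ is CONSISTENT with the record and its surplus is what KIT-T‴ ∕ KIT-T′ would test); value at the Tate point: `λ_E(𝔄ᵢ) = (a_{ℓᵢ}(E) − 1, λ_E(𝔫ᵢ)) = (ord q_E) =
p^{nᵢ}ℤ_p` (Kummer; at `ℓᵢ = p` via finite flatness of `E[p^m]` for `p^m ∣ v_p(q_E)` and the flat component of Kisin's ring = Snowden's node).
NOT VERBATIM IN PRINT (audit asked): patching marked elements with the old-quotient maps; `K_{i,∞} = 𝔫ᵢM_∞` at `p ∥ N` TW-but-not-big image;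
the `ℓ = p` factor; `p = 5` constants.  COVERAGE IF IT HOLDS: S2, S3, S3⁺ and the CLEAN part of S5 (the «two-carrier ceiling» of S5's
docstring is then lifted on clean levels); silent at trivial primes (S4♮ ∕ S4ₚ: no Hensel root at `q ≡ 1` with `ρ̄(Frob_q) = 1`) and on Ш (S6).
NEXT ROWS (BSD-free engine, BSD-consistent predictions; designed for REF, not requested — kit 0).  KIT-T‴ — THE DISCRIMINATING FEASIBLE ROW: a
clean THREE-carrier level at depths (1,1,1) (e.g. `1978·ℓ₃`@5 or `430·ℓ₃`@5 with `ℓ₃ ≡ 2, 3 (mod 5)`, `a_{ℓ₃}(43a) ≡ ℓ₃ + 1`; `ψ = 3168(ℓ₃+1)` resp.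
`792(ℓ₃+1)`): P⁺ says `η ∈ 𝔞₁𝔞₂𝔞₃`, so `v_p(λ_N(η)) ≥ 3` at the member new at all three carriers, whereas (W) + the typed S3 give only `max + 1 = 2` —
`ob₃(η) ≠ 0` kills P⁺ and the whole «sum» family, the typed stubs survive.  KIT-T′ (`δ₁₂ ≥ 2`) needs the sparse engine REF describes.  Member-wise
valuations at the sixteen levels are implied at `δ₁₂ = 1` (bookkeeping, not a test).  The decisive check of P⁺ is the AUDIT of P⁺3 ∕ P⁺5 ∕ P⁺6 ∕ P⁺7
against print (asked of REF ∕ critic, no clock).  Nothing is registered or closed by this paragraph; BSD is not proved.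
REV 8 (g37).  KIT-T‴ — RUN (REF g31, REF-AUDIT §ZK; kit j338489; evidence #58 on 20614) — full record ARCHIVED VERBATIM in
`Lines/monogen5-revlog.md` §L3 (rev 15).  Summary kept here: level `9890 = 43·2·23·5`@5, CLEAN (carriers `2, 23` ♭ and `5 = p`; depths
`n₁ = 1`, `n₂ = 2`, `a₅ ≡ 1`), multiplicity one ✓, Gorenstein ✓, inertia ideals `I₂`, `I₂₃`, `I₅` all PRINCIPAL; `η ∈ ⋂𝔞ᵢ` ✓ and
**`η ∈ 𝔞₂𝔞₂₃𝔞₅` — `ob₃(η) = 0`**; all eight member types inhabited; the triply-new member has **`v₅(λ_{g_nnn}(t_η)) = 3 = 1 + 1 + 1`**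
where (W) + the typed S3 give only `≥ max + 1 = 2` — THE FIRST DISCRIMINATING ROW, siding with «SUM» ∕ P⁺.  PREDICTION 3 (member-wise
`v(λ_g(t_η)) ≥ Σ_{new} nᵢ(g) + Σ_{old} v(αᵢ(g) − 1)`): seventeen single-member values — 15 equalities, 2 above the bound by one (the type-`N`
members of 14467@5 ∕ 13685@5), NONE below; REF's BSD-free ramification cross-examination verify3: 2 ∕ 2 sharp hits (`e = 2, f = 1`; `e = 3, f = 1`).
FAMILY: 17 levels, 0 kills.  REF's AUDIT POINTS (f) ♭ invertibility in P⁺5's old-quotient identification, (g) `M = T·γ` + «no `p`-isogeny on U5»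
in P⁺7, (h) PREDICTIONS 1–2 are falsifiers of the sketch itself — adopted in §4b; the `ℓ = p` item (c′) (`𝔫_p|_{X_st}` = the ordinary coordinate;
Snowden §4) is THE print item to check; SHADOW (s2) `Kᵢ = IᵢM` holds at all 17 levels and is automatic from `M ≅ T`, so P⁺5's BSD-free content is
UPSTAIRS (`K_{i,∞} = 𝔫ᵢM_∞`).  REF §ZL CONCURS PASS on REV 7; nits N-g31-3 ∕ N-g31-4 folded.  Nothing is registered or closed; BSD is not proved.
[cite: DiamondCSS1997, Thm. 6.1] [cite: KisinModuli2009, (3.4.12)] [cite: Taylor2008, §3] [cite: Shotton2016LocalDeformationRings, Thm. 1]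
[cite: Ribet1984ICM, Ihara's lemma] [cite: DiamondTaylor1994, Thm. A] [cite: Snowden2018Singularities, §4] [cite: KimOta2019CongruenceIdeals, Thm. 1.3, Rem. 1.17]
[cite: RibetTakahashi1997, Thm. 1] [cite: BoeckleKhareManning2024, §1] -/

/-- §5 kernel anchor (a): the INTERSECTION of the two bi-kernel ideals only gives the MAX.  If `η ∈ 𝔞₁ ⊓ 𝔞₂` with
`𝔞ᵢ = (xᵢ) ⊔ Iᵢ`, `λ(xᵢ) = 0` and `λ(Iᵢ) ≤ P ^ nᵢ`, then `λ(η) ∈ P ^ max n₁ n₂`.  Pure commutative algebra (the shape of (W)+(V) ⟹ S2 at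
the deeper carrier). [folklore] -/
theorem map_mem_pow_max_of_mem_inf {T S : Type*} [CommRing T] [CommRing S] (lam : T →+* S) (P : Ideal S)
    (x₁ x₂ η : T) (I₁ I₂ : Ideal T) (n₁ n₂ : ℕ)
    (hx₁ : lam x₁ = 0) (hx₂ : lam x₂ = 0)
    (hI₁ : I₁.map lam ≤ P ^ n₁) (hI₂ : I₂.map lam ≤ P ^ n₂)
    (hη : η ∈ (Ideal.span {x₁} ⊔ I₁) ⊓ (Ideal.span {x₂} ⊔ I₂)) :
    lam η ∈ P ^ (max n₁ n₂) := by
  have key : ∀ (x : T) (I : Ideal T) (n : ℕ), lam x = 0 → I.map lam ≤ P ^ n →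
      (Ideal.span {x} ⊔ I).map lam ≤ P ^ n := by
    intro x I n hx hI
    rw [Ideal.map_sup, Ideal.map_span, Set.image_singleton, hx, Ideal.span_singleton_zero, bot_sup_eq]
    exact hI
  have h1 : lam η ∈ P ^ n₁ := key x₁ I₁ n₁ hx₁ hI₁ (Ideal.mem_map_of_mem lam hη.1)
  have h2 : lam η ∈ P ^ n₂ := key x₂ I₂ n₂ hx₂ hI₂ (Ideal.mem_map_of_mem lam hη.2)
  rcases le_total n₁ n₂ with h | h
  · rw [max_eq_right h]; exact h2
  · rw [max_eq_left h]; exact h1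

/-- §5 kernel anchor (b): the PRODUCT of the two bi-kernel ideals gives the SUM.  If `η ∈ 𝔞₁ * 𝔞₂` with `𝔞ᵢ = (xᵢ) ⊔ Iᵢ`,
`λ(xᵢ) = 0` and `λ(Iᵢ) ≤ P ^ nᵢ`, then `λ(η) ∈ P ^ (n₁ + n₂)` — the bookkeeping behind «S3⁺ ⟹ two-carrier additivity».
Pure commutative algebra. [folklore] -/
theorem map_mem_pow_add_of_mem_mul {T S : Type*} [CommRing T] [CommRing S] (lam : T →+* S) (P : Ideal S)
    (x₁ x₂ η : T) (I₁ I₂ : Ideal T) (n₁ n₂ : ℕ)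
    (hx₁ : lam x₁ = 0) (hx₂ : lam x₂ = 0)
    (hI₁ : I₁.map lam ≤ P ^ n₁) (hI₂ : I₂.map lam ≤ P ^ n₂)
    (hη : η ∈ (Ideal.span {x₁} ⊔ I₁) * (Ideal.span {x₂} ⊔ I₂)) :
    lam η ∈ P ^ (n₁ + n₂) := by
  have key : ∀ (x : T) (I : Ideal T) (n : ℕ), lam x = 0 → I.map lam ≤ P ^ n →
      (Ideal.span {x} ⊔ I).map lam ≤ P ^ n := by
    intro x I n hx hI
    rw [Ideal.map_sup, Ideal.map_span, Set.image_singleton, hx, Ideal.span_singleton_zero, bot_sup_eq]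
    exact hI
  have hprod : ((Ideal.span {x₁} ⊔ I₁) * (Ideal.span {x₂} ⊔ I₂)).map lam ≤ P ^ (n₁ + n₂) := by
    rw [Ideal.map_mul, pow_add]
    exact Ideal.mul_mono (key x₁ I₁ n₁ hx₁ hI₁) (key x₂ I₂ n₂ hx₂ hI₂)
  exact hprod (Ideal.mem_map_of_mem lam hη)

/-- §5 kernel anchor (c) (rev 8 — the `k`-carrier bookkeeping behind PROPOSITION P⁺ and KIT-T‴'s `3 = 1 + 1 + 1`): the PRODUCT of finitely many
ideals gives the SUM.  If `η ∈ ∏_{i ∈ s} 𝔞ᵢ` and `λ(𝔞ᵢ) ≤ P ^ nᵢ` for `i ∈ s`, then `λ(η) ∈ P ^ (Σ_{i ∈ s} nᵢ)`.  Pure commutative algebra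
(`Ideal.map_mul` iterated). [folklore] -/
theorem map_mem_pow_sum_of_mem_prod {T S ι : Type*} [CommRing T] [CommRing S] (lam : T →+* S) (P : Ideal S)
    (s : Finset ι) (𝔞 : ι → Ideal T) (n : ι → ℕ)
    (h𝔞 : ∀ i ∈ s, (𝔞 i).map lam ≤ P ^ n i) {η : T} (hη : η ∈ ∏ i ∈ s, 𝔞 i) :
    lam η ∈ P ^ (∑ i ∈ s, n i) := by
  classical
  have key : ∀ (u : Finset ι), (∀ i ∈ u, (𝔞 i).map lam ≤ P ^ n i) →
      (∏ i ∈ u, 𝔞 i).map lam ≤ P ^ (∑ i ∈ u, n i) := by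
    intro u
    induction u using Finset.induction_on with
    | empty =>
      intro _
      simp only [Finset.prod_empty, Finset.sum_empty, pow_zero, Ideal.one_eq_top, Ideal.map_top, le_refl]
    | insert a u ha ih =>
      intro h
      rw [Finset.prod_insert ha, Finset.sum_insert ha, Ideal.map_mul, pow_add]
      exact Ideal.mul_mono (h a (Finset.mem_insert_self a u)) (ih fun j hj => h j (Finset.mem_insert_of_mem hj))
  exact key s h𝔞 (Ideal.mem_map_of_mem lam hη)

end Summit.BirchSwinnertonDyer.BirchSwinnertonDyer.Cruxes.UpperNonSurjFive.MonoGen
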